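import Summits.ValiantsHypothesis.ValiantsHypothesis.Theorems.NewtonUnitEquationsTwoProductsMomentRecordDefs

/-!
# val-idea-37 (g4) — TOWER RECORD LEMMA (refinement of K11 `dvr-collapse-records` for towers of height `D`)

Scratch for crux `stmt-ValiantsHypothesis-5906` (`TwoProducts`).  VP ≠ VNP is NOT proved; nothing here is a tree write or a claim.

MODEL.  Letters `x_i + e•d` (`0 ≤ e ≤ D`) — a TOWER of height `D` along one direction `d ∈ ℤ²` on each carrier `x_i`;
the letter pencils are arbitrary polynomials `γ_{j i} ∈ ℂ[z]` of degree `≤ D` (`[z^e] γ_{j i}` = coefficient of the letter `x_i + e d`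
in factor `j`); `M(S) = Σ_j Π_i γ_{j i}^{S_i}`, `L_k(S) = [z^k](M_u(S) − M_v(S))` (`layerT`), the pair `(S, k)` sits at `S•x + k•d`.
`D = 1` is W3/R12 (`momentPoly`, `layer`).  A RECORD for a real weight `ξ` is a live shallow pair strictly heavier than every other.

THE LEMMA (K2-valued, `towerRecordLemma`, PROVED): if `(S, k)` is a record for `ξ`, `a ∈ supp S`, and `P·π_a = Σ_{b ≠ a} Q_b·π_b` is a
POLYNOMIAL relation among the pencil vectors `π_b = (γ_{j b})_j ∈ ℂ[z]^{2m}` with a marked index `s₀`, `P.coeff s₀ ≠ 0`, such that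
`(s₀ − s)·(ξ·d) ≥ 0` for `s ∈ supp P` and `ξ·x_b − ξ·x_a + (s₀ − s)·(ξ·d) ≥ 0` for `s ∈ supp Q_b` — then `False`.
(`s₀ = deg P` when `ξ·d > 0`, `s₀ = ord P` when `ξ·d < 0`: a VALUED relation, valuation `−deg` resp. `ord_0`; proof = extract
`[z^{k+s₀}]` of `P·ΔM(S) = Σ_b Q_b·ΔM(S − e_a + e_b)`: every competing pair is distinct from `(S,k)` and not lighter, hence dead.)
K1 (exchange, `card_cellLettersT_le`, PROVED): among any `2m+1` carriers a Siegel dependence `Σ λ_b π_b = 0`, `deg λ_b ≤ 2mD`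
(dimension count `(2m+1)(L+1) > 2m(L+D+1)`), and the `argmin` of `ξ·(x_b − ν_b d)` (`ν = deg` or `ord`) has a valued relation:
so AT MOST `2m` RECORD CARRIERS per cell of the arrangement `{ξ·(x_a − x_b + j d) = 0 : |j| ≤ 2mD} ∪ {ξ·d = 0}`; `k ∈ {kmax S, kmin S}`;
COUNT (`towerRecordCount`, PROVED): `#records ≤ 64·(n²(4mD+1)+3)·(m+1)·2^{3m}` — LINEAR in the tower height `D`
(the shift-rank engine pays `2m(D+1)` letters and `D^{m}` in the count); LAW (`towerRecordLaw_holds : TowerRecordLaw`, PROVED):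
`#records ≤ 2^{18 m} (t+2)² (D+1)` whenever `n ≤ 2mt` (no dissociation, no sign, no sparsity hypothesis is needed on the coefficient side).
SCOPE (honest): this is the COEFFICIENT-SIDE law; the transfer to a CLASS rung needs carrier-dissociation to depth `(m, mD)`
(`(S,k) ↦ S•x + k•d` injective on shallow pairs), i.e. PARALLEL towers on dissociated carriers — NOT the collinear digit towers of F10.
SPARSE LEVELS (§10, rev 2, answer to crit-8 VERDICT #19 (ii)): the height `D` enters ONLY through the differences `ν_a − ν_b` of the
Siegel multipliers; with pencil levels in a sparse set `E` the multipliers may be supported on any EXCHANGE SET `Λ` with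
`2m|Λ+E| < (2m+1)|Λ|` (`siegel_dependence_supp`), the arrangement is indexed by `J ⊇ Λ − Λ`, and `#records ≤ 64(n²|J|+3)(m+1)2^{3m}`
(`towerRecordCountG`).  THREE LEVELS `{0,1,H}` (`threeLevelRecordLaw_holds : ThreeLevelRecordLaw`, PROVED, `(a,b) = (23,2)`):
`#records ≤ 2^{23m}(t+2)²` for EVERY height `H` (`Λ = {a + bH : a,b ≤ 4m+1}`, `|J| ≤ (8m+3)²`).  ANY `ℓ` LEVELS (§10b,
`sparseLevelRecordLaw_holds : 1 ≤ ℓ → SparseLevelRecordLaw ℓ`, PROVED, `a(ℓ) = 4ℓ²+10ℓ+16`, `b = 2`): iterated sumsets `C·E`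
(`|C·E| ≤ (C+1)^{|E|}`) + pigeonhole (`slow_step`, `C₀ = 8ℓ²m²`) ⇒ `#records ≤ 64(n²C₀^{2ℓ}+3)(m+1)2^{3m}`, height-free.  Residual of the coefficient side =
towers with MANY (`≫ m / log m`) levels of LARGE height (`D ≫ 2^{O(m)}·poly t`) — F10's digit towers — plus collinear fibre lumping.
LEVEL-FREE (§11–§12, rev 4–5, crit-8's Q-R13 — ALL PROVED, 0 sorry): CRAMER RECORD LEMMA at a `ξ`-optimal maximal minor
(`cramerRecordLemma`, `card_recordLettersAt_le`: for EVERY real weight at most `2m` record letters, for ARBITRARY pencils), then the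
SWEEP: Grassmann–Plücker symmetric exchange inside the optimal set (`gp_rows`, `opt_exchange`), the rank potential chain (`psi_chain`),
the abstract envelope walk (`envelope`, `exists_lineFamily`: along a pencil of slopes the right vertices take `≤ r(n−1)+1` values because
the vertex factors through the potential), an orthogonal frame `ξ = aν + bζ`, `ζ ⊥ d` (`exists_frame`) ⇒ `vertexWalkBound_holds :
VertexWalkBound` (`≤ 4mn+4` sets of `≤ 2m` letters cover the record letters of every weight) ⇒ `levelFreeRecordLaw_holds :
LevelFreeRecordLaw`: `#records ≤ 2^{11m}(t+2)` whenever `n ≤ 2mt`, for pencils of ANY degree with ANY level structure (the tower height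
`D` only bounds the finite window of pairs).  The coefficient side of 5906's residual is thereby CLOSED at the level of laws; what remains is
class-side (carrier dissociation / collinear fibre lumping), outside this engine.
-/

set_option linter.unusedVariables false
set_option linter.unusedSectionVars false

noncomputable section

open Classical

namespace ValIdea37g4T

open scoped BigOperators
open Module Polynomial
open Summit.ValiantsHypothesis.ValiantsHypothesis.Theorems.NewtonUnitEquations.TwoProducts.FormalLogLinearisation
open Summit.ValiantsHypothesis.ValiantsHypothesis.Theorems.NewtonUnitEquations.TwoProducts.MomentRecord
open Summit.ValiantsHypothesis.ValiantsHypothesis.Theorems.NewtonUnitEquations.TwoProducts.PlanarCell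

variable {m n : ℕ}

/-! ## 1. Tower data, records, the law -/

/-- Tower moment polynomial `Σ_j Π_i γ_{j i}^{S_i}` (pencils = arbitrary polynomials). -/
def momentPolyT (γ : Fin m → Fin n → ℂ[X]) (S : Fin n → ℕ) : ℂ[X] := ∑ j, ∏ i, γ j i ^ S i

/-- Layer `k` of the signed tower moment polynomial. -/
def layerT (γ γ' : Fin m → Fin n → ℂ[X]) (k : ℕ) (S : Fin n → ℕ) : ℂ :=
  (momentPolyT γ S - momentPolyT γ' S).coeff k

/-- All pencils have degree `≤ D` (towers of height `D`). -/
def DegLe (γ : Fin m → Fin n → ℂ[X]) (D : ℕ) : Prop := ∀ j i, (γ j i).natDegree ≤ D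

/-- Live shallow pairs: `|S| ≤ m'` and `L_k(S) ≠ 0`. -/
def liveT (γ γ' : Fin m → Fin n → ℂ[X]) (m' : ℕ) : Set ((Fin n → ℕ) × ℕ) :=
  {p | size p.1 ≤ m' ∧ layerT γ γ' p.2 p.1 ≠ 0}

/-- `(S, k)` is a RECORD for `ξ`: live and strictly heavier than every other live shallow pair. -/
def IsRecordT (γ γ' : Fin m → Fin n → ℂ[X]) (x : Fin n → Expo) (d : Fin 2 → ℤ) (m' : ℕ) (ξ : Fin 2 → ℝ)
    (p : (Fin n → ℕ) × ℕ) : Prop :=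
  p ∈ liveT γ γ' m' ∧ ∀ q ∈ liveT γ γ' m', q ≠ p → wtZ ξ (ptZ x d q.1 q.2) < wtZ ξ (ptZ x d p.1 p.2)

/-- The finite box of shallow pairs of the tower model: entries of `S` at most `m'`, `k ≤ D m'`. -/
def shallowPairsT (n m' D : ℕ) : Finset ((Fin n → ℕ) × ℕ) :=
  (Fintype.piFinset fun _ : Fin n => Finset.range (m' + 1)) ×ˢ Finset.range (D * m' + 1)

/-- **THE TOWER RECORD LAW**: records of towers of height `D` number `≤ 2^{a m} (t+2)^b (D+1)`. -/
def TowerRecordLaw : Prop :=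
  ∃ a b : ℕ, ∀ (m n t D : ℕ) (γ γ' : Fin m → Fin n → ℂ[X]) (x : Fin n → Expo) (d : Fin 2 → ℤ),
    DegLe γ D → DegLe γ' D → n ≤ 2 * m * t →
    ((shallowPairsT n m D).filter fun p => ∃ ξ : Fin 2 → ℝ, IsRecordT γ γ' x d m ξ p).card
      ≤ 2 ^ (a * m) * (t + 2) ^ b * (D + 1)

/-! ## 2. Algebra of the tower moment polynomials -/

theorem natDegree_momentPolyT_le (γ : Fin m → Fin n → ℂ[X]) (D : ℕ) (hγ : DegLe γ D) (S : Fin n → ℕ) :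
    (momentPolyT γ S).natDegree ≤ D * size S := by
  unfold momentPolyT
  refine natDegree_sum_le_of_forall_le _ _ (fun j _ => ?_)
  refine (natDegree_prod_le _ _).trans ?_
  rw [size, Finset.mul_sum]
  refine Finset.sum_le_sum fun i _ => natDegree_pow_le.trans ?_
  calc S i * (γ j i).natDegree ≤ S i * D := Nat.mul_le_mul_left _ (hγ j i)
    _ = D * S i := mul_comm _ _

theorem layerT_eq_zero_of_lt (γ γ' : Fin m → Fin n → ℂ[X]) (D : ℕ) (hγ : DegLe γ D) (hγ' : DegLe γ' D)
    {k : ℕ} {S : Fin n → ℕ} (h : D * size S < k) : layerT γ γ' k S = 0 := by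
  unfold layerT
  rw [coeff_sub, coeff_eq_zero_of_natDegree_lt ((natDegree_momentPolyT_le γ D hγ S).trans_lt h),
    coeff_eq_zero_of_natDegree_lt ((natDegree_momentPolyT_le γ' D hγ' S).trans_lt h), sub_zero]

theorem le_of_layerT_ne_zero (γ γ' : Fin m → Fin n → ℂ[X]) (D : ℕ) (hγ : DegLe γ D) (hγ' : DegLe γ' D)
    {k : ℕ} {S : Fin n → ℕ} (h : layerT γ γ' k S ≠ 0) : k ≤ D * size S := by
  by_contra hlt
  exact h (layerT_eq_zero_of_lt γ γ' D hγ hγ' (not_le.mp hlt))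

theorem prod_pow_add_single (p : Fin n → ℂ[X]) (T : Fin n → ℕ) (a : Fin n) :
    ∏ i, p i ^ (T + Pi.single a 1 : Fin n → ℕ) i = p a * ∏ i, p i ^ T i := by
  simp only [Pi.add_apply, pow_add, Finset.prod_mul_distrib]
  rw [mul_comm]
  congr 1
  rw [Finset.prod_eq_single a]
  · simp
  · intro b _ hb
    simp [hb]
  · intro h
    exact absurd (Finset.mem_univ a) h

theorem momentPolyT_add_single (γ : Fin m → Fin n → ℂ[X]) (T : Fin n → ℕ) (a : Fin n) :
    momentPolyT γ (T + Pi.single a 1) = ∑ j, γ j a * ∏ i, γ j i ^ T i :=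
  Finset.sum_congr rfl fun j _ => prod_pow_add_single (fun i => γ j i) T a

theorem size_add_single (T : Fin n → ℕ) (b : Fin n) : size (T + Pi.single b 1) = size T + 1 := by
  simp [size, Finset.sum_add_distrib, Pi.single_apply]

theorem wtZ_ptZ_add_single (ξ : Fin 2 → ℝ) (x : Fin n → Expo) (d : Fin 2 → ℤ) (T : Fin n → ℕ) (b : Fin n) (k : ℕ) :
    wtZ ξ (ptZ x d (T + Pi.single b 1) k) = wtZ ξ (ptZ x d T k) + wt ξ (x b) := by
  have h : ∀ c, ptZ x d (T + Pi.single b 1) k c = ptZ x d T k c + ((x b c : ℕ) : ℤ) := by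
    intro c
    simp only [ptZ, Pi.add_apply, Nat.cast_add, add_mul, Finset.sum_add_distrib, Pi.single_apply, Nat.cast_ite,
      Nat.cast_one, Nat.cast_zero, ite_mul, one_mul, zero_mul, Finset.sum_ite_eq', Finset.mem_univ, if_true]
    ring
  simp only [wtZ, wt, h]
  push_cast
  ring

theorem wtZ_ptZ_k (ξ : Fin 2 → ℝ) (x : Fin n → Expo) (d : Fin 2 → ℤ) (S : Fin n → ℕ) (k : ℕ) :
    wtZ ξ (ptZ x d S k) = wtZ ξ (ptZ x d S 0) + (k : ℝ) * wtZ ξ d := by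
  have h : ∀ c, ptZ x d S k c = ptZ x d S 0 c + (k : ℤ) * d c := by
    intro c
    simp [ptZ]
  simp only [wtZ, h]
  push_cast
  ring

/-- (★) a POLYNOMIAL relation `P·π_a = Σ_b Q_b·π_b` among the pencils propagates to the moment polynomials. -/
theorem momentPolyT_rel (γ : Fin m → Fin n → ℂ[X]) (a : Fin n) (P : ℂ[X]) (Q : Fin n → ℂ[X])
    (hrel : ∀ j, P * γ j a = ∑ b, Q b * γ j b) (T : Fin n → ℕ) :
    P * momentPolyT γ (T + Pi.single a 1) = ∑ b, Q b * momentPolyT γ (T + Pi.single b 1) := by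
  have hR : ∀ b, Q b * momentPolyT γ (T + Pi.single b 1) = ∑ j, Q b * (γ j b * ∏ i, γ j i ^ T i) := by
    intro b
    rw [momentPolyT_add_single, Finset.mul_sum]
  simp_rw [hR]
  rw [momentPolyT_add_single, Finset.mul_sum, Finset.sum_comm]
  refine Finset.sum_congr rfl fun j _ => ?_
  rw [← mul_assoc, hrel j, Finset.sum_mul]
  exact Finset.sum_congr rfl fun b _ => by ring

theorem deltaT_rel (γ γ' : Fin m → Fin n → ℂ[X]) (a : Fin n) (P : ℂ[X]) (Q : Fin n → ℂ[X])
    (hrel : ∀ j, P * γ j a = ∑ b, Q b * γ j b) (hrel' : ∀ j, P * γ' j a = ∑ b, Q b * γ' j b) (T : Fin n → ℕ) :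
    P * (momentPolyT γ (T + Pi.single a 1) - momentPolyT γ' (T + Pi.single a 1)) =
      ∑ b, Q b * (momentPolyT γ (T + Pi.single b 1) - momentPolyT γ' (T + Pi.single b 1)) := by
  rw [mul_sub, momentPolyT_rel γ a P Q hrel T, momentPolyT_rel γ' a P Q hrel' T, ← Finset.sum_sub_distrib]
  exact Finset.sum_congr rfl fun b _ => by ring

/-! ## 3. K2-valued: THE TOWER RECORD LEMMA (PROVED) -/

/-- **Tower record lemma.**  A record letter admits no valued polynomial relation. -/
theorem towerRecordLemma (γ γ' : Fin m → Fin n → ℂ[X]) (x : Fin n → Expo) (d : Fin 2 → ℤ) (m' : ℕ)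
    (ξ : Fin 2 → ℝ) (S : Fin n → ℕ) (k : ℕ) (hrec : IsRecordT γ γ' x d m' ξ (S, k)) (a : Fin n) (hSa : 0 < S a)
    (P : ℂ[X]) (Q : Fin n → ℂ[X]) (s₀ : ℕ) (hs₀ : P.coeff s₀ ≠ 0) (hQa : Q a = 0)
    (hrel : ∀ j, P * γ j a = ∑ b, Q b * γ j b) (hrel' : ∀ j, P * γ' j a = ∑ b, Q b * γ' j b)
    (hP : ∀ s ∈ P.support, 0 ≤ ((s₀ : ℝ) - s) * wtZ ξ d)
    (hQ : ∀ b, ∀ s ∈ (Q b).support, 0 ≤ wt ξ (x b) - wt ξ (x a) + ((s₀ : ℝ) - s) * wtZ ξ d) : False := by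
  -- `S = T + e_a`
  obtain ⟨T, rfl⟩ : ∃ T : Fin n → ℕ, S = T + Pi.single a 1 := by
    refine ⟨Function.update S a (S a - 1), funext fun i => ?_⟩
    by_cases hi : i = a
    · subst hi
      simp [Nat.sub_add_cancel hSa]
    · simp [hi]
  have hlive : (T + Pi.single a 1, k) ∈ liveT γ γ' m' := hrec.1
  simp only [liveT, Set.mem_setOf_eq] at hlive
  obtain ⟨hsizeS, hlayerS⟩ := hlive
  have hbeat := hrec.2
  -- a shallow pair distinct from the record and not lighter is dead
  have dead : ∀ (S' : Fin n → ℕ) (k' : ℕ), size S' ≤ m' → (S', k') ≠ (T + Pi.single a 1, k) →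
      wtZ ξ (ptZ x d (T + Pi.single a 1) k) ≤ wtZ ξ (ptZ x d S' k') → layerT γ γ' k' S' = 0 := by
    intro S' k' hs hne hle
    by_contra h
    have hq : (S', k') ∈ liveT γ γ' m' := by
      simp only [liveT, Set.mem_setOf_eq]
      exact ⟨hs, h⟩
    exact absurd (hbeat (S', k') hq hne) (not_lt.mpr hle)
  -- coefficient `k + s₀` of `P · ΔM(S)`
  have lhs : (P * (momentPolyT γ (T + Pi.single a 1) - momentPolyT γ' (T + Pi.single a 1))).coeff (k + s₀) =
      P.coeff s₀ * layerT γ γ' k (T + Pi.single a 1) := by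
    rw [coeff_mul, Finset.sum_eq_single (s₀, k)]
    · rfl
    · rintro ⟨s, k'⟩ hmem hne
      rw [Finset.HasAntidiagonal.mem_antidiagonal] at hmem
      by_cases hs : P.coeff s = 0
      · rw [hs, zero_mul]
      · have hcast : (k' : ℝ) - k = (s₀ : ℝ) - s := by
          have h := congrArg (Nat.cast : ℕ → ℝ) hmem
          push_cast at h
          linarith
        have hkk : k' ≠ k := by
          intro h
          subst h
          have : s = s₀ := by omega
          exact hne (by rw [this])
        have h0 : layerT γ γ' k' (T + Pi.single a 1) = 0 := by
          refine dead _ _ hsizeS (fun h => hkk (congrArg Prod.snd h)) ?_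
          rw [wtZ_ptZ_k ξ x d _ k, wtZ_ptZ_k ξ x d _ k']
          have := hP s (mem_support_iff.mpr hs)
          have hprod : ((k' : ℝ) - k) * wtZ ξ d = ((s₀ : ℝ) - s) * wtZ ξ d := by rw [hcast]
          have hexp : ((k' : ℝ) - k) * wtZ ξ d = (k' : ℝ) * wtZ ξ d - (k : ℝ) * wtZ ξ d := by ring
          linarith [hprod, hexp, this]
        change P.coeff s * layerT γ γ' k' (T + Pi.single a 1) = 0
        rw [h0, mul_zero]
    · intro hnot
      exact absurd (Finset.HasAntidiagonal.mem_antidiagonal.mpr (by simp only; omega)) hnot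
  -- coefficient `k + s₀` of the right-hand side vanishes
  have rhs : (∑ b, Q b * (momentPolyT γ (T + Pi.single b 1) - momentPolyT γ' (T + Pi.single b 1))).coeff (k + s₀) = 0 := by
    rw [finsetSum_coeff]
    refine Finset.sum_eq_zero fun b _ => ?_
    rw [coeff_mul]
    refine Finset.sum_eq_zero fun y hmem => ?_
    obtain ⟨s, k'⟩ := y
    rw [Finset.HasAntidiagonal.mem_antidiagonal] at hmem
    by_cases hs : (Q b).coeff s = 0
    · rw [hs, zero_mul]
    · have hba : b ≠ a := by
        rintro rfl
        rw [hQa, coeff_zero] at hs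
        exact hs rfl
      have hcast : (k' : ℝ) - k = (s₀ : ℝ) - s := by
        have h := congrArg (Nat.cast : ℕ → ℝ) hmem
        push_cast at h
        linarith
      have h0 : layerT γ γ' k' (T + Pi.single b 1) = 0 := by
        refine dead _ _ (by rw [size_add_single] at hsizeS ⊢; exact hsizeS) ?_ ?_
        · intro h
          have := congrFun (congrArg Prod.fst h) a
          simp [hba] at this
        · rw [wtZ_ptZ_k ξ x d _ k, wtZ_ptZ_k ξ x d _ k', wtZ_ptZ_add_single, wtZ_ptZ_add_single]
          have := hQ b s (mem_support_iff.mpr hs)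
          have hprod : ((k' : ℝ) - k) * wtZ ξ d = ((s₀ : ℝ) - s) * wtZ ξ d := by rw [hcast]
          have hexp : ((k' : ℝ) - k) * wtZ ξ d = (k' : ℝ) * wtZ ξ d - (k : ℝ) * wtZ ξ d := by ring
          linarith [hprod, hexp, this]
      change (Q b).coeff s * layerT γ γ' k' (T + Pi.single b 1) = 0
      rw [h0, mul_zero]
  have key : P.coeff s₀ * layerT γ γ' k (T + Pi.single a 1) = 0 := by
    rw [← lhs, deltaT_rel γ γ' a P Q hrel hrel' T, rhs]
  exact hlayerS ((mul_eq_zero.mp key).resolve_left hs₀)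

/-! ## 4. K1, first half: a SIEGEL DEPENDENCE of bounded degree (dimension count, PROVED) -/

/-- Among `|κ|` polynomial vectors `π_b ∈ ℂ[X]^ι` of degree `≤ D` with `|ι| (L+D+1) < |κ| (L+1)` there is a dependence
`Σ_b λ_b π_b = 0`, `deg λ_b ≤ L`, not all `λ_b = 0`. -/
theorem siegel_dependence {ι κ : Type*} [Fintype ι] [Fintype κ] [DecidableEq ι] [DecidableEq κ]
    (π : κ → ι → ℂ[X]) (D L : ℕ) (hdeg : ∀ b i, (π b i).natDegree ≤ D)
    (hcard : Fintype.card ι * (L + D + 1) < Fintype.card κ * (L + 1)) :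
    ∃ lam : κ → ℂ[X], (∃ b, lam b ≠ 0) ∧ (∀ b, (lam b).natDegree ≤ L) ∧ ∀ i, ∑ b, lam b * π b i = 0 := by
  let A : Matrix (ι × Fin (L + D + 1)) (κ × Fin (L + 1)) ℂ :=
    fun ie bs => if (bs.2 : ℕ) ≤ (ie.2 : ℕ) then (π bs.1 ie.1).coeff ((ie.2 : ℕ) - (bs.2 : ℕ)) else 0
  have hlt : finrank ℂ (ι × Fin (L + D + 1) → ℂ) < finrank ℂ (κ × Fin (L + 1) → ℂ) := by
    simp only [Module.finrank_fintype_fun_eq_card, Fintype.card_prod, Fintype.card_fin]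
    exact hcard
  have hker := LinearMap.ker_ne_bot_of_finrank_lt (f := Matrix.mulVecLin A) hlt
  obtain ⟨c, hc, hc0⟩ := (Submodule.ne_bot_iff _).mp hker
  rw [LinearMap.mem_ker, Matrix.mulVecLin_apply] at hc
  refine ⟨fun b => ∑ s : Fin (L + 1), C (c (b, s)) * X ^ (s : ℕ), ?_, ?_, ?_⟩
  · obtain ⟨⟨b, s⟩, hbs⟩ : ∃ bs, c bs ≠ 0 := by
      by_contra h
      push Not at h
      exact hc0 (funext h)
    refine ⟨b, fun h0 => hbs ?_⟩
    have h1 := congrArg (fun p : ℂ[X] => p.coeff (s : ℕ)) h0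
    simp only [finsetSum_coeff, coeff_C_mul_X_pow, coeff_zero] at h1
    rw [Finset.sum_eq_single s] at h1
    · simpa using h1
    · intro s' _ hs'
      rw [if_neg]
      exact fun h => hs' (Fin.ext h).symm
    · intro h
      exact absurd (Finset.mem_univ s) h
  · intro b
    refine natDegree_sum_le_of_forall_le _ _ fun s _ => ?_
    exact (natDegree_C_mul_X_pow_le (c (b, s)) s).trans (Nat.le_of_lt_succ s.is_lt)
  · intro i
    ext e
    rw [finsetSum_coeff, coeff_zero]
    have hterm : ∀ b, ((∑ s : Fin (L + 1), C (c (b, s)) * X ^ (s : ℕ)) * π b i).coeff e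
        = ∑ s : Fin (L + 1), (if (s : ℕ) ≤ e then c (b, s) * (π b i).coeff (e - s) else 0) := by
      intro b
      rw [Finset.sum_mul, finsetSum_coeff]
      refine Finset.sum_congr rfl fun s _ => ?_
      rw [mul_assoc, coeff_C_mul, coeff_X_pow_mul']
      split_ifs <;> simp
    simp_rw [hterm]
    by_cases he : e < L + D + 1
    · have h1 := congrFun hc (i, ⟨e, he⟩)
      simp only [Matrix.mulVec, dotProduct, Pi.zero_apply] at h1
      refine Eq.trans ?_ h1
      rw [Fintype.sum_prod_type]
      refine Finset.sum_congr rfl fun b _ => Finset.sum_congr rfl fun s _ => ?_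
      simp only [A]
      split_ifs <;> ring
    · refine Finset.sum_eq_zero fun b _ => Finset.sum_eq_zero fun s _ => ?_
      split_ifs with hs
      · rw [coeff_eq_zero_of_natDegree_lt, mul_zero]
        calc (π b i).natDegree ≤ D := hdeg b i
          _ < e - s := by have := s.is_lt; omega
      · rfl

/-! ## 5. Cells of the real weight plane deciding the signs of finitely many integer linear forms -/

section Cells

/-- Critical ratio of an integer vector `δ`: `0 ≤ ξ·δ ⇔ ξ₀ (−δ₀) ≤ ξ₁ δ₁`, critical value `δ₁ / (−δ₀)`. -/
def cvZ (δ : Fin 2 → ℤ) : ℝ := ((δ 1 : ℤ) : ℝ) / (-((δ 0 : ℤ) : ℝ))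

variable {ι : Type*} [Fintype ι]

def critSetZ (δ : ι → Fin 2 → ℤ) : Finset ℝ := Finset.univ.image fun i => cvZ (δ i)

/-- The CELL of a real weight w.r.t. a finite family of integer vectors. -/
def cellZ (δ : ι → Fin 2 → ℤ) (ξ : Fin 2 → ℝ) : (Bool × Bool × Bool × Bool) × ℕ × Bool :=
  ((decide (0 < ξ 1), decide (ξ 1 < 0), decide (0 < ξ 0), decide (ξ 0 < 0)),
    ((critSetZ δ).filter fun q => q < ξ 0 / ξ 1).card, decide (ξ 0 / ξ 1 ∈ critSetZ δ))

def cellSetZ (δ : ι → Fin 2 → ℤ) : Finset ((Bool × Bool × Bool × Bool) × ℕ × Bool) :=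
  Finset.univ ×ˢ (Finset.range ((critSetZ δ).card + 1) ×ˢ Finset.univ)

theorem cellZ_mem_cellSetZ (δ : ι → Fin 2 → ℤ) (ξ : Fin 2 → ℝ) : cellZ δ ξ ∈ cellSetZ δ := by
  simp only [cellSetZ, cellZ, Finset.mem_product, Finset.mem_univ, Finset.mem_range, true_and, and_true]
  exact Nat.lt_succ_of_le (Finset.card_filter_le _ _)

theorem card_critSetZ_le (δ : ι → Fin 2 → ℤ) : (critSetZ δ).card ≤ Fintype.card ι :=
  Finset.card_image_le.trans (by rw [Finset.card_univ])

theorem card_cellSetZ_le (δ : ι → Fin 2 → ℤ) : (cellSetZ δ).card ≤ 32 * (Fintype.card ι + 1) := by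
  have hQ := card_critSetZ_le δ
  simp only [cellSetZ, Finset.card_product, Finset.card_univ, Fintype.card_prod, Fintype.card_bool,
    Finset.card_range]
  linarith

theorem nonneg_wtZ_iff_sub (ξ : Fin 2 → ℝ) (δ : Fin 2 → ℤ) :
    0 ≤ wtZ ξ δ ↔ ξ 0 * (-((δ 0 : ℤ) : ℝ)) ≤ ξ 1 * ((δ 1 : ℤ) : ℝ) := by
  simp only [wtZ]
  constructor <;> intro h <;> linarith

theorem lt_of_card_filter_lt_eq (Q : Finset ℝ) (ρ ρ' : ℝ)
    (h : (Q.filter (· < ρ)).card = (Q.filter (· < ρ')).card) {q : ℝ} (hq : q ∈ Q) (hlt : q < ρ) : q < ρ' := by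
  by_contra hn
  have hle : ρ' ≤ q := not_lt.mp hn
  have hsub : Q.filter (· < ρ') ⊆ Q.filter (· < ρ) := by
    intro y hy
    rw [Finset.mem_filter] at hy ⊢
    exact ⟨hy.1, (hy.2.trans_le hle).trans hlt⟩
  have hss : Q.filter (· < ρ') ⊂ Q.filter (· < ρ) :=
    (Finset.ssubset_iff_of_subset hsub).mpr
      ⟨q, Finset.mem_filter.mpr ⟨hq, hlt⟩, fun hx => hn (Finset.mem_filter.mp hx).2⟩
  exact absurd h (Finset.card_lt_card hss).ne'

theorem eq_of_cell_eq (Q : Finset ℝ) (ρ ρ' : ℝ)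
    (h : (Q.filter (· < ρ)).card = (Q.filter (· < ρ')).card) (hρ : ρ ∈ Q) (hρ' : ρ' ∈ Q) : ρ = ρ' := by
  rcases lt_trichotomy ρ ρ' with hlt | heq | hgt
  · exact absurd (lt_of_card_filter_lt_eq Q ρ' ρ h.symm hρ hlt) (lt_irrefl _)
  · exact heq
  · exact absurd (lt_of_card_filter_lt_eq Q ρ ρ' h hρ' hgt) (lt_irrefl _)

theorem trichotomy_of_cell_eq (Q : Finset ℝ) (ρ ρ' : ℝ)
    (h : (Q.filter (· < ρ)).card = (Q.filter (· < ρ')).card) (hβ : (ρ ∈ Q ↔ ρ' ∈ Q))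
    {q : ℝ} (hq : q ∈ Q) : (q < ρ ↔ q < ρ') ∧ (q = ρ ↔ q = ρ') := by
  refine ⟨⟨lt_of_card_filter_lt_eq Q ρ ρ' h hq, lt_of_card_filter_lt_eq Q ρ' ρ h.symm hq⟩, ?_, ?_⟩
  · rintro rfl
    exact eq_of_cell_eq Q q ρ' h hq (hβ.mp hq)
  · rintro rfl
    exact (eq_of_cell_eq Q ρ q h (hβ.mpr hq) hq).symm

theorem ratio_le_transfer (ρ ρ' u v : ℝ)
    (H : u ≠ 0 → ((v / u < ρ ↔ v / u < ρ') ∧ (v / u = ρ ↔ v / u = ρ'))) :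
    (ρ * u ≤ v ↔ ρ' * u ≤ v) := by
  rcases lt_trichotomy 0 u with hpos | hzero | hneg
  · obtain ⟨h1, -⟩ := H hpos.ne'
    rw [← le_div_iff₀ hpos, ← le_div_iff₀ hpos, ← not_lt, ← not_lt]
    exact not_congr h1
  · rw [← hzero, mul_zero, mul_zero]
  · obtain ⟨h1, h2⟩ := H hneg.ne
    rw [← div_le_iff_of_neg hneg, ← div_le_iff_of_neg hneg, le_iff_lt_or_eq, le_iff_lt_or_eq, h1, h2]

theorem ratio_ge_transfer (ρ ρ' u v : ℝ)
    (H : u ≠ 0 → ((v / u < ρ ↔ v / u < ρ') ∧ (v / u = ρ ↔ v / u = ρ'))) :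
    (v ≤ ρ * u ↔ v ≤ ρ' * u) := by
  rcases lt_trichotomy 0 u with hpos | hzero | hneg
  · obtain ⟨h1, h2⟩ := H hpos.ne'
    rw [← div_le_iff₀ hpos, ← div_le_iff₀ hpos, le_iff_lt_or_eq, le_iff_lt_or_eq, h1, h2]
  · rw [← hzero, mul_zero, mul_zero]
  · obtain ⟨h1, -⟩ := H hneg.ne
    rw [← le_div_iff_of_neg hneg, ← le_div_iff_of_neg hneg, ← not_lt, ← not_lt]
    exact not_congr h1

/-- **Same cell ⇒ same sign of every form of the family** (real weights, all signs). -/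
theorem nonneg_wtZ_iff_of_cellZ_eq (δ : ι → Fin 2 → ℤ) {ξ ξ' : Fin 2 → ℝ} (h : cellZ δ ξ = cellZ δ ξ') (i : ι) :
    (0 ≤ wtZ ξ (δ i) ↔ 0 ≤ wtZ ξ' (δ i)) := by
  simp only [cellZ, Prod.mk.injEq, decide_eq_decide] at h
  obtain ⟨⟨h1p, h1n, h0p, h0n⟩, hcard, hmem⟩ := h
  rw [nonneg_wtZ_iff_sub ξ, nonneg_wtZ_iff_sub ξ']
  set u : ℝ := -((δ i 0 : ℤ) : ℝ) with hu
  set v : ℝ := ((δ i 1 : ℤ) : ℝ) with hv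
  have hq : cvZ (δ i) ∈ critSetZ δ := Finset.mem_image.mpr ⟨i, Finset.mem_univ _, rfl⟩
  have hcrit : cvZ (δ i) = v / u := rfl
  obtain ⟨hlt, heq⟩ := trichotomy_of_cell_eq (critSetZ δ) (ξ 0 / ξ 1) (ξ' 0 / ξ' 1) hcard hmem hq
  rw [hcrit] at hlt heq
  rcases lt_trichotomy 0 (ξ 1) with h1 | h1 | h1
  · have key : ∀ η : Fin 2 → ℝ, 0 < η 1 → (η 0 * u ≤ η 1 * v ↔ η 0 / η 1 * u ≤ v) := fun η hη => by
      rw [div_mul_eq_mul_div, div_le_iff₀ hη, mul_comm (η 1) v]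
    rw [key ξ h1, key ξ' (h1p.mp h1)]
    exact ratio_le_transfer _ _ u v fun _ => ⟨hlt, heq⟩
  · have hξ1 : ξ 1 = 0 := h1.symm
    have hξ1' : ξ' 1 = 0 := by
      rcases lt_trichotomy (ξ' 1) 0 with hh | hh | hh
      · exact absurd (h1n.mpr hh) (by rw [hξ1]; exact lt_irrefl 0)
      · exact hh
      · exact absurd (h1p.mpr hh) (by rw [hξ1]; exact lt_irrefl 0)
    rw [hξ1, hξ1', zero_mul]
    have epos : ∀ c : ℝ, 0 < c → (c * u ≤ 0 ↔ u ≤ 0) := fun c hc =>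
      ⟨fun h => not_lt.mp fun hu' => (not_lt.mpr h) (mul_pos hc hu'),
        fun h => by simpa using mul_le_mul_of_nonneg_left h hc.le⟩
    have eneg : ∀ c : ℝ, c < 0 → (c * u ≤ 0 ↔ 0 ≤ u) := fun c hc =>
      ⟨fun h => not_lt.mp fun hu' => (not_lt.mpr h) (mul_pos_of_neg_of_neg hc hu'),
        fun h => by simpa using mul_le_mul_of_nonneg_right hc.le h⟩
    rcases lt_trichotomy 0 (ξ 0) with h0 | h0 | h0
    · rw [epos _ h0, epos _ (h0p.mp h0)]
    · have hξ0 : ξ 0 = 0 := h0.symm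
      have hξ0' : ξ' 0 = 0 := by
        rcases lt_trichotomy (ξ' 0) 0 with hh | hh | hh
        · exact absurd (h0n.mpr hh) (by rw [hξ0]; exact lt_irrefl 0)
        · exact hh
        · exact absurd (h0p.mpr hh) (by rw [hξ0]; exact lt_irrefl 0)
      rw [hξ0, hξ0']
    · rw [eneg _ h0, eneg _ (h0n.mp h0)]
  · have key : ∀ η : Fin 2 → ℝ, η 1 < 0 → (η 0 * u ≤ η 1 * v ↔ v ≤ η 0 / η 1 * u) := fun η hη => by
      rw [div_mul_eq_mul_div, le_div_iff_of_neg hη, mul_comm (η 1) v]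
    rw [key ξ h1, key ξ' (h1n.mp h1)]
    exact ratio_ge_transfer _ _ u v fun _ => ⟨hlt, heq⟩

end Cells

/-! ## 6. The tower family of forms: `±d` and `x_a − x_b + j d`, `|j| ≤ L₀` -/

/-- Index of the tower family. -/
abbrev TIdx (n L₀ : ℕ) := Bool ⊕ ((Fin n × Fin n) × Fin (2 * L₀ + 1))

/-- The tower family of integer forms: `d`, `−d`, and `x_a − x_b + (e − L₀) d`. -/
def tfam (x : Fin n → Expo) (d : Fin 2 → ℤ) (L₀ : ℕ) : TIdx n L₀ → Fin 2 → ℤ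
  | Sum.inl true => d
  | Sum.inl false => -d
  | Sum.inr ((a, b), e) => fun c => ((x a c : ℕ) : ℤ) - ((x b c : ℕ) : ℤ) + ((e : ℕ) - (L₀ : ℤ)) * d c

theorem wtZ_tfam_inr (ξ : Fin 2 → ℝ) (x : Fin n → Expo) (d : Fin 2 → ℤ) (L₀ : ℕ) (a b : Fin n) (e : Fin (2 * L₀ + 1)) :
    wtZ ξ (tfam x d L₀ (Sum.inr ((a, b), e))) = wt ξ (x a) - wt ξ (x b) + (((e : ℕ) : ℝ) - L₀) * wtZ ξ d := by
  simp only [wtZ, wt, tfam]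
  push_cast
  ring

theorem wtZ_tfam_true (ξ : Fin 2 → ℝ) (x : Fin n → Expo) (d : Fin 2 → ℤ) (L₀ : ℕ) :
    wtZ ξ (tfam x d L₀ (Sum.inl true)) = wtZ ξ d := rfl

theorem wtZ_tfam_false (ξ : Fin 2 → ℝ) (x : Fin n → Expo) (d : Fin 2 → ℤ) (L₀ : ℕ) :
    wtZ ξ (tfam x d L₀ (Sum.inl false)) = - wtZ ξ d := by
  simp only [wtZ, tfam, Pi.neg_apply]
  push_cast
  ring

theorem card_TIdx (n L₀ : ℕ) : Fintype.card (TIdx n L₀) = 2 + n * n * (2 * L₀ + 1) := by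
  simp only [TIdx, Fintype.card_sum, Fintype.card_bool, Fintype.card_prod, Fintype.card_fin]

/-- Signs of `ξ·d` agree on a cell. -/
theorem sign_transfer (x : Fin n → Expo) (d : Fin 2 → ℤ) (L₀ : ℕ) {ξ ξ' : Fin 2 → ℝ}
    (h : cellZ (tfam x d L₀) ξ = cellZ (tfam x d L₀) ξ') :
    (0 < wtZ ξ d → 0 < wtZ ξ' d) ∧ (wtZ ξ d < 0 → wtZ ξ' d < 0) ∧ (wtZ ξ d = 0 → wtZ ξ' d = 0) := by
  have hp := nonneg_wtZ_iff_of_cellZ_eq (tfam x d L₀) h (Sum.inl true)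
  have hn := nonneg_wtZ_iff_of_cellZ_eq (tfam x d L₀) h (Sum.inl false)
  rw [wtZ_tfam_true, wtZ_tfam_true] at hp
  rw [wtZ_tfam_false, wtZ_tfam_false] at hn
  refine ⟨fun hc => ?_, fun hc => ?_, fun hc => ?_⟩
  · by_contra hle
    have : 0 ≤ -wtZ ξ d := hn.mpr (by linarith [not_lt.mp hle])
    linarith
  · by_contra hle
    have : 0 ≤ wtZ ξ' d := not_lt.mp hle
    have := hp.mpr this
    linarith
  · have h1 : 0 ≤ wtZ ξ' d := hp.mp (le_of_eq hc.symm)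
    have h2 : 0 ≤ -wtZ ξ' d := hn.mp (by linarith)
    linarith

/-! ## 7. K1, second half: AT MOST `2m` RECORD CARRIERS PER CELL (valued exchange, PROVED) -/

/-- Pencil vectors of the tower model, indexed by the rows of `u` and of `v`. -/
def tvec (γ γ' : Fin m → Fin n → ℂ[X]) (b : Fin n) : Fin m ⊕ Fin m → ℂ[X] :=
  fun i => Sum.elim (fun j => γ j b) (fun j => γ' j b) i

/-- The record letters of a CELL: carriers occurring in some record of some weight of the cell. -/
def cellLettersT (γ γ' : Fin m → Fin n → ℂ[X]) (x : Fin n → Expo) (d : Fin 2 → ℤ) (D m' : ℕ)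
    (κ : (Bool × Bool × Bool × Bool) × ℕ × Bool) : Finset (Fin n) :=
  Finset.univ.filter fun a => ∃ ξ : Fin 2 → ℝ, cellZ (tfam x d (2 * m * D)) ξ = κ ∧
    ∃ (S : Fin n → ℕ) (k : ℕ), IsRecordT γ γ' x d m' ξ (S, k) ∧ 0 < S a

theorem sum_ite_zero_else {β M : Type*} [Fintype β] [DecidableEq β] [AddCommGroup M] (f : β → M) (a : β) :
    ∑ b, (if b = a then 0 else f b) = ∑ b, f b - f a := by
  have h1 : ∑ b, (if b = a then 0 else f b) = ∑ b ∈ Finset.univ.erase a, f b := by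
    rw [← Finset.sum_erase_add _ _ (Finset.mem_univ a), if_pos rfl, add_zero]
    exact Finset.sum_congr rfl fun b hb => if_neg (Finset.ne_of_mem_erase hb)
  have h2 : ∑ b, f b = ∑ b ∈ Finset.univ.erase a, f b + f a :=
    (Finset.sum_erase_add _ _ (Finset.mem_univ a)).symm
  rw [h1, h2, add_sub_cancel_right]

/-- **≤ 2m record carriers per cell** (uniformly in `n`, `t`, `D`, the layer and the truncation depth `m'`). -/
theorem card_cellLettersT_le (γ γ' : Fin m → Fin n → ℂ[X]) (D : ℕ) (hγ : DegLe γ D) (hγ' : DegLe γ' D)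
    (x : Fin n → Expo) (d : Fin 2 → ℤ) (m' : ℕ) (κ : (Bool × Bool × Bool × Bool) × ℕ × Bool) :
    (cellLettersT γ γ' x d D m' κ).card ≤ 2 * m := by
  by_contra hgt
  rw [not_le] at hgt
  set L₀ := 2 * m * D with hL₀
  obtain ⟨L', hsub, hcardL⟩ := Finset.exists_subset_card_eq
    (show 2 * m + 1 ≤ (cellLettersT γ γ' x d D m' κ).card by omega)
  have hwit : ∀ b ∈ L', ∃ ξ : Fin 2 → ℝ, cellZ (tfam x d L₀) ξ = κ ∧
      ∃ (S : Fin n → ℕ) (k : ℕ), IsRecordT γ γ' x d m' ξ (S, k) ∧ 0 < S b := by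
    intro b hb
    have := hsub hb
    simpa [cellLettersT] using this
  -- Siegel dependence among the `2m+1` pencil vectors of `L'`
  have hdeg : ∀ (b : ↥L') (i : Fin m ⊕ Fin m), (tvec γ γ' (b : Fin n) i).natDegree ≤ D := by
    rintro b (j | j)
    · exact hγ j b
    · exact hγ' j b
  have hcard : Fintype.card (Fin m ⊕ Fin m) * (L₀ + D + 1) < Fintype.card ↥L' * (L₀ + 1) := by
    rw [Fintype.card_sum, Fintype.card_fin, Fintype.card_coe, hcardL, hL₀]
    have : (2 * m + 1) * (2 * m * D + 1) = (m + m) * (2 * m * D + D + 1) + 1 := by ring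
    omega
  obtain ⟨lam, ⟨b₀, hb₀⟩, hdegL, hrelS⟩ :=
    siegel_dependence (ι := Fin m ⊕ Fin m) (κ := ↥L') (fun b => tvec γ γ' (b : Fin n)) D L₀ hdeg hcard
  -- a representative weight of the cell
  obtain ⟨ξs, hξs, -⟩ := hwit b₀ b₀.2
  -- the valuation index `ν` (deg if `ξ·d > 0`, ord otherwise) and the potential `ψ`
  let ν : ↥L' → ℕ := fun b => if 0 < wtZ ξs d then (lam b).natDegree else (lam b).natTrailingDegree
  have hνL : ∀ b, ν b ≤ L₀ := fun b => by
    by_cases h : 0 < wtZ ξs d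
    · simp only [ν, if_pos h]
      exact hdegL b
    · simp only [ν, if_neg h]
      exact (natTrailingDegree_le_natDegree _).trans (hdegL b)
  let ψ : ↥L' → ℝ := fun b => wt ξs (x b) + ((L₀ : ℝ) - ν b) * wtZ ξs d
  obtain ⟨a, haF, hamin⟩ := Finset.exists_min_image (Finset.univ.filter fun b : ↥L' => lam b ≠ 0) ψ
    ⟨b₀, Finset.mem_filter.mpr ⟨Finset.mem_univ _, hb₀⟩⟩
  have ha0 : lam a ≠ 0 := (Finset.mem_filter.mp haF).2
  obtain ⟨ξa, hξa, S, k, hrec, hSa⟩ := hwit a a.2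
  have hcell : cellZ (tfam x d L₀) ξs = cellZ (tfam x d L₀) ξa := hξs.trans hξa.symm
  obtain ⟨hsp, hsn, hsz⟩ := sign_transfer x d L₀ hcell
  -- `(ν_b − s)·(ξ_a·d) ≥ 0` on the support of `λ_b`
  have hνs : ∀ (b : ↥L'), ∀ s ∈ (lam b).support, 0 ≤ ((ν b : ℝ) - s) * wtZ ξa d := by
    intro b s hs
    rcases lt_trichotomy 0 (wtZ ξs d) with hc | hc | hc
    · have hν : ν b = (lam b).natDegree := by simp only [ν, if_pos hc]
      have hle : s ≤ ν b := hν ▸ le_natDegree_of_mem_supp s hs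
      exact mul_nonneg (sub_nonneg.mpr (by exact_mod_cast hle)) (hsp hc).le
    · rw [hsz hc.symm, mul_zero]
    · have hν : ν b = (lam b).natTrailingDegree := by simp only [ν, if_neg (not_lt.mpr hc.le)]
      have hle : ν b ≤ s := hν ▸ natTrailingDegree_le_of_ne_zero (mem_support_iff.mp hs)
      exact mul_nonneg_of_nonpos_of_nonpos (sub_nonpos.mpr (by exact_mod_cast hle)) (hsn hc).le
  -- the relation `λ_a π_a = Σ_{b ≠ a} (−λ_b) π_b`
  let Q : Fin n → ℂ[X] := fun b => if h : b ∈ L' then (if (⟨b, h⟩ : ↥L') = a then 0 else - lam ⟨b, h⟩) else 0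
  have hQsum : ∀ g : Fin n → ℂ[X], (∑ b : ↥L', lam b * g b = 0) → ∑ b, Q b * g b = lam a * g a := by
    intro g hg
    have h1 : ∑ b, Q b * g b = ∑ b ∈ L', Q b * g b := by
      refine (Finset.sum_subset (Finset.subset_univ L') fun b _ hb => ?_).symm
      simp only [Q, dif_neg hb, zero_mul]
    have h2 : ∑ b ∈ L', Q b * g b = ∑ b : ↥L', Q b * g b := (Finset.sum_coe_sort L' _).symm
    have h3 : ∀ b : ↥L', Q b * g b = if b = a then 0 else (-(lam b * g b)) := by
      intro b
      show (if h : (b : Fin n) ∈ L' then (if (⟨b, h⟩ : ↥L') = a then 0 else - lam ⟨b, h⟩) else 0) * g b = _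
      rw [dif_pos b.property]
      simp only [Subtype.coe_eta]
      split_ifs <;> ring
    rw [h1, h2, Finset.sum_congr rfl fun b _ => h3 b, sum_ite_zero_else, Finset.sum_neg_distrib, hg]
    ring
  have hs0 : (lam a).coeff (ν a) ≠ 0 := by
    by_cases hc : 0 < wtZ ξs d
    · have hν : ν a = (lam a).natDegree := by simp only [ν, if_pos hc]
      rw [hν]
      exact leadingCoeff_ne_zero.mpr ha0
    · have hν : ν a = (lam a).natTrailingDegree := by simp only [ν, if_neg hc]
      rw [hν]
      exact fun h => ha0 (trailingCoeff_eq_zero.mp h)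
  have hQa : Q a = 0 := by
    show (if h : (a : Fin n) ∈ L' then (if (⟨a, h⟩ : ↥L') = a then 0 else - lam ⟨a, h⟩) else 0) = 0
    rw [dif_pos a.property]
    simp only [Subtype.coe_eta, if_true]
  have hrel : ∀ j, lam a * γ j a = ∑ b, Q b * γ j b := fun j =>
    (hQsum (fun b => γ j b) (hrelS (Sum.inl j))).symm
  have hrel' : ∀ j, lam a * γ' j a = ∑ b, Q b * γ' j b := fun j =>
    (hQsum (fun b => γ' j b) (hrelS (Sum.inr j))).symm
  have hQ : ∀ b, ∀ s ∈ (Q b).support, 0 ≤ wt ξa (x b) - wt ξa (x a) + ((ν a : ℝ) - s) * wtZ ξa d := by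
    intro b s hs
    by_cases hb : b ∈ L'
    · by_cases hba : (⟨b, hb⟩ : ↥L') = a
      · exfalso
        simp only [Q, dif_pos hb, if_pos hba, support_zero, Finset.notMem_empty] at hs
      · have hQb : Q b = - lam ⟨b, hb⟩ := by simp only [Q, dif_pos hb, if_neg hba]
        rw [hQb, support_neg] at hs
        have hlb : lam ⟨b, hb⟩ ≠ 0 := by
          intro h0
          rw [h0, support_zero] at hs
          exact Finset.notMem_empty _ hs
        have hmin := hamin ⟨b, hb⟩ (Finset.mem_filter.mpr ⟨Finset.mem_univ _, hlb⟩)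
        have hmin' : wt ξs (x a) + ((L₀ : ℝ) - ν a) * wtZ ξs d ≤
            wt ξs (x b) + ((L₀ : ℝ) - ν ⟨b, hb⟩) * wtZ ξs d := hmin
        have he : L₀ + ν a - ν ⟨b, hb⟩ < 2 * L₀ + 1 := by
          have := hνL a
          omega
        have hcast : (((L₀ + ν a - ν ⟨b, hb⟩ : ℕ)) : ℝ) - (L₀ : ℝ) = (ν a : ℝ) - ν ⟨b, hb⟩ := by
          rw [Nat.cast_sub (by have := hνL ⟨b, hb⟩; omega), Nat.cast_add]
          ring
        have h1 : 0 ≤ wtZ ξs (tfam x d L₀ (Sum.inr ((b, (a : Fin n)), ⟨L₀ + ν a - ν ⟨b, hb⟩, he⟩))) := by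
          rw [wtZ_tfam_inr, hcast]
          have e1 : ((L₀ : ℝ) - ν a) * wtZ ξs d = (L₀ : ℝ) * wtZ ξs d - (ν a : ℝ) * wtZ ξs d := by ring
          have e2 : ((L₀ : ℝ) - ν ⟨b, hb⟩) * wtZ ξs d = (L₀ : ℝ) * wtZ ξs d - (ν ⟨b, hb⟩ : ℝ) * wtZ ξs d := by ring
          have e3 : ((ν a : ℝ) - ν ⟨b, hb⟩) * wtZ ξs d = (ν a : ℝ) * wtZ ξs d - (ν ⟨b, hb⟩ : ℝ) * wtZ ξs d := by ring
          linarith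
        have h2 := (nonneg_wtZ_iff_of_cellZ_eq (tfam x d L₀) hcell _).mp h1
        rw [wtZ_tfam_inr, hcast] at h2
        have h3 := hνs ⟨b, hb⟩ s hs
        have hsplit : ((ν a : ℝ) - s) * wtZ ξa d =
            ((ν a : ℝ) - ν ⟨b, hb⟩) * wtZ ξa d + ((ν ⟨b, hb⟩ : ℝ) - s) * wtZ ξa d := by ring
        rw [hsplit]
        linarith
    · exfalso
      simp only [Q, dif_neg hb, support_zero, Finset.notMem_empty] at hs
  exact towerRecordLemma γ γ' x d m' ξa S k hrec a hSa (lam a) Q (ν a) hs0 hQa hrel hrel' (hνs a) hQ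

/-! ## 8. `k` is determined by `S` up to two values; candidates per cell; THE COUNT and THE LAW (PROVED) -/

def liveLayers (γ γ' : Fin m → Fin n → ℂ[X]) (D m' : ℕ) (S : Fin n → ℕ) : Finset ℕ :=
  (Finset.range (D * m' + 1)).filter fun k => layerT γ γ' k S ≠ 0

def kmax (γ γ' : Fin m → Fin n → ℂ[X]) (D m' : ℕ) (S : Fin n → ℕ) : ℕ :=
  if h : (liveLayers γ γ' D m' S).Nonempty then (liveLayers γ γ' D m' S).max' h else 0

def kmin (γ γ' : Fin m → Fin n → ℂ[X]) (D m' : ℕ) (S : Fin n → ℕ) : ℕ :=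
  if h : (liveLayers γ γ' D m' S).Nonempty then (liveLayers γ γ' D m' S).min' h else 0

/-- A record `(S, k)` has `k = kmax S` (if `ξ·d ≥ 0`) or `k = kmin S` (if `ξ·d < 0`). -/
theorem record_k (γ γ' : Fin m → Fin n → ℂ[X]) (D : ℕ) (hγ : DegLe γ D) (hγ' : DegLe γ' D)
    (x : Fin n → Expo) (d : Fin 2 → ℤ) (m' : ℕ) (ξ : Fin 2 → ℝ) (S : Fin n → ℕ) (k : ℕ)
    (hrec : IsRecordT γ γ' x d m' ξ (S, k)) : k = kmax γ γ' D m' S ∨ k = kmin γ γ' D m' S := by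
  have hlive := hrec.1
  simp only [liveT, Set.mem_setOf_eq] at hlive
  obtain ⟨hsize, hlayer⟩ := hlive
  have hkD : k ≤ D * m' := (le_of_layerT_ne_zero γ γ' D hγ hγ' hlayer).trans (Nat.mul_le_mul_left _ hsize)
  have hkmem : k ∈ liveLayers γ γ' D m' S :=
    Finset.mem_filter.mpr ⟨Finset.mem_range.mpr (by omega), hlayer⟩
  have hne : (liveLayers γ γ' D m' S).Nonempty := ⟨k, hkmem⟩
  have beat : ∀ k' ∈ liveLayers γ γ' D m' S, k' ≠ k → wtZ ξ (ptZ x d S k') < wtZ ξ (ptZ x d S k) := by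
    intro k' hk' hne'
    have hl : (S, k') ∈ liveT γ γ' m' := by
      simp only [liveT, Set.mem_setOf_eq]
      exact ⟨hsize, (Finset.mem_filter.mp hk').2⟩
    exact hrec.2 (S, k') hl (fun h => hne' (congrArg Prod.snd h))
  rcases le_or_gt 0 (wtZ ξ d) with hc | hc
  · left
    rw [kmax, dif_pos hne]
    by_contra hk
    have hle : k ≤ (liveLayers γ γ' D m' S).max' hne := Finset.le_max' _ _ hkmem
    have hlt : k < (liveLayers γ γ' D m' S).max' hne := lt_of_le_of_ne hle hk
    have hb := beat _ (Finset.max'_mem _ hne) (ne_of_gt hlt)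
    rw [wtZ_ptZ_k ξ x d S k, wtZ_ptZ_k ξ x d S ((liveLayers γ γ' D m' S).max' hne)] at hb
    have hcast : (k : ℝ) ≤ (((liveLayers γ γ' D m' S).max' hne : ℕ) : ℝ) := by exact_mod_cast hle
    have := mul_le_mul_of_nonneg_right hcast hc
    linarith
  · right
    rw [kmin, dif_pos hne]
    by_contra hk
    have hle : (liveLayers γ γ' D m' S).min' hne ≤ k := Finset.min'_le _ _ hkmem
    have hlt : (liveLayers γ γ' D m' S).min' hne < k := lt_of_le_of_ne hle (Ne.symm hk)
    have hb := beat _ (Finset.min'_mem _ hne) (ne_of_lt hlt)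
    rw [wtZ_ptZ_k ξ x d S k, wtZ_ptZ_k ξ x d S ((liveLayers γ γ' D m' S).min' hne)] at hb
    have hcast : (((liveLayers γ γ' D m' S).min' hne : ℕ) : ℝ) ≤ k := by exact_mod_cast hle
    have := mul_le_mul_of_nonpos_right hcast hc.le
    linarith

/-- Shallow multisets supported on a letter set. -/
def msets (Lset : Finset (Fin n)) (m' : ℕ) : Finset (Fin n → ℕ) :=
  (Finset.range (m' + 1)).biUnion fun j => Finset.piAntidiag Lset j

theorem mem_msets {Lset : Finset (Fin n)} {m' : ℕ} {S : Fin n → ℕ} (hS : size S ≤ m')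
    (hL : ∀ a, S a ≠ 0 → a ∈ Lset) : S ∈ msets Lset m' := by
  rw [msets, Finset.mem_biUnion]
  refine ⟨Lset.sum S, Finset.mem_range.mpr (Nat.lt_succ_of_le ?_), Finset.mem_piAntidiag.mpr ⟨rfl, hL⟩⟩
  calc Lset.sum S ≤ ∑ i, S i := Finset.sum_le_sum_of_subset (Finset.subset_univ Lset)
    _ ≤ m' := hS

theorem card_piAntidiag_le (L : Finset (Fin n)) (j : ℕ) : (Finset.piAntidiag L j).card ≤ 2 ^ (L.card + j) := by
  have h : (L.finsuppAntidiag j).card = (Finset.piAntidiag L j).card := by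
    rw [Finset.finsuppAntidiag, Finset.card_map, Finset.card_attach]
  rw [← h, Finset.card_finsuppAntidiag_nat_eq_choose]
  exact (Nat.choose_le_two_pow _ _).trans (Nat.pow_le_pow_right (by norm_num) (by omega))

theorem card_msets_le (Lset : Finset (Fin n)) (m' M : ℕ) (hL : Lset.card ≤ M) :
    (msets Lset m').card ≤ (m' + 1) * 2 ^ (M + m') := by
  rw [msets]
  calc _ ≤ ∑ j ∈ Finset.range (m' + 1), (Finset.piAntidiag Lset j).card := Finset.card_biUnion_le
    _ ≤ ∑ _j ∈ Finset.range (m' + 1), 2 ^ (M + m') := Finset.sum_le_sum fun j hj => ?_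
    _ = (m' + 1) * 2 ^ (M + m') := by rw [Finset.sum_const, Finset.card_range, smul_eq_mul]
  have hj := Finset.mem_range.mp hj
  exact (card_piAntidiag_le Lset j).trans (Nat.pow_le_pow_right (by norm_num) (by omega))

/-- Candidate records over a letter set: `(S, kmax S)` and `(S, kmin S)`. -/
def candidatesT (γ γ' : Fin m → Fin n → ℂ[X]) (D m' : ℕ) (Lset : Finset (Fin n)) : Finset ((Fin n → ℕ) × ℕ) :=
  (msets Lset m').image (fun S => (S, kmax γ γ' D m' S)) ∪ (msets Lset m').image (fun S => (S, kmin γ γ' D m' S))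

theorem card_candidatesT_le (γ γ' : Fin m → Fin n → ℂ[X]) (D m' M : ℕ) (Lset : Finset (Fin n)) (hL : Lset.card ≤ M) :
    (candidatesT γ γ' D m' Lset).card ≤ 2 * ((m' + 1) * 2 ^ (M + m')) := by
  rw [candidatesT, two_mul]
  exact (Finset.card_union_le _ _).trans (Nat.add_le_add
    (Finset.card_image_le.trans (card_msets_le Lset m' M hL)) (Finset.card_image_le.trans (card_msets_le Lset m' M hL)))

/-- **THE TOWER RECORD COUNT** (coefficient side, `m' = m`): records number `≤ 32 (|TIdx| + 1) · 2 (m+1) 2^{3m}` — linear in `D`. -/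
theorem towerRecordCount (m n D : ℕ) (γ γ' : Fin m → Fin n → ℂ[X]) (hγ : DegLe γ D) (hγ' : DegLe γ' D)
    (x : Fin n → Expo) (d : Fin 2 → ℤ) :
    ((shallowPairsT n m D).filter fun p => ∃ ξ : Fin 2 → ℝ, IsRecordT γ γ' x d m ξ p).card
      ≤ 32 * (2 + n * n * (2 * (2 * m * D) + 1) + 1) * (2 * ((m + 1) * 2 ^ (2 * m + m))) := by
  calc _ ≤ ((cellSetZ (tfam x d (2 * m * D))).biUnion fun κ =>
            candidatesT γ γ' D m (cellLettersT γ γ' x d D m κ)).card := Finset.card_le_card ?_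
    _ ≤ ∑ κ ∈ cellSetZ (tfam x d (2 * m * D)), (candidatesT γ γ' D m (cellLettersT γ γ' x d D m κ)).card :=
        Finset.card_biUnion_le
    _ ≤ ∑ _κ ∈ cellSetZ (tfam x d (2 * m * D)), 2 * ((m + 1) * 2 ^ (2 * m + m)) :=
        Finset.sum_le_sum fun κ _ => card_candidatesT_le γ γ' D m (2 * m) _ (card_cellLettersT_le γ γ' D hγ hγ' x d m κ)
    _ = (cellSetZ (tfam x d (2 * m * D))).card * (2 * ((m + 1) * 2 ^ (2 * m + m))) := by
        rw [Finset.sum_const, smul_eq_mul]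
    _ ≤ 32 * (Fintype.card (TIdx n (2 * m * D)) + 1) * (2 * ((m + 1) * 2 ^ (2 * m + m))) :=
        Nat.mul_le_mul_right _ (card_cellSetZ_le _)
    _ = 32 * (2 + n * n * (2 * (2 * m * D) + 1) + 1) * (2 * ((m + 1) * 2 ^ (2 * m + m))) := by
        rw [card_TIdx]
  rintro ⟨S, k⟩ hp
  rw [Finset.mem_filter] at hp
  obtain ⟨-, ξ, hrec⟩ := hp
  rw [Finset.mem_biUnion]
  refine ⟨cellZ (tfam x d (2 * m * D)) ξ, cellZ_mem_cellSetZ _ ξ, ?_⟩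
  have hlive := hrec.1
  simp only [liveT, Set.mem_setOf_eq] at hlive
  obtain ⟨hsize, -⟩ := hlive
  have hS : S ∈ msets (cellLettersT γ γ' x d D m (cellZ (tfam x d (2 * m * D)) ξ)) m :=
    mem_msets hsize fun a ha => by
      simp only [cellLettersT, Finset.mem_filter, Finset.mem_univ, true_and]
      exact ⟨ξ, rfl, S, k, hrec, Nat.pos_of_ne_zero ha⟩
  rcases record_k γ γ' D hγ hγ' x d m ξ S k hrec with h | h
  · exact Finset.mem_union_left _ (Finset.mem_image.mpr ⟨S, hS, by rw [h]⟩)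
  · exact Finset.mem_union_right _ (Finset.mem_image.mpr ⟨S, hS, by rw [h]⟩)

/-- Lazy arithmetic: the count is `≤ 2^{18 m} (t+2)² (D+1)` for `1 ≤ m`, `n ≤ 2mt`. -/
theorem arith_tower (m n t D : ℕ) (hm : 1 ≤ m) (hn : n ≤ 2 * m * t) :
    32 * (2 + n * n * (2 * (2 * m * D) + 1) + 1) * (2 * ((m + 1) * 2 ^ (2 * m + m)))
      ≤ 2 ^ (18 * m) * (t + 2) ^ 2 * (D + 1) := by
  obtain ⟨X, hX⟩ : ∃ X : ℕ, X = 2 ^ m := ⟨_, rfl⟩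
  have hmX : m + 1 ≤ X := hX ▸ Nat.lt_two_pow_self
  have hX2 : 2 ≤ X := by
    rw [hX]
    calc (2 : ℕ) = 2 ^ 1 := (pow_one 2).symm
      _ ≤ 2 ^ m := Nat.pow_le_pow_right (by norm_num) hm
  have h3 : 2 ^ (2 * m + m) = X ^ 3 := by
    rw [hX, ← pow_mul]
    ring_nf
  have h18 : 2 ^ (18 * m) = X ^ 18 := by rw [hX, ← pow_mul, mul_comm]
  rw [h3, h18]
  have hn' : n ≤ 2 * X * (t + 2) := by
    calc n ≤ 2 * m * t := hn
      _ ≤ 2 * X * (t + 2) := Nat.mul_le_mul (Nat.mul_le_mul_left 2 (by omega)) (by omega)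
  have hmd : m * D ≤ X * D := Nat.mul_le_mul_right _ (by omega)
  have hF : 2 * (2 * m * D) + 1 ≤ 4 * X * (D + 1) := by
    have e1 : 2 * (2 * m * D) = 4 * (m * D) := by ring
    have e2 : 4 * X * (D + 1) = 4 * (X * D) + 4 * X := by ring
    rw [e1, e2]
    omega
  have hA : n * n * (2 * (2 * m * D) + 1) ≤ 16 * (X ^ 3 * (t + 2) ^ 2 * (D + 1)) :=
    calc n * n * (2 * (2 * m * D) + 1) ≤ (2 * X * (t + 2)) * (2 * X * (t + 2)) * (4 * X * (D + 1)) :=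
          Nat.mul_le_mul (Nat.mul_le_mul hn' hn') hF
      _ = 16 * (X ^ 3 * (t + 2) ^ 2 * (D + 1)) := by ring
  have hP : 1 ≤ X ^ 3 * (t + 2) ^ 2 * (D + 1) := Nat.one_le_iff_ne_zero.mpr (by positivity)
  have hB : 2 + n * n * (2 * (2 * m * D) + 1) + 1 ≤ 19 * (X ^ 3 * (t + 2) ^ 2 * (D + 1)) := by omega
  have hC : 2 * ((m + 1) * X ^ 3) ≤ 2 * (X * X ^ 3) := Nat.mul_le_mul_left 2 (Nat.mul_le_mul_right _ hmX)
  have h1216 : 1216 ≤ X ^ 11 :=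
    calc 1216 ≤ 2 ^ 11 := by norm_num
      _ ≤ X ^ 11 := Nat.pow_le_pow_left hX2 11
  calc 32 * (2 + n * n * (2 * (2 * m * D) + 1) + 1) * (2 * ((m + 1) * X ^ 3))
      ≤ 32 * (19 * (X ^ 3 * (t + 2) ^ 2 * (D + 1))) * (2 * (X * X ^ 3)) := Nat.mul_le_mul (Nat.mul_le_mul_left _ hB) hC
    _ = 1216 * (X ^ 7 * (t + 2) ^ 2 * (D + 1)) := by ring
    _ ≤ X ^ 11 * (X ^ 7 * (t + 2) ^ 2 * (D + 1)) := Nat.mul_le_mul_right _ h1216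
    _ = X ^ 18 * (t + 2) ^ 2 * (D + 1) := by ring

/-- **THE TOWER RECORD LAW, PROVED** (`(a, b) = (18, 2)`, times `(D+1)`). -/
theorem towerRecordLaw_holds : TowerRecordLaw := by
  refine ⟨18, 2, fun m n t D γ γ' x d hγ hγ' hn => ?_⟩
  rcases Nat.eq_zero_or_pos m with rfl | hm
  · have h0 : ((shallowPairsT n 0 D).filter fun p => ∃ ξ : Fin 2 → ℝ, IsRecordT γ γ' x d 0 ξ p).card = 0 := by
      rw [Finset.card_eq_zero, Finset.filter_eq_empty_iff]
      rintro p - ⟨ξ, hrec⟩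
      have h := hrec.1
      simp only [liveT, Set.mem_setOf_eq, layerT, momentPolyT] at h
      exact h.2 (by simp)
    rw [h0]
    exact Nat.zero_le _
  · exact (towerRecordCount m n D γ γ' hγ hγ' x d).trans (arith_tower m n t D hm hn)

/-! ## 9. The class rung this law would feed (TYPED TARGETS, NOT proved here — the transfer is p3's Lift with pencils of degree `≤ D`) -/

/-- Tower dissociation to depth `(m, D)`: shallow pairs `|S| ≤ m`, `k ≤ D|S|` are separated by their planar point `S•x + k•d`
(PARALLEL towers on dissociated carriers; the collinear digit towers of F10 violate it maximally). -/
def TowerDissociated (x : Fin n → Expo) (d : Fin 2 → ℤ) (m D : ℕ) : Prop :=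
  ∀ (S S' : Fin n → ℕ) (k k' : ℕ), size S ≤ m → size S' ≤ m → k ≤ D * size S → k' ≤ D * size S' →
    ptZ x d S k = ptZ x d S' k' → (S = S' ∧ k = k')

/-- **(B_D) TOWER-CARRIER LAW** (the rung in the ladder's currency; typed target): instances whose tail alphabet lies in
`X ⊔ (X+d) ⊔ … ⊔ (X+D•d)`, tower-dissociated to depth `(m, D)`, obey the per-cell law with an extra factor `(D+1)`.
`D = 1` is R12's `ShiftedCarrierLaw` (up to `CarrierDissociated` vs `TowerDissociated … 1`). -/
def TowerCarrierLaw : Prop :=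
  ∃ a b : ℕ, ∀ (m t n D : ℕ) (u v : Fin m → MvPolynomial (Fin 2) ℂ) (x : Fin n → Expo) (d : Fin 2 → ℤ),
    2 ≤ t →
    (∀ j, MvPolynomial.coeff 0 (u j) = 0 ∧ (u j).support.card ≤ t) →
    (∀ j, MvPolynomial.coeff 0 (v j) = 0 ∧ (v j).support.card ≤ t) →
    (∀ e ∈ tailSupport u v, ∃ i : Fin n, ∃ j : ℕ, j ≤ D ∧ ∀ c, ((e c : ℕ) : ℤ) = ((x i c : ℕ) : ℤ) + (j : ℤ) * d c) →
    TowerDissociated x d m D →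
    ∀ (R : Expo → Expo → Prop) (S : Finset Expo), IsCellFamily u v R S → S.card ≤ 2 ^ (a * m) * (t + 2) ^ b * (D + 1)

/-- (A_D) ⇒ (B_D), M-sized (typed target, NOT proved): the graded log-linearisation with pencils `γ_{j i}(z) = Σ_{e ≤ D} [X^{x_i + e d}] u_j · z^e`
identifies a visible point of a cell family with the planar point of a record `(S, k)` (tower dissociation makes `(S,k) ↦ S•x + k•d` injective on
live shallow pairs, `k ≤ D|S|` by `le_of_layerT_ne_zero`), exactly as in R12's `Lift` (degree `1`). -/
def towerCarrier_of_towerRecord : Prop := TowerRecordLaw → TowerCarrierLaw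

/-! ## 10. SPARSE LEVELS (answer to VERDICT #19 (ii)): the exchange set replaces the height — D-FREE law for 3-level towers `{0, 1, H}`

The height `D` enters §7–§8 only through the degrees `≤ 2mD` of the Siegel multipliers, i.e. through the DIFFERENCES `ν_a − ν_b` indexing
the cell arrangement.  For pencils with SPARSE level set `E` one takes multipliers supported on any EXCHANGE SET `Λ ⊆ ℕ` with
`2m·|Λ + E| < (2m+1)·|Λ|` (a generalized progression on the levels); the arrangement is indexed by `J ⊇ Λ − Λ` and the count is
`≤ 64 (n²|J| + 3)(m+1)2^{3m}`.  Dense `E = [0,D]`: `Λ = [0,2mD]`, `|J| = 4mD+1` (§8).  Three levels `{0,1,H}`, `H > 4m+2`: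
`Λ = {a + bH : a, b ≤ 4m+1}`, `|J| ≤ (8m+3)²` — INDEPENDENT of `H`. -/

section Sparse
open Pointwise

/-- Siegel dependence with PRESCRIBED SUPPORT: pencils with levels in `E`, multipliers supported on `Λ`, `|ι|·|Λ+E| < |κ|·|Λ|`. -/
theorem siegel_dependence_supp {ι κ : Type*} [Fintype ι] [Fintype κ] [DecidableEq ι] [DecidableEq κ]
    (π : κ → ι → ℂ[X]) (E Λ : Finset ℕ) (hE : ∀ b i, (π b i).support ⊆ E)
    (hcard : Fintype.card ι * (Λ + E).card < Fintype.card κ * Λ.card) :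
    ∃ lam : κ → ℂ[X], (∃ b, lam b ≠ 0) ∧ (∀ b, (lam b).support ⊆ Λ) ∧ ∀ i, ∑ b, lam b * π b i = 0 := by
  let A : Matrix (ι × ↥(Λ + E)) (κ × ↥Λ) ℂ :=
    fun ie bs => if ((bs.2 : ℕ)) ≤ ((ie.2 : ℕ)) then (π bs.1 ie.1).coeff ((ie.2 : ℕ) - (bs.2 : ℕ)) else 0
  have hlt : finrank ℂ (ι × ↥(Λ + E) → ℂ) < finrank ℂ (κ × ↥Λ → ℂ) := by
    simp only [Module.finrank_fintype_fun_eq_card, Fintype.card_prod, Fintype.card_coe]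
    exact hcard
  have hker := LinearMap.ker_ne_bot_of_finrank_lt (f := Matrix.mulVecLin A) hlt
  obtain ⟨c, hc, hc0⟩ := (Submodule.ne_bot_iff _).mp hker
  rw [LinearMap.mem_ker, Matrix.mulVecLin_apply] at hc
  refine ⟨fun b => ∑ s : ↥Λ, C (c (b, s)) * X ^ (s : ℕ), ?_, ?_, ?_⟩
  · obtain ⟨⟨b, s⟩, hbs⟩ : ∃ bs, c bs ≠ 0 := by
      by_contra h
      push Not at h
      exact hc0 (funext h)
    refine ⟨b, fun h0 => hbs ?_⟩
    have h1 := congrArg (fun p : ℂ[X] => p.coeff (s : ℕ)) h0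
    simp only [finsetSum_coeff, coeff_C_mul_X_pow, coeff_zero] at h1
    rw [Finset.sum_eq_single s] at h1
    · simpa using h1
    · intro s' _ hs'
      rw [if_neg]
      exact fun h => hs' (Subtype.ext h).symm
    · intro h
      exact absurd (Finset.mem_univ s) h
  · intro b e he
    rw [Polynomial.mem_support_iff, finsetSum_coeff] at he
    by_contra heΛ
    apply he
    refine Finset.sum_eq_zero fun s _ => ?_
    rw [coeff_C_mul_X_pow, if_neg]
    intro h
    exact heΛ (h ▸ s.property)
  · intro i
    ext e
    rw [finsetSum_coeff, coeff_zero]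
    have hterm : ∀ b, ((∑ s : ↥Λ, C (c (b, s)) * X ^ (s : ℕ)) * π b i).coeff e
        = ∑ s : ↥Λ, (if (s : ℕ) ≤ e then c (b, s) * (π b i).coeff (e - s) else 0) := by
      intro b
      rw [Finset.sum_mul, finsetSum_coeff]
      refine Finset.sum_congr rfl fun s _ => ?_
      rw [mul_assoc, coeff_C_mul, coeff_X_pow_mul']
      split_ifs <;> simp
    simp_rw [hterm]
    by_cases he : e ∈ Λ + E
    · have h1 := congrFun hc (i, ⟨e, he⟩)
      simp only [Matrix.mulVec, dotProduct, Pi.zero_apply] at h1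
      refine Eq.trans ?_ h1
      rw [Fintype.sum_prod_type]
      refine Finset.sum_congr rfl fun b _ => Finset.sum_congr rfl fun s _ => ?_
      simp only [A]
      split_ifs <;> ring
    · refine Finset.sum_eq_zero fun b _ => Finset.sum_eq_zero fun s _ => ?_
      split_ifs with hs
      · by_cases hco : (π b i).coeff (e - s) = 0
        · rw [hco, mul_zero]
        · exfalso
          have hmem : e - (s : ℕ) ∈ E := hE b i (mem_support_iff.mpr hco)
          have : (s : ℕ) + (e - s) ∈ Λ + E := Finset.add_mem_add s.property hmem
          rw [Nat.add_sub_cancel' hs] at this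
          exact he this
      · rfl

/-- Index of the sparse family: `±d` and `x_a − x_b + j•d`, `j ∈ J`. -/
abbrev TIdxG (n : ℕ) (J : Finset ℤ) := Bool ⊕ ((Fin n × Fin n) × ↥J)

def tfamG (x : Fin n → Expo) (d : Fin 2 → ℤ) (J : Finset ℤ) : TIdxG n J → Fin 2 → ℤ
  | Sum.inl true => d
  | Sum.inl false => -d
  | Sum.inr ((a, b), j) => fun c => ((x a c : ℕ) : ℤ) - ((x b c : ℕ) : ℤ) + (j : ℤ) * d c

theorem wtZ_tfamG_inr (ξ : Fin 2 → ℝ) (x : Fin n → Expo) (d : Fin 2 → ℤ) (J : Finset ℤ) (a b : Fin n) (j : ↥J) :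
    wtZ ξ (tfamG x d J (Sum.inr ((a, b), j))) = wt ξ (x a) - wt ξ (x b) + ((j : ℤ) : ℝ) * wtZ ξ d := by
  simp only [wtZ, wt, tfamG]
  push_cast
  ring

theorem wtZ_tfamG_true (ξ : Fin 2 → ℝ) (x : Fin n → Expo) (d : Fin 2 → ℤ) (J : Finset ℤ) :
    wtZ ξ (tfamG x d J (Sum.inl true)) = wtZ ξ d := rfl

theorem wtZ_tfamG_false (ξ : Fin 2 → ℝ) (x : Fin n → Expo) (d : Fin 2 → ℤ) (J : Finset ℤ) :
    wtZ ξ (tfamG x d J (Sum.inl false)) = - wtZ ξ d := by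
  simp only [wtZ, tfamG, Pi.neg_apply]
  push_cast
  ring

theorem card_TIdxG (n : ℕ) (J : Finset ℤ) : Fintype.card (TIdxG n J) = 2 + n * n * J.card := by
  simp only [TIdxG, Fintype.card_sum, Fintype.card_bool, Fintype.card_prod, Fintype.card_fin, Fintype.card_coe]

theorem sign_transferG (x : Fin n → Expo) (d : Fin 2 → ℤ) (J : Finset ℤ) {ξ ξ' : Fin 2 → ℝ}
    (h : cellZ (tfamG x d J) ξ = cellZ (tfamG x d J) ξ') :
    (0 < wtZ ξ d → 0 < wtZ ξ' d) ∧ (wtZ ξ d < 0 → wtZ ξ' d < 0) ∧ (wtZ ξ d = 0 → wtZ ξ' d = 0) := by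
  have hp := nonneg_wtZ_iff_of_cellZ_eq (tfamG x d J) h (Sum.inl true)
  have hn := nonneg_wtZ_iff_of_cellZ_eq (tfamG x d J) h (Sum.inl false)
  rw [wtZ_tfamG_true, wtZ_tfamG_true] at hp
  rw [wtZ_tfamG_false, wtZ_tfamG_false] at hn
  refine ⟨fun hc => ?_, fun hc => ?_, fun hc => ?_⟩
  · by_contra hle
    have : 0 ≤ -wtZ ξ d := hn.mpr (by linarith [not_lt.mp hle])
    linarith
  · by_contra hle
    have : 0 ≤ wtZ ξ' d := not_lt.mp hle
    have := hp.mpr this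
    linarith
  · have h1 : 0 ≤ wtZ ξ' d := hp.mp (le_of_eq hc.symm)
    have h2 : 0 ≤ -wtZ ξ' d := hn.mp (by linarith)
    linarith

/-- Record letters of a cell of the sparse arrangement. -/
def cellLettersG (γ γ' : Fin m → Fin n → ℂ[X]) (x : Fin n → Expo) (d : Fin 2 → ℤ) (J : Finset ℤ) (m' : ℕ)
    (κ : (Bool × Bool × Bool × Bool) × ℕ × Bool) : Finset (Fin n) :=
  Finset.univ.filter fun a => ∃ ξ : Fin 2 → ℝ, cellZ (tfamG x d J) ξ = κ ∧
    ∃ (S : Fin n → ℕ) (k : ℕ), IsRecordT γ γ' x d m' ξ (S, k) ∧ 0 < S a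

/-- **≤ 2m record carriers per cell, SPARSE form**: levels in `E`, an exchange set `Λ` with `2m|Λ+E| < (2m+1)|Λ|`, arrangement `J ⊇ Λ − Λ`. -/
theorem card_cellLettersG_le (γ γ' : Fin m → Fin n → ℂ[X]) (E Λ : Finset ℕ)
    (hγ : ∀ j i, (γ j i).support ⊆ E) (hγ' : ∀ j i, (γ' j i).support ⊆ E)
    (hΛ : 2 * m * (Λ + E).card < (2 * m + 1) * Λ.card) (J : Finset ℤ) (hJ : ∀ u ∈ Λ, ∀ v ∈ Λ, ((u : ℤ) - v) ∈ J)
    (x : Fin n → Expo) (d : Fin 2 → ℤ) (m' : ℕ) (κ : (Bool × Bool × Bool × Bool) × ℕ × Bool) :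
    (cellLettersG γ γ' x d J m' κ).card ≤ 2 * m := by
  by_contra hgt
  rw [not_le] at hgt
  obtain ⟨L', hsub, hcardL⟩ := Finset.exists_subset_card_eq
    (show 2 * m + 1 ≤ (cellLettersG γ γ' x d J m' κ).card by omega)
  have hwit : ∀ b ∈ L', ∃ ξ : Fin 2 → ℝ, cellZ (tfamG x d J) ξ = κ ∧
      ∃ (S : Fin n → ℕ) (k : ℕ), IsRecordT γ γ' x d m' ξ (S, k) ∧ 0 < S b := by
    intro b hb
    have := hsub hb
    simpa [cellLettersG] using this
  have hsupp : ∀ (b : ↥L') (i : Fin m ⊕ Fin m), (tvec γ γ' (b : Fin n) i).support ⊆ E := by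
    rintro b (j | j)
    · exact hγ j b
    · exact hγ' j b
  have hcard : Fintype.card (Fin m ⊕ Fin m) * (Λ + E).card < Fintype.card ↥L' * Λ.card := by
    rw [Fintype.card_sum, Fintype.card_fin, Fintype.card_coe, hcardL, ← two_mul]
    exact hΛ
  obtain ⟨lam, ⟨b₀, hb₀⟩, hsuppL, hrelS⟩ :=
    siegel_dependence_supp (ι := Fin m ⊕ Fin m) (κ := ↥L') (fun b => tvec γ γ' (b : Fin n)) E Λ hsupp hcard
  obtain ⟨ξs, hξs, -⟩ := hwit b₀ b₀.2
  let ν : ↥L' → ℕ := fun b => if 0 < wtZ ξs d then (lam b).natDegree else (lam b).natTrailingDegree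
  have hνΛ : ∀ b, lam b ≠ 0 → ν b ∈ Λ := fun b hb => by
    by_cases h : 0 < wtZ ξs d
    · simp only [ν, if_pos h]
      exact hsuppL b (natDegree_mem_support_of_nonzero hb)
    · simp only [ν, if_neg h]
      exact hsuppL b (natTrailingDegree_mem_support_of_nonzero hb)
  let ψ : ↥L' → ℝ := fun b => wt ξs (x b) - (ν b : ℝ) * wtZ ξs d
  obtain ⟨a, haF, hamin⟩ := Finset.exists_min_image (Finset.univ.filter fun b : ↥L' => lam b ≠ 0) ψ
    ⟨b₀, Finset.mem_filter.mpr ⟨Finset.mem_univ _, hb₀⟩⟩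
  have ha0 : lam a ≠ 0 := (Finset.mem_filter.mp haF).2
  obtain ⟨ξa, hξa, S, k, hrec, hSa⟩ := hwit a a.2
  have hcell : cellZ (tfamG x d J) ξs = cellZ (tfamG x d J) ξa := hξs.trans hξa.symm
  obtain ⟨hsp, hsn, hsz⟩ := sign_transferG x d J hcell
  have hνs : ∀ (b : ↥L'), ∀ s ∈ (lam b).support, 0 ≤ ((ν b : ℝ) - s) * wtZ ξa d := by
    intro b s hs
    rcases lt_trichotomy 0 (wtZ ξs d) with hc | hc | hc
    · have hν : ν b = (lam b).natDegree := by simp only [ν, if_pos hc]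
      have hle : s ≤ ν b := hν ▸ le_natDegree_of_mem_supp s hs
      exact mul_nonneg (sub_nonneg.mpr (by exact_mod_cast hle)) (hsp hc).le
    · rw [hsz hc.symm, mul_zero]
    · have hν : ν b = (lam b).natTrailingDegree := by simp only [ν, if_neg (not_lt.mpr hc.le)]
      have hle : ν b ≤ s := hν ▸ natTrailingDegree_le_of_ne_zero (mem_support_iff.mp hs)
      exact mul_nonneg_of_nonpos_of_nonpos (sub_nonpos.mpr (by exact_mod_cast hle)) (hsn hc).le
  let Q : Fin n → ℂ[X] := fun b => if h : b ∈ L' then (if (⟨b, h⟩ : ↥L') = a then 0 else - lam ⟨b, h⟩) else 0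
  have hQsum : ∀ g : Fin n → ℂ[X], (∑ b : ↥L', lam b * g b = 0) → ∑ b, Q b * g b = lam a * g a := by
    intro g hg
    have h1 : ∑ b, Q b * g b = ∑ b ∈ L', Q b * g b := by
      refine (Finset.sum_subset (Finset.subset_univ L') fun b _ hb => ?_).symm
      simp only [Q, dif_neg hb, zero_mul]
    have h2 : ∑ b ∈ L', Q b * g b = ∑ b : ↥L', Q b * g b := (Finset.sum_coe_sort L' _).symm
    have h3 : ∀ b : ↥L', Q b * g b = if b = a then 0 else (-(lam b * g b)) := by
      intro b
      show (if h : (b : Fin n) ∈ L' then (if (⟨b, h⟩ : ↥L') = a then 0 else - lam ⟨b, h⟩) else 0) * g b = _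
      rw [dif_pos b.property]
      simp only [Subtype.coe_eta]
      split_ifs <;> ring
    rw [h1, h2, Finset.sum_congr rfl fun b _ => h3 b, sum_ite_zero_else, Finset.sum_neg_distrib, hg]
    ring
  have hs0 : (lam a).coeff (ν a) ≠ 0 := by
    by_cases hc : 0 < wtZ ξs d
    · have hν : ν a = (lam a).natDegree := by simp only [ν, if_pos hc]
      rw [hν]
      exact leadingCoeff_ne_zero.mpr ha0
    · have hν : ν a = (lam a).natTrailingDegree := by simp only [ν, if_neg hc]
      rw [hν]
      exact fun h => ha0 (trailingCoeff_eq_zero.mp h)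
  have hQa : Q a = 0 := by
    show (if h : (a : Fin n) ∈ L' then (if (⟨a, h⟩ : ↥L') = a then 0 else - lam ⟨a, h⟩) else 0) = 0
    rw [dif_pos a.property]
    simp only [Subtype.coe_eta, if_true]
  have hrel : ∀ j, lam a * γ j a = ∑ b, Q b * γ j b := fun j =>
    (hQsum (fun b => γ j b) (hrelS (Sum.inl j))).symm
  have hrel' : ∀ j, lam a * γ' j a = ∑ b, Q b * γ' j b := fun j =>
    (hQsum (fun b => γ' j b) (hrelS (Sum.inr j))).symm
  have hQ : ∀ b, ∀ s ∈ (Q b).support, 0 ≤ wt ξa (x b) - wt ξa (x a) + ((ν a : ℝ) - s) * wtZ ξa d := by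
    intro b s hs
    by_cases hb : b ∈ L'
    · by_cases hba : (⟨b, hb⟩ : ↥L') = a
      · exfalso
        simp only [Q, dif_pos hb, if_pos hba, support_zero, Finset.notMem_empty] at hs
      · have hQb : Q b = - lam ⟨b, hb⟩ := by simp only [Q, dif_pos hb, if_neg hba]
        rw [hQb, support_neg] at hs
        have hlb : lam ⟨b, hb⟩ ≠ 0 := by
          intro h0
          rw [h0, support_zero] at hs
          exact Finset.notMem_empty _ hs
        have hmin := hamin ⟨b, hb⟩ (Finset.mem_filter.mpr ⟨Finset.mem_univ _, hlb⟩)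
        have hmin' : wt ξs (x a) - (ν a : ℝ) * wtZ ξs d ≤ wt ξs (x b) - (ν ⟨b, hb⟩ : ℝ) * wtZ ξs d := hmin
        have hj : ((ν a : ℕ) : ℤ) - (ν ⟨b, hb⟩ : ℕ) ∈ J := hJ _ (hνΛ a ha0) _ (hνΛ _ hlb)
        have hcast : ((((ν a : ℕ) : ℤ) - (ν ⟨b, hb⟩ : ℕ) : ℤ) : ℝ) = (ν a : ℝ) - ν ⟨b, hb⟩ := by push_cast; ring
        have h1 : 0 ≤ wtZ ξs (tfamG x d J (Sum.inr ((b, (a : Fin n)), ⟨_, hj⟩))) := by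
          rw [wtZ_tfamG_inr, hcast]
          have e3 : ((ν a : ℝ) - ν ⟨b, hb⟩) * wtZ ξs d = (ν a : ℝ) * wtZ ξs d - (ν ⟨b, hb⟩ : ℝ) * wtZ ξs d := by ring
          linarith
        have h2 := (nonneg_wtZ_iff_of_cellZ_eq (tfamG x d J) hcell _).mp h1
        rw [wtZ_tfamG_inr, hcast] at h2
        have h3 := hνs ⟨b, hb⟩ s hs
        have hsplit : ((ν a : ℝ) - s) * wtZ ξa d =
            ((ν a : ℝ) - ν ⟨b, hb⟩) * wtZ ξa d + ((ν ⟨b, hb⟩ : ℝ) - s) * wtZ ξa d := by ring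
        rw [hsplit]
        linarith
    · exfalso
      simp only [Q, dif_neg hb, support_zero, Finset.notMem_empty] at hs
  exact towerRecordLemma γ γ' x d m' ξa S k hrec a hSa (lam a) Q (ν a) hs0 hQa hrel hrel' (hνs a) hQ

/-- **THE SPARSE RECORD COUNT**: `#records ≤ 64 (n²|J| + 3)(m+1)2^{3m}` for any exchange set. -/
theorem towerRecordCountG (m n D : ℕ) (γ γ' : Fin m → Fin n → ℂ[X]) (hγD : DegLe γ D) (hγ'D : DegLe γ' D)
    (E Λ : Finset ℕ) (hγ : ∀ j i, (γ j i).support ⊆ E) (hγ' : ∀ j i, (γ' j i).support ⊆ E)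
    (hΛ : 2 * m * (Λ + E).card < (2 * m + 1) * Λ.card) (J : Finset ℤ) (hJ : ∀ u ∈ Λ, ∀ v ∈ Λ, ((u : ℤ) - v) ∈ J)
    (x : Fin n → Expo) (d : Fin 2 → ℤ) :
    ((shallowPairsT n m D).filter fun p => ∃ ξ : Fin 2 → ℝ, IsRecordT γ γ' x d m ξ p).card
      ≤ 32 * (2 + n * n * J.card + 1) * (2 * ((m + 1) * 2 ^ (2 * m + m))) := by
  calc _ ≤ ((cellSetZ (tfamG x d J)).biUnion fun κ =>
            candidatesT γ γ' D m (cellLettersG γ γ' x d J m κ)).card := Finset.card_le_card ?_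
    _ ≤ ∑ κ ∈ cellSetZ (tfamG x d J), (candidatesT γ γ' D m (cellLettersG γ γ' x d J m κ)).card :=
        Finset.card_biUnion_le
    _ ≤ ∑ _κ ∈ cellSetZ (tfamG x d J), 2 * ((m + 1) * 2 ^ (2 * m + m)) :=
        Finset.sum_le_sum fun κ _ => card_candidatesT_le γ γ' D m (2 * m) _
          (card_cellLettersG_le γ γ' E Λ hγ hγ' hΛ J hJ x d m κ)
    _ = (cellSetZ (tfamG x d J)).card * (2 * ((m + 1) * 2 ^ (2 * m + m))) := by
        rw [Finset.sum_const, smul_eq_mul]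
    _ ≤ 32 * (Fintype.card (TIdxG n J) + 1) * (2 * ((m + 1) * 2 ^ (2 * m + m))) :=
        Nat.mul_le_mul_right _ (card_cellSetZ_le _)
    _ = 32 * (2 + n * n * J.card + 1) * (2 * ((m + 1) * 2 ^ (2 * m + m))) := by rw [card_TIdxG]
  rintro ⟨S, k⟩ hp
  rw [Finset.mem_filter] at hp
  obtain ⟨-, ξ, hrec⟩ := hp
  rw [Finset.mem_biUnion]
  refine ⟨cellZ (tfamG x d J) ξ, cellZ_mem_cellSetZ _ ξ, ?_⟩
  have hlive := hrec.1
  simp only [liveT, Set.mem_setOf_eq] at hlive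
  obtain ⟨hsize, -⟩ := hlive
  have hS : S ∈ msets (cellLettersG γ γ' x d J m (cellZ (tfamG x d J) ξ)) m :=
    mem_msets hsize fun a ha => by
      simp only [cellLettersG, Finset.mem_filter, Finset.mem_univ, true_and]
      exact ⟨ξ, rfl, S, k, hrec, Nat.pos_of_ne_zero ha⟩
  rcases record_k γ γ' D hγD hγ'D x d m ξ S k hrec with h | h
  · exact Finset.mem_union_left _ (Finset.mem_image.mpr ⟨S, hS, by rw [h]⟩)
  · exact Finset.mem_union_right _ (Finset.mem_image.mpr ⟨S, hS, by rw [h]⟩)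

/-- Pencils with levels in `E`. -/
def LevelsIn (γ : Fin m → Fin n → ℂ[X]) (E : Finset ℕ) : Prop := ∀ j i, (γ j i).support ⊆ E

/-- **THREE-LEVEL RECORD LAW** (levels `{0, 1, H}`, any height `H`): records number `≤ 2^{a m}(t+2)^b`, INDEPENDENT of `H`. -/
def ThreeLevelRecordLaw : Prop :=
  ∃ a b : ℕ, ∀ (m n t H : ℕ) (γ γ' : Fin m → Fin n → ℂ[X]) (x : Fin n → Expo) (d : Fin 2 → ℤ),
    LevelsIn γ {0, 1, H} → LevelsIn γ' {0, 1, H} → n ≤ 2 * m * t →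
    ((shallowPairsT n m (H + 1)).filter fun p => ∃ ξ : Fin 2 → ℝ, IsRecordT γ γ' x d m ξ p).card
      ≤ 2 ^ (a * m) * (t + 2) ^ b

theorem degLe_of_levelsIn {γ : Fin m → Fin n → ℂ[X]} {H : ℕ} (h : LevelsIn γ {0, 1, H}) : DegLe γ (H + 1) := by
  intro j i
  by_cases h0 : γ j i = 0
  · rw [h0, natDegree_zero]
    exact Nat.zero_le _
  · have hmem := h j i (natDegree_mem_support_of_nonzero h0)
    simp only [Finset.mem_insert, Finset.mem_singleton] at hmem
    omega

/-- The exchange progression `{a + bH : a, b ≤ C}` and its arithmetic. -/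
def gap (H C : ℕ) : Finset ℕ := (Finset.range (C + 1) ×ˢ Finset.range (C + 1)).image fun ab => ab.1 + ab.2 * H

def gapJ (H C : ℕ) : Finset ℤ :=
  (Finset.Icc (-(C : ℤ)) C ×ˢ Finset.Icc (-(C : ℤ)) C).image fun ab => ab.1 + ab.2 * (H : ℤ)

theorem card_gap (H C : ℕ) (hH : C < H) : (gap H C).card = (C + 1) * (C + 1) := by
  rw [gap, Finset.card_image_of_injOn, Finset.card_product, Finset.card_range]
  rintro ⟨a, b⟩ hab ⟨a', b'⟩ hab' (h : a + b * H = a' + b' * H)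
  simp only [Finset.coe_product, Set.mem_prod, Finset.mem_coe, Finset.mem_range] at hab hab'
  have ha : a = a' := by
    have h1 := congrArg (· % H) h
    simp only [Nat.add_mul_mod_self_right, Nat.mod_eq_of_lt (show a < H by omega),
      Nat.mod_eq_of_lt (show a' < H by omega)] at h1
    exact h1
  subst ha
  have hb : b * H = b' * H := by omega
  have := Nat.eq_of_mul_eq_mul_right (by omega) hb
  subst this
  rfl

theorem card_gap_add_le (H C : ℕ) : (gap H C + ({0, 1, H} : Finset ℕ)).card ≤ (C + 2) * (C + 2) := by
  have hsub : gap H C + ({0, 1, H} : Finset ℕ) ⊆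
      (Finset.range (C + 2) ×ˢ Finset.range (C + 2)).image fun ab => ab.1 + ab.2 * H := by
    intro u hu
    rw [Finset.mem_add] at hu
    obtain ⟨y, hy, z, hz, rfl⟩ := hu
    rw [gap, Finset.mem_image] at hy
    obtain ⟨⟨a, b⟩, hab, rfl⟩ := hy
    simp only [Finset.mem_product, Finset.mem_range] at hab
    simp only [Finset.mem_insert, Finset.mem_singleton] at hz
    rw [Finset.mem_image]
    rcases hz with rfl | rfl | rfl
    · exact ⟨(a, b), by simp only [Finset.mem_product, Finset.mem_range]; omega, by ring⟩
    · exact ⟨(a + 1, b), by simp only [Finset.mem_product, Finset.mem_range]; omega, by ring⟩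
    · exact ⟨(a, b + 1), by simp only [Finset.mem_product, Finset.mem_range]; omega, by ring⟩
  refine (Finset.card_le_card hsub).trans (Finset.card_image_le.trans ?_)
  rw [Finset.card_product, Finset.card_range]

theorem card_gapJ_le (H C : ℕ) : (gapJ H C).card ≤ (2 * C + 1) * (2 * C + 1) := by
  have hI : (Finset.Icc (-(C : ℤ)) C).card = 2 * C + 1 := by
    have h := Int.card_Icc_of_le (a := -(C : ℤ)) (b := C) (by omega)
    omega
  refine Finset.card_image_le.trans ?_
  rw [Finset.card_product, hI]

theorem sub_mem_gapJ (H C : ℕ) {u v : ℕ} (hu : u ∈ gap H C) (hv : v ∈ gap H C) : ((u : ℤ) - v) ∈ gapJ H C := by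
  rw [gap, Finset.mem_image] at hu hv
  obtain ⟨⟨a, b⟩, hab, rfl⟩ := hu
  obtain ⟨⟨a', b'⟩, hab', rfl⟩ := hv
  simp only [Finset.mem_product, Finset.mem_range] at hab hab'
  rw [gapJ, Finset.mem_image]
  refine ⟨((a : ℤ) - a', (b : ℤ) - b'), ?_, by push_cast; ring⟩
  simp only [Finset.mem_product, Finset.mem_Icc]
  omega

theorem arith_sparse (m n t : ℕ) (hm : 1 ≤ m) (hn : n ≤ 2 * m * t) :
    32 * (2 + n * n * ((2 * (4 * m + 1) + 1) * (2 * (4 * m + 1) + 1)) + 1) * (2 * ((m + 1) * 2 ^ (2 * m + m)))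
      ≤ 2 ^ (23 * m) * (t + 2) ^ 2 := by
  obtain ⟨X, hX⟩ : ∃ X : ℕ, X = 2 ^ m := ⟨_, rfl⟩
  have hmX : m + 1 ≤ X := hX ▸ Nat.lt_two_pow_self
  have hX2 : 2 ≤ X := by
    rw [hX]
    calc (2 : ℕ) = 2 ^ 1 := (pow_one 2).symm
      _ ≤ 2 ^ m := Nat.pow_le_pow_right (by norm_num) hm
  have h3 : 2 ^ (2 * m + m) = X ^ 3 := by
    rw [hX, ← pow_mul]
    ring_nf
  have h23 : 2 ^ (23 * m) = X ^ 23 := by rw [hX, ← pow_mul, mul_comm]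
  rw [h3, h23]
  have hn' : n ≤ 2 * X * (t + 2) := by
    calc n ≤ 2 * m * t := hn
      _ ≤ 2 * X * (t + 2) := Nat.mul_le_mul (Nat.mul_le_mul_left 2 (by omega)) (by omega)
  have hF : 2 * (4 * m + 1) + 1 ≤ 10 * X := by omega
  have hA : n * n * ((2 * (4 * m + 1) + 1) * (2 * (4 * m + 1) + 1)) ≤ 400 * (X ^ 4 * (t + 2) ^ 2) :=
    calc n * n * ((2 * (4 * m + 1) + 1) * (2 * (4 * m + 1) + 1))
        ≤ (2 * X * (t + 2)) * (2 * X * (t + 2)) * ((10 * X) * (10 * X)) :=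
          Nat.mul_le_mul (Nat.mul_le_mul hn' hn') (Nat.mul_le_mul hF hF)
      _ = 400 * (X ^ 4 * (t + 2) ^ 2) := by ring
  have hP : 1 ≤ X ^ 4 * (t + 2) ^ 2 := Nat.one_le_iff_ne_zero.mpr (by positivity)
  have hB : 2 + n * n * ((2 * (4 * m + 1) + 1) * (2 * (4 * m + 1) + 1)) + 1 ≤ 403 * (X ^ 4 * (t + 2) ^ 2) := by omega
  have hC : 2 * ((m + 1) * X ^ 3) ≤ 2 * (X * X ^ 3) := Nat.mul_le_mul_left 2 (Nat.mul_le_mul_right _ hmX)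
  have hK : 25792 ≤ X ^ 15 :=
    calc 25792 ≤ 2 ^ 15 := by norm_num
      _ ≤ X ^ 15 := Nat.pow_le_pow_left hX2 15
  calc 32 * (2 + n * n * ((2 * (4 * m + 1) + 1) * (2 * (4 * m + 1) + 1)) + 1) * (2 * ((m + 1) * X ^ 3))
      ≤ 32 * (403 * (X ^ 4 * (t + 2) ^ 2)) * (2 * (X * X ^ 3)) := Nat.mul_le_mul (Nat.mul_le_mul_left _ hB) hC
    _ = 25792 * (X ^ 8 * (t + 2) ^ 2) := by ring
    _ ≤ X ^ 15 * (X ^ 8 * (t + 2) ^ 2) := Nat.mul_le_mul_right _ hK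
    _ = X ^ 23 * (t + 2) ^ 2 := by ring

/-- **THE THREE-LEVEL RECORD LAW, PROVED** — `(a, b) = (23, 2)`, uniformly in the height `H`. -/
theorem threeLevelRecordLaw_holds : ThreeLevelRecordLaw := by
  refine ⟨23, 2, fun m n t H γ γ' x d hγ hγ' hn => ?_⟩
  rcases Nat.eq_zero_or_pos m with rfl | hm
  · have h0 : ((shallowPairsT n 0 (H + 1)).filter fun p => ∃ ξ : Fin 2 → ℝ, IsRecordT γ γ' x d 0 ξ p).card = 0 := by
      rw [Finset.card_eq_zero, Finset.filter_eq_empty_iff]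
      rintro p - ⟨ξ, hrec⟩
      have h := hrec.1
      simp only [liveT, Set.mem_setOf_eq, layerT, momentPolyT] at h
      exact h.2 (by simp)
    rw [h0]
    exact Nat.zero_le _
  have hD := degLe_of_levelsIn hγ
  have hD' := degLe_of_levelsIn hγ'
  have hX1 : m + 1 ≤ 2 ^ m := Nat.lt_two_pow_self
  by_cases hH : H ≤ 4 * m + 2
  · -- low towers: the dense law with `D = H + 1 ≤ 4m + 3`
    refine ((towerRecordCount m n (H + 1) γ γ' hD hD' x d).trans (arith_tower m n t (H + 1) hm hn)).trans ?_
    have h5 : H + 1 + 1 ≤ 2 ^ (5 * m) := by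
      calc H + 1 + 1 ≤ 4 * (m + 1) := by omega
        _ ≤ 2 ^ 2 * 2 ^ m := by rw [show (2:ℕ) ^ 2 = 4 by norm_num]; exact Nat.mul_le_mul_left 4 hX1
        _ = 2 ^ (2 + m) := (pow_add 2 2 m).symm
        _ ≤ 2 ^ (5 * m) := Nat.pow_le_pow_right (by norm_num) (by omega)
    calc 2 ^ (18 * m) * (t + 2) ^ 2 * (H + 1 + 1) ≤ 2 ^ (18 * m) * (t + 2) ^ 2 * 2 ^ (5 * m) :=
          Nat.mul_le_mul_left _ h5
      _ = 2 ^ (23 * m) * (t + 2) ^ 2 := by rw [mul_comm (2 ^ (18 * m) * (t + 2) ^ 2), ← mul_assoc, ← pow_add]; ring_nf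
  · -- tall towers: the exchange progression `{a + bH : a, b ≤ 4m+1}`
    rw [not_le] at hH
    set C := 4 * m + 1 with hC
    have hΛ : 2 * m * (gap H C + ({0, 1, H} : Finset ℕ)).card < (2 * m + 1) * (gap H C).card := by
      rw [card_gap H C (by omega)]
      refine lt_of_le_of_lt (Nat.mul_le_mul_left _ (card_gap_add_le H C)) ?_
      have : (2 * m + 1) * ((C + 1) * (C + 1)) = 2 * m * ((C + 2) * (C + 2)) + (6 * m + 4) := by
        rw [hC]; ring
      omega
    refine (towerRecordCountG m n (H + 1) γ γ' hD hD' {0, 1, H} (gap H C) hγ hγ' hΛ (gapJ H C)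
      (fun u hu v hv => sub_mem_gapJ H C hu hv) x d).trans ?_
    refine le_trans ?_ (arith_sparse m n t hm hn)
    have hJ := card_gapJ_le H C
    rw [hC] at hJ
    have : n * n * (gapJ H (4 * m + 1)).card ≤ n * n * ((2 * (4 * m + 1) + 1) * (2 * (4 * m + 1) + 1)) :=
      Nat.mul_le_mul_left _ hJ
    have : 2 + n * n * (gapJ H C).card + 1 ≤ 2 + n * n * ((2 * (4 * m + 1) + 1) * (2 * (4 * m + 1) + 1)) + 1 := by
      rw [hC]; omega
    exact Nat.mul_le_mul (Nat.mul_le_mul_left _ this) le_rfl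

/-! ### 10b. ANY number `ℓ` of levels: iterated sumsets + pigeonhole ⇒ a HEIGHT-FREE count `64(n²·C₀^{2ℓ}+3)(m+1)2^{3m}`, `C₀ = 8ℓ²m²` -/

/-- Iterated sumset `C·E` (`0·E = {0}`). -/
def sumset (E : Finset ℕ) : ℕ → Finset ℕ
  | 0 => {0}
  | C + 1 => sumset E C + E

/-- Box parametrisation of `C·E`. -/
def boxPhi (E : Finset ℕ) (c : ↥E → ℕ) : ℕ := ∑ e : ↥E, c e * (e : ℕ)

theorem sumset_subset_image (E : Finset ℕ) (C : ℕ) :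
    sumset E C ⊆ (Fintype.piFinset fun _ : ↥E => Finset.range (C + 1)).image (boxPhi E) := by
  induction C with
  | zero =>
    intro u hu
    simp only [sumset, Finset.mem_singleton] at hu
    subst hu
    refine Finset.mem_image.mpr ⟨fun _ => 0, ?_, ?_⟩
    · rw [Fintype.mem_piFinset]
      intro _
      exact Finset.mem_range.mpr (by omega)
    · simp [boxPhi]
  | succ C ih =>
    intro u hu
    simp only [sumset] at hu
    rw [Finset.mem_add] at hu
    obtain ⟨v, hv, e, he, rfl⟩ := hu
    obtain ⟨c, hc, rfl⟩ := Finset.mem_image.mp (ih hv)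
    rw [Fintype.mem_piFinset] at hc
    refine Finset.mem_image.mpr ⟨c + Pi.single (⟨e, he⟩ : ↥E) 1, ?_, ?_⟩
    · rw [Fintype.mem_piFinset]
      intro i
      have := Finset.mem_range.mp (hc i)
      rw [Finset.mem_range, Pi.add_apply]
      by_cases hi : i = ⟨e, he⟩
      · subst hi
        rw [Pi.single_eq_same]
        omega
      · rw [Pi.single_eq_of_ne hi]
        omega
    · simp only [boxPhi, Pi.add_apply, add_mul, Finset.sum_add_distrib]
      congr 1
      rw [Finset.sum_eq_single (⟨e, he⟩ : ↥E)]
      · rw [Pi.single_eq_same, one_mul]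
      · intro i _ hi
        rw [Pi.single_eq_of_ne hi, zero_mul]
      · intro h
        exact absurd (Finset.mem_univ _) h

theorem card_sumset_le (E : Finset ℕ) (C : ℕ) : (sumset E C).card ≤ (C + 1) ^ E.card := by
  refine (Finset.card_le_card (sumset_subset_image E C)).trans (Finset.card_image_le.trans (le_of_eq ?_))
  rw [Fintype.card_piFinset, Finset.prod_const, Finset.card_range, Finset.card_univ, Fintype.card_coe]

/-- Pigeonhole: polynomial growth forces a slow step before `C₀` once `(2m)^{C₀}(C₀+1)^ℓ < (2m+1)^{C₀}`. -/
theorem slow_step (E : Finset ℕ) (m C₀ ℓ : ℕ) (hE : E.card ≤ ℓ)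
    (hnum : (2 * m) ^ C₀ * (C₀ + 1) ^ ℓ < (2 * m + 1) ^ C₀) :
    ∃ C, C < C₀ ∧ 2 * m * (sumset E (C + 1)).card < (2 * m + 1) * (sumset E C).card := by
  by_contra h
  push Not at h
  have key : ∀ C, C ≤ C₀ → (2 * m + 1) ^ C ≤ (2 * m) ^ C * (sumset E C).card := by
    intro C
    induction C with
    | zero =>
      intro _
      simp [sumset]
    | succ C ih =>
      intro hC
      have h1 := ih (by omega)
      have h2 := h C (by omega)
      calc (2 * m + 1) ^ (C + 1) = (2 * m + 1) ^ C * (2 * m + 1) := pow_succ _ _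
        _ ≤ (2 * m) ^ C * (sumset E C).card * (2 * m + 1) := Nat.mul_le_mul_right _ h1
        _ = (2 * m) ^ C * ((2 * m + 1) * (sumset E C).card) := by ring
        _ ≤ (2 * m) ^ C * (2 * m * (sumset E (C + 1)).card) := Nat.mul_le_mul_left _ h2
        _ = (2 * m) ^ (C + 1) * (sumset E (C + 1)).card := by ring
  have hc : (sumset E C₀).card ≤ (C₀ + 1) ^ ℓ :=
    (card_sumset_le E C₀).trans (Nat.pow_le_pow_right (by omega) hE)
  have := (key C₀ le_rfl).trans (Nat.mul_le_mul_left _ hc)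
  omega

theorem pow_add_mul_le (a : ℕ) : ∀ j : ℕ, a ^ (j + 1) + (j + 1) * a ^ j ≤ (a + 1) ^ (j + 1)
  | 0 => by simp
  | j + 1 => by
    have ih := pow_add_mul_le a j
    have e : (a ^ (j + 1) + (j + 1) * a ^ j) * (a + 1) = a ^ (j + 2) + (j + 2) * a ^ (j + 1) + (j + 1) * a ^ j := by
      ring
    calc a ^ (j + 1 + 1) + (j + 1 + 1) * a ^ (j + 1) ≤ (a ^ (j + 1) + (j + 1) * a ^ j) * (a + 1) := by
          rw [e]; exact Nat.le_add_right _ _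
      _ ≤ (a + 1) ^ (j + 1) * (a + 1) := Nat.mul_le_mul_right _ ih
      _ = (a + 1) ^ (j + 1 + 1) := (pow_succ _ _).symm

theorem two_mul_pow_le (m : ℕ) (hm : 1 ≤ m) : 2 * (2 * m) ^ (2 * m) ≤ (2 * m + 1) ^ (2 * m) := by
  obtain ⟨j, hj⟩ : ∃ j, 2 * m = j + 1 := ⟨2 * m - 1, by omega⟩
  rw [hj]
  have h := pow_add_mul_le (j + 1) j
  have e : (j + 1) * (j + 1) ^ j = (j + 1) ^ (j + 1) := (pow_succ' _ _).symm
  rw [e] at h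
  omega

theorem sixteen_pow_gt (y : ℕ) (hy : 1 ≤ y) : 8 * y ^ 2 + 1 < 16 ^ y := by
  induction y, hy using Nat.le_induction with
  | base => norm_num
  | succ y hy ih =>
    have : 8 * (y + 1) ^ 2 + 1 ≤ 16 * (8 * y ^ 2 + 1) := by nlinarith
    calc 8 * (y + 1) ^ 2 + 1 ≤ 16 * (8 * y ^ 2 + 1) := this
      _ < 16 * 16 ^ y := Nat.mul_lt_mul_of_pos_left ih (by norm_num)
      _ = 16 ^ (y + 1) := (pow_succ' _ _).symm

/-- The numeric input of the pigeonhole with `C₀ = 2m·(4ℓ²m) = 8ℓ²m²`. -/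
theorem hnum (m ℓ : ℕ) (hm : 1 ≤ m) (hℓ : 1 ≤ ℓ) :
    (2 * m) ^ (2 * m * (4 * ℓ * ℓ * m)) * (2 * m * (4 * ℓ * ℓ * m) + 1) ^ ℓ < (2 * m + 1) ^ (2 * m * (4 * ℓ * ℓ * m)) := by
  set N := 4 * ℓ * ℓ * m with hN
  clear_value N
  have h1 : 2 ^ N * (2 * m) ^ (2 * m * N) ≤ (2 * m + 1) ^ (2 * m * N) := by
    have e1 : (2 * m) ^ (2 * m * N) = ((2 * m) ^ (2 * m)) ^ N := pow_mul _ _ _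
    have e2 : (2 * m + 1) ^ (2 * m * N) = ((2 * m + 1) ^ (2 * m)) ^ N := pow_mul _ _ _
    rw [e1, e2, ← mul_pow]
    exact Nat.pow_le_pow_left (two_mul_pow_le m hm) N
  have h2 : (2 * m * N + 1) ^ ℓ < 2 ^ N := by
    have e1 : 2 * m * N + 1 = 8 * (ℓ * m) ^ 2 + 1 := by rw [hN]; ring
    have e2 : 2 ^ N = (16 ^ (ℓ * m)) ^ ℓ := by
      rw [hN, ← pow_mul, show (16 : ℕ) = 2 ^ 4 by norm_num, ← pow_mul]
      congr 1
      ring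
    rw [e1, e2]
    exact Nat.pow_lt_pow_left (sixteen_pow_gt (ℓ * m) (Nat.one_le_iff_ne_zero.mpr (by positivity))) (by omega)
  have hpos : 0 < (2 * m) ^ (2 * m * N) := by positivity
  calc (2 * m) ^ (2 * m * N) * (2 * m * N + 1) ^ ℓ < (2 * m) ^ (2 * m * N) * 2 ^ N :=
        Nat.mul_lt_mul_of_pos_left h2 hpos
    _ = 2 ^ N * (2 * m) ^ (2 * m * N) := mul_comm _ _
    _ ≤ (2 * m + 1) ^ (2 * m * N) := h1

/-- **SPARSE-LEVEL RECORD COUNT** (any `ℓ ≥ |E|` levels, any height): `#records ≤ 64(n²·C₀^{2ℓ}+3)(m+1)2^{3m}`, `C₀ = 8ℓ²m²`. -/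
theorem sparseLevelRecordCount (m n D ℓ : ℕ) (hm : 1 ≤ m) (hℓ : 1 ≤ ℓ) (γ γ' : Fin m → Fin n → ℂ[X])
    (hγD : DegLe γ D) (hγ'D : DegLe γ' D) (E : Finset ℕ) (hE : E.card ≤ ℓ)
    (hγ : LevelsIn γ E) (hγ' : LevelsIn γ' E) (x : Fin n → Expo) (d : Fin 2 → ℤ) :
    ((shallowPairsT n m D).filter fun p => ∃ ξ : Fin 2 → ℝ, IsRecordT γ γ' x d m ξ p).card
      ≤ 32 * (2 + n * n * ((2 * m * (4 * ℓ * ℓ * m)) ^ ℓ * (2 * m * (4 * ℓ * ℓ * m)) ^ ℓ) + 1)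
        * (2 * ((m + 1) * 2 ^ (2 * m + m))) := by
  set C₀ := 2 * m * (4 * ℓ * ℓ * m) with hC₀
  obtain ⟨C, hC, hslow⟩ := slow_step E m C₀ ℓ hE (hnum m ℓ hm hℓ)
  have hΛ : 2 * m * (sumset E C + E).card < (2 * m + 1) * (sumset E C).card := hslow
  let J : Finset ℤ := (sumset E C ×ˢ sumset E C).image fun uv => ((uv.1 : ℕ) : ℤ) - ((uv.2 : ℕ) : ℤ)
  have hJ : ∀ u ∈ sumset E C, ∀ v ∈ sumset E C, ((u : ℤ) - v) ∈ J := fun u hu v hv =>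
    Finset.mem_image.mpr ⟨(u, v), Finset.mem_product.mpr ⟨hu, hv⟩, rfl⟩
  have hC₀pos : 1 ≤ C₀ := by
    rw [hC₀]
    exact Nat.one_le_iff_ne_zero.mpr (by positivity)
  have hΛc : (sumset E C).card ≤ C₀ ^ ℓ :=
    (card_sumset_le E C).trans
      ((Nat.pow_le_pow_left (by omega) _).trans (Nat.pow_le_pow_right hC₀pos hE))
  have hJc : J.card ≤ C₀ ^ ℓ * C₀ ^ ℓ := Finset.card_image_le.trans (by
    rw [Finset.card_product]
    exact Nat.mul_le_mul hΛc hΛc)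
  refine (towerRecordCountG m n D γ γ' hγD hγ'D E (sumset E C) hγ hγ' hΛ J hJ x d).trans ?_
  have : 2 + n * n * J.card + 1 ≤ 2 + n * n * (C₀ ^ ℓ * C₀ ^ ℓ) + 1 := by
    have := Nat.mul_le_mul_left (n * n) hJc
    omega
  exact Nat.mul_le_mul (Nat.mul_le_mul_left _ this) le_rfl

/-- **SPARSE-LEVEL RECORD LAW** (`≤ ℓ` levels): `#records ≤ 2^{a m}(t+2)^b` with `a = a(ℓ)`, independent of the height. -/
def SparseLevelRecordLaw (ℓ : ℕ) : Prop :=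
  ∃ a b : ℕ, ∀ (m n t D : ℕ) (γ γ' : Fin m → Fin n → ℂ[X]) (x : Fin n → Expo) (d : Fin 2 → ℤ) (E : Finset ℕ),
    E.card ≤ ℓ → LevelsIn γ E → LevelsIn γ' E → DegLe γ D → DegLe γ' D → n ≤ 2 * m * t →
    ((shallowPairsT n m D).filter fun p => ∃ ξ : Fin 2 → ℝ, IsRecordT γ γ' x d m ξ p).card
      ≤ 2 ^ (a * m) * (t + 2) ^ b

theorem arith_levels (m n t ℓ : ℕ) (hm : 1 ≤ m) (hℓ : 1 ≤ ℓ) (hn : n ≤ 2 * m * t) :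
    32 * (2 + n * n * ((2 * m * (4 * ℓ * ℓ * m)) ^ ℓ * (2 * m * (4 * ℓ * ℓ * m)) ^ ℓ) + 1)
        * (2 * ((m + 1) * 2 ^ (2 * m + m)))
      ≤ 2 ^ ((2 * ((2 * ℓ + 5) * ℓ) + 16) * m) * (t + 2) ^ 2 := by
  obtain ⟨X, hX⟩ : ∃ X : ℕ, X = 2 ^ m := ⟨_, rfl⟩
  have hmX : m + 1 ≤ X := hX ▸ Nat.lt_two_pow_self
  have hX2 : 2 ≤ X := by
    rw [hX]
    calc (2 : ℕ) = 2 ^ 1 := (pow_one 2).symm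
      _ ≤ 2 ^ m := Nat.pow_le_pow_right (by norm_num) hm
  have h3 : 2 ^ (2 * m + m) = X ^ 3 := by
    rw [hX, ← pow_mul]
    ring_nf
  have hA : 2 ^ ((2 * ((2 * ℓ + 5) * ℓ) + 16) * m) = X ^ (2 * ((2 * ℓ + 5) * ℓ) + 16) := by
    rw [hX, ← pow_mul, mul_comm]
  rw [h3, hA]
  -- `C₀ ≤ X^{2ℓ+5}`
  have hℓX : ℓ * ℓ ≤ X ^ (2 * ℓ) := by
    have h1 : ℓ ≤ 2 ^ ℓ := Nat.lt_two_pow_self.le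
    calc ℓ * ℓ ≤ 2 ^ ℓ * 2 ^ ℓ := Nat.mul_le_mul h1 h1
      _ = 2 ^ (2 * ℓ) := by rw [← pow_add]; ring_nf
      _ ≤ X ^ (2 * ℓ) := Nat.pow_le_pow_left hX2 _
  have hC₀ : 2 * m * (4 * ℓ * ℓ * m) ≤ X ^ (2 * ℓ + 5) := by
    calc 2 * m * (4 * ℓ * ℓ * m) = 8 * (ℓ * ℓ) * (m * m) := by ring
      _ ≤ X ^ 3 * X ^ (2 * ℓ) * (X * X) := Nat.mul_le_mul (Nat.mul_le_mul
          (by calc (8:ℕ) = 2 ^ 3 := by norm_num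
                _ ≤ X ^ 3 := Nat.pow_le_pow_left hX2 3) hℓX) (Nat.mul_le_mul (by omega) (by omega))
      _ = X ^ (2 * ℓ + 5) := by ring
  have hP : (2 * m * (4 * ℓ * ℓ * m)) ^ ℓ * (2 * m * (4 * ℓ * ℓ * m)) ^ ℓ ≤ X ^ (2 * ((2 * ℓ + 5) * ℓ)) := by
    calc _ ≤ (X ^ (2 * ℓ + 5)) ^ ℓ * (X ^ (2 * ℓ + 5)) ^ ℓ :=
          Nat.mul_le_mul (Nat.pow_le_pow_left hC₀ _) (Nat.pow_le_pow_left hC₀ _)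
      _ = X ^ (2 * ((2 * ℓ + 5) * ℓ)) := by rw [← pow_mul, ← pow_add]; ring_nf
  have hn' : n ≤ 2 * X * (t + 2) := by
    calc n ≤ 2 * m * t := hn
      _ ≤ 2 * X * (t + 2) := Nat.mul_le_mul (Nat.mul_le_mul_left 2 (by omega)) (by omega)
  have hnn : n * n ≤ X ^ 4 * (t + 2) ^ 2 := by
    calc n * n ≤ (2 * X * (t + 2)) * (2 * X * (t + 2)) := Nat.mul_le_mul hn' hn'
      _ = 4 * X ^ 2 * (t + 2) ^ 2 := by ring
      _ ≤ X ^ 2 * X ^ 2 * (t + 2) ^ 2 := Nat.mul_le_mul_right _ (Nat.mul_le_mul_right _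
          (by calc (4:ℕ) = 2 ^ 2 := by norm_num
                _ ≤ X ^ 2 := Nat.pow_le_pow_left hX2 2))
      _ = X ^ 4 * (t + 2) ^ 2 := by ring
  set P := (2 * m * (4 * ℓ * ℓ * m)) ^ ℓ * (2 * m * (4 * ℓ * ℓ * m)) ^ ℓ with hPdef
  set K := 2 * ((2 * ℓ + 5) * ℓ) with hK
  have hQ : 1 ≤ X ^ 4 * (t + 2) ^ 2 * X ^ K := Nat.one_le_iff_ne_zero.mpr (by positivity)
  have hB : 2 + n * n * P + 1 ≤ X ^ 2 * (X ^ 4 * (t + 2) ^ 2 * X ^ K) := by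
    have h1 : n * n * P ≤ X ^ 4 * (t + 2) ^ 2 * X ^ K := Nat.mul_le_mul hnn hP
    have h4 : 4 ≤ X ^ 2 := by
      calc (4:ℕ) = 2 ^ 2 := by norm_num
        _ ≤ X ^ 2 := Nat.pow_le_pow_left hX2 2
    calc 2 + n * n * P + 1 ≤ 4 * (X ^ 4 * (t + 2) ^ 2 * X ^ K) := by omega
      _ ≤ X ^ 2 * (X ^ 4 * (t + 2) ^ 2 * X ^ K) := Nat.mul_le_mul_right _ h4
  have hC : 2 * ((m + 1) * X ^ 3) ≤ X * (X * X ^ 3) :=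
    Nat.mul_le_mul (by omega) (Nat.mul_le_mul_right _ hmX)
  have h32 : 32 ≤ X ^ 5 := by
    calc (32:ℕ) = 2 ^ 5 := by norm_num
      _ ≤ X ^ 5 := Nat.pow_le_pow_left hX2 5
  calc 32 * (2 + n * n * P + 1) * (2 * ((m + 1) * X ^ 3))
      ≤ X ^ 5 * (X ^ 2 * (X ^ 4 * (t + 2) ^ 2 * X ^ K)) * (X * (X * X ^ 3)) :=
        Nat.mul_le_mul (Nat.mul_le_mul h32 hB) hC
    _ = X ^ (K + 16) * (t + 2) ^ 2 := by ring

/-- **THE SPARSE-LEVEL RECORD LAW, PROVED** — `a(ℓ) = 4ℓ² + 10ℓ + 16`, `b = 2`, uniformly in the height. -/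
theorem sparseLevelRecordLaw_holds (ℓ : ℕ) (hℓ : 1 ≤ ℓ) : SparseLevelRecordLaw ℓ := by
  refine ⟨2 * ((2 * ℓ + 5) * ℓ) + 16, 2, fun m n t D γ γ' x d E hE hγ hγ' hγD hγ'D hn => ?_⟩
  rcases Nat.eq_zero_or_pos m with rfl | hm
  · have h0 : ((shallowPairsT n 0 D).filter fun p => ∃ ξ : Fin 2 → ℝ, IsRecordT γ γ' x d 0 ξ p).card = 0 := by
      rw [Finset.card_eq_zero, Finset.filter_eq_empty_iff]
      rintro p - ⟨ξ, hrec⟩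
      have h := hrec.1
      simp only [liveT, Set.mem_setOf_eq, layerT, momentPolyT] at h
      exact h.2 (by simp)
    rw [h0]
    exact Nat.zero_le _
  exact (sparseLevelRecordCount m n D ℓ hm hℓ γ γ' hγD hγ'D E hE hγ hγ' x d).trans (arith_levels m n t ℓ hm hℓ hn)

end Sparse

/-! ## 11. LEVEL-FREE (answer to crit-8's Q-R13, coefficient side): the CRAMER RECORD LEMMA

K1 without any exchange set: let `r` be the maximal order of a non-vanishing minor of the pencil matrix `(tvec b)_b` (rows = the
`2m` factor rows, columns = carriers) and, for a weight `ξ`, let `(ρ, β*, s₀)` MAXIMISE the score `ξ·x(β) + s·(ξ·d)` over all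
`r`-column selections `β` with `det Π_{ρ,β} ≠ 0` and `s ∈ supp det Π_{ρ,β}` (the `ξ`-heaviest point of the tower `x(β) + supp(det)·d`).
Laplace expansion of the vanishing `(r+1)`-minors `rows (i,ρ) × cols (a,β*)` gives the Cramer relation
`Δ·π_a = Σ_q ± det Π_{ρ, β*−β*_q+a} · π_{β*_q}`, and optimality of `β*` is EXACTLY the valued hypothesis of K2 (`towerRecordLemma`).
Hence **every record letter at `ξ` is a column of `β*`**: `#letters(ξ) ≤ r ≤ 2m` for EVERY weight — no degree, no level set, no cell
(`card_recordLettersAt_le`).  The count then needs only the number of distinct optimal column sets met by the sweep `ξ ↦ β*(ξ)`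
(`FewLetterSets`; paper proof in the memo: the optimal sets are vertices of a valuated-matroid shadow, consecutive vertices raise the
rank potential `Σ_{b∈β*} #{b'' : η·x_{b''} < η·x_b}` by Brualdi's exchange bijection ⇒ `≤ 4mn + 4` sets; KERNEL proof in §12 via
Grassmann–Plücker symmetric exchange instead of the bijection) ⇒ `LevelFreeRecordLaw` with `(a,b) = (11,1)` (`levelFreeRecordLaw_holds`, §12). -/

section Cramer

/-- Minor of the pencil matrix: rows `ρ`, carrier columns `β`. -/
def minorT (γ γ' : Fin m → Fin n → ℂ[X]) {r : ℕ} (ρ : Fin r → Fin m ⊕ Fin m) (β : Fin r → Fin n) : ℂ[X] :=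
  (Matrix.of fun p u => tvec γ γ' (β u) (ρ p)).det

/-- `ξ`-weight of a column selection. -/
def wsum (ξ : Fin 2 → ℝ) (x : Fin n → Expo) {r : ℕ} (β : Fin r → Fin n) : ℝ := ∑ u, wt ξ (x (β u))

/-- Columns `β` with `a` put in front and then position `q` of `β` deleted (Laplace companion). -/
def swapCol {r : ℕ} (β : Fin r → Fin n) (a : Fin n) (q : Fin r) : Fin r → Fin n :=
  fun u => (Fin.cons a β : Fin (r + 1) → Fin n) ((Fin.succ q).succAbove u)

theorem wsum_swapCol (ξ : Fin 2 → ℝ) (x : Fin n → Expo) {r : ℕ} (β : Fin r → Fin n) (a : Fin n) (q : Fin r) :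
    wsum ξ x (swapCol β a q) = wsum ξ x β - wt ξ (x (β q)) + wt ξ (x a) := by
  have h := Fin.sum_univ_succAbove (fun v : Fin (r + 1) => wt ξ (x ((Fin.cons a β : Fin (r + 1) → Fin n) v)))
    (Fin.succ q)
  rw [Fin.sum_univ_succ] at h
  simp only [Fin.cons_zero, Fin.cons_succ] at h
  simp only [wsum, swapCol]
  linarith

/-- Laplace: if all `(r+1)`-minors vanish, `Δ·π_a(i) = Σ_q (−1)^q det(swap_q)·π_{β q}(i)`. -/
theorem laplace_relation (γ γ' : Fin m → Fin n → ℂ[X]) {r : ℕ} (ρ : Fin r → Fin m ⊕ Fin m) (β : Fin r → Fin n)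
    (a : Fin n) (i : Fin m ⊕ Fin m)
    (hmax : ∀ (ρ' : Fin (r + 1) → Fin m ⊕ Fin m) (β' : Fin (r + 1) → Fin n), minorT γ γ' ρ' β' = 0) :
    minorT γ γ' ρ β * tvec γ γ' a i
      = ∑ q : Fin r, ((-1) ^ (q : ℕ) * minorT γ γ' ρ (swapCol β a q)) * tvec γ γ' (β q) i := by
  have h0 := hmax (Fin.cons i ρ) (Fin.cons a β)
  unfold minorT at h0
  rw [Matrix.det_succ_row_zero, Fin.sum_univ_succ] at h0
  have e0 : (Matrix.of fun p u => tvec γ γ' ((Fin.cons a β : Fin (r + 1) → Fin n) u)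
      ((Fin.cons i ρ : Fin (r + 1) → Fin m ⊕ Fin m) p)).submatrix Fin.succ (Fin.succAbove (0 : Fin (r + 1)))
      = Matrix.of fun p u => tvec γ γ' (β u) (ρ p) := by
    ext p u
    simp [Matrix.submatrix_apply, Matrix.of_apply, Fin.cons_succ]
  have eq : ∀ q : Fin r, (Matrix.of fun p u => tvec γ γ' ((Fin.cons a β : Fin (r + 1) → Fin n) u)
      ((Fin.cons i ρ : Fin (r + 1) → Fin m ⊕ Fin m) p)).submatrix Fin.succ (Fin.succAbove (Fin.succ q))
      = Matrix.of fun p u => tvec γ γ' (swapCol β a q u) (ρ p) := by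
    intro q
    ext p u
    simp [Matrix.submatrix_apply, Matrix.of_apply, Fin.cons_succ, swapCol]
  simp only [Matrix.of_apply, Fin.cons_zero, Fin.cons_succ, Fin.val_zero, pow_zero, one_mul, Fin.val_succ] at h0
  rw [e0] at h0
  simp only [eq] at h0
  have h1 : tvec γ γ' a i * minorT γ γ' ρ β
      + ∑ q : Fin r, -((-1) ^ (q : ℕ) * minorT γ γ' ρ (swapCol β a q) * tvec γ γ' (β q) i) = 0 := by
    rw [← h0]
    unfold minorT
    congr 1
    refine Finset.sum_congr rfl fun q _ => ?_
    rw [pow_succ]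
    ring
  rw [Finset.sum_neg_distrib] at h1
  have h2 : minorT γ γ' ρ β * tvec γ γ' a i
      = ∑ q : Fin r, (-1) ^ (q : ℕ) * minorT γ γ' ρ (swapCol β a q) * tvec γ γ' (β q) i := by
    linear_combination h1
  rw [h2]

/-- **CRAMER RECORD LEMMA** (level-free K1): a record letter at `ξ` is a column of every `ξ`-optimal maximal minor. -/
theorem cramerRecordLemma (γ γ' : Fin m → Fin n → ℂ[X]) (x : Fin n → Expo) (d : Fin 2 → ℤ) (m' : ℕ)
    (ξ : Fin 2 → ℝ) (S : Fin n → ℕ) (k : ℕ) (hrec : IsRecordT γ γ' x d m' ξ (S, k)) {r : ℕ}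
    (ρ : Fin r → Fin m ⊕ Fin m) (β : Fin r → Fin n) (s₀ : ℕ) (hs₀ : (minorT γ γ' ρ β).coeff s₀ ≠ 0)
    (hmax : ∀ (ρ' : Fin (r + 1) → Fin m ⊕ Fin m) (β' : Fin (r + 1) → Fin n), minorT γ γ' ρ' β' = 0)
    (hopt : ∀ β' : Fin r → Fin n, ∀ s ∈ (minorT γ γ' ρ β').support,
      wsum ξ x β' + (s : ℝ) * wtZ ξ d ≤ wsum ξ x β + (s₀ : ℝ) * wtZ ξ d)
    (a : Fin n) (hSa : 0 < S a) (ha : ∀ q, β q ≠ a) : False := by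
  let Q : Fin n → ℂ[X] := fun b => ∑ q : Fin r, if β q = b then (-1) ^ (q : ℕ) * minorT γ γ' ρ (swapCol β a q) else 0
  have hQa : Q a = 0 := Finset.sum_eq_zero fun q _ => if_neg (ha q)
  have hsum : ∀ g : Fin n → ℂ[X], ∑ b, Q b * g b
      = ∑ q : Fin r, ((-1) ^ (q : ℕ) * minorT γ γ' ρ (swapCol β a q)) * g (β q) := by
    intro g
    simp only [Q, Finset.sum_mul]
    rw [Finset.sum_comm]
    refine Finset.sum_congr rfl fun q _ => ?_
    rw [Finset.sum_eq_single (β q)]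
    · rw [if_pos rfl]
    · intro b _ hb
      rw [if_neg (Ne.symm hb), zero_mul]
    · intro h
      exact absurd (Finset.mem_univ _) h
  have hrel : ∀ j, minorT γ γ' ρ β * γ j a = ∑ b, Q b * γ j b := fun j => by
    rw [hsum]
    exact laplace_relation γ γ' ρ β a (Sum.inl j) hmax
  have hrel' : ∀ j, minorT γ γ' ρ β * γ' j a = ∑ b, Q b * γ' j b := fun j => by
    rw [hsum]
    exact laplace_relation γ γ' ρ β a (Sum.inr j) hmax
  have hP : ∀ s ∈ (minorT γ γ' ρ β).support, 0 ≤ ((s₀ : ℝ) - s) * wtZ ξ d := by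
    intro s hs
    have := hopt β s hs
    have e : ((s₀ : ℝ) - s) * wtZ ξ d = (s₀ : ℝ) * wtZ ξ d - (s : ℝ) * wtZ ξ d := by ring
    linarith
  have hQ : ∀ b, ∀ s ∈ (Q b).support, 0 ≤ wt ξ (x b) - wt ξ (x a) + ((s₀ : ℝ) - s) * wtZ ξ d := by
    intro b s hs
    rw [Polynomial.mem_support_iff] at hs
    simp only [Q, finsetSum_coeff] at hs
    obtain ⟨q, -, hq⟩ := Finset.exists_ne_zero_of_sum_ne_zero hs
    by_cases hb : β q = b
    · rw [if_pos hb] at hq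
      have hs' : s ∈ (minorT γ γ' ρ (swapCol β a q)).support := by
        rw [Polynomial.mem_support_iff]
        intro h0
        apply hq
        rcases neg_one_pow_eq_or ℂ[X] (q : ℕ) with h | h
        · rw [h, one_mul, h0]
        · rw [h, neg_one_mul, coeff_neg, h0, neg_zero]
      have h1 := hopt (swapCol β a q) s hs'
      rw [wsum_swapCol, hb] at h1
      have e : ((s₀ : ℝ) - s) * wtZ ξ d = (s₀ : ℝ) * wtZ ξ d - (s : ℝ) * wtZ ξ d := by ring
      linarith
    · rw [if_neg hb, coeff_zero] at hq
      exact absurd rfl hq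
  exact towerRecordLemma γ γ' x d m' ξ S k hrec a hSa (minorT γ γ' ρ β) Q s₀ hs₀ hQa hrel hrel' hP hQ

/-- The record letters AT ONE WEIGHT `ξ`. -/
def recordLettersAt (γ γ' : Fin m → Fin n → ℂ[X]) (x : Fin n → Expo) (d : Fin 2 → ℤ) (m' : ℕ) (ξ : Fin 2 → ℝ) :
    Finset (Fin n) :=
  Finset.univ.filter fun a => ∃ (S : Fin n → ℕ) (k : ℕ), IsRecordT γ γ' x d m' ξ (S, k) ∧ 0 < S a

/-- **LEVEL-FREE LETTER BOUND**: for EVERY weight, at most `2m` record letters — arbitrary pencils (any degree, any levels). -/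
theorem card_recordLettersAt_le (γ γ' : Fin m → Fin n → ℂ[X]) (x : Fin n → Expo) (d : Fin 2 → ℤ) (m' : ℕ)
    (ξ : Fin 2 → ℝ) : (recordLettersAt γ γ' x d m' ξ).card ≤ 2 * m := by
  -- maximal order `r` of a non-vanishing minor
  let P : ℕ → Prop := fun k => ∀ (ρ : Fin k → Fin m ⊕ Fin m) (β : Fin k → Fin n), minorT γ γ' ρ β = 0
  have hP : P (2 * m + 1) := by
    intro ρ β
    obtain ⟨p, p', hne, heq⟩ := Fintype.exists_ne_map_eq_of_card_lt ρ (by simp; omega)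
    exact Matrix.det_zero_of_row_eq hne (funext fun u => by simp [Matrix.of_apply, heq])
  have hex : ∃ k, P k := ⟨_, hP⟩
  have h0 : ¬ P 0 := by
    intro h
    have := h Fin.elim0 Fin.elim0
    rw [minorT, Matrix.det_fin_zero] at this
    exact one_ne_zero this
  obtain ⟨r, hr⟩ : ∃ r, Nat.find hex = r + 1 :=
    Nat.exists_eq_succ_of_ne_zero (fun h => h0 (h ▸ Nat.find_spec hex))
  have hmax : P (r + 1) := hr ▸ Nat.find_spec hex
  have hr2 : r ≤ 2 * m := by
    have := Nat.find_le (h := hex) hP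
    omega
  have hnot : ¬ P r := Nat.find_min hex (by omega)
  simp only [P, not_forall] at hnot
  obtain ⟨ρ, β₀, hβ₀⟩ := hnot
  -- the `ξ`-optimal column selection
  let T : Finset ((Fin r → Fin n) × ℕ) :=
    (Finset.univ : Finset (Fin r → Fin n)).biUnion fun β' => ((minorT γ γ' ρ β').support).image fun s => (β', s)
  have hmemT : ∀ β' s, (β', s) ∈ T ↔ s ∈ (minorT γ γ' ρ β').support := by
    intro β' s
    simp only [T, Finset.mem_biUnion, Finset.mem_univ, true_and, Finset.mem_image, Prod.mk.injEq]
    constructor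
    · rintro ⟨β'', s', hs', h1, rfl⟩
      rw [← h1]
      exact hs'
    · intro hs
      exact ⟨β', s, hs, rfl, rfl⟩
  have hT : T.Nonempty := by
    obtain ⟨s, hs⟩ := Finset.nonempty_iff_ne_empty.mpr (mt Polynomial.support_eq_empty.mp hβ₀)
    exact ⟨(β₀, s), (hmemT β₀ s).mpr hs⟩
  obtain ⟨⟨β, s₀⟩, hβT, hopt⟩ := Finset.exists_max_image T (fun βs => wsum ξ x βs.1 + (βs.2 : ℝ) * wtZ ξ d) hT
  have hs₀ : (minorT γ γ' ρ β).coeff s₀ ≠ 0 := Polynomial.mem_support_iff.mp ((hmemT β s₀).mp hβT)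
  have hopt' : ∀ β' : Fin r → Fin n, ∀ s ∈ (minorT γ γ' ρ β').support,
      wsum ξ x β' + (s : ℝ) * wtZ ξ d ≤ wsum ξ x β + (s₀ : ℝ) * wtZ ξ d :=
    fun β' s hs => hopt (β', s) ((hmemT β' s).mpr hs)
  -- every record letter is a column of `β`
  have hsub : recordLettersAt γ γ' x d m' ξ ⊆ Finset.univ.image β := by
    intro a ha
    simp only [recordLettersAt, Finset.mem_filter, Finset.mem_univ, true_and] at ha
    obtain ⟨S, k, hrec, hSa⟩ := ha
    by_contra hna
    have ha' : ∀ q, β q ≠ a := fun q h => hna (Finset.mem_image.mpr ⟨q, Finset.mem_univ _, h⟩)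
    exact cramerRecordLemma γ γ' x d m' ξ S k hrec ρ β s₀ hs₀ hmax hopt' a hSa ha'
  calc (recordLettersAt γ γ' x d m' ξ).card ≤ (Finset.univ.image β).card := Finset.card_le_card hsub
    _ ≤ (Finset.univ : Finset (Fin r)).card := Finset.card_image_le
    _ = r := by simp
    _ ≤ 2 * m := hr2

/-- FEW LETTER SETS: `≤ L` sets of `≤ 2m` letters such that every weight's record letters lie in one of them. -/
def FewLetterSets (γ γ' : Fin m → Fin n → ℂ[X]) (x : Fin n → Expo) (d : Fin 2 → ℤ) (m' L : ℕ) : Prop :=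
  ∃ 𝒩 : Finset (Finset (Fin n)), 𝒩.card ≤ L ∧ (∀ N ∈ 𝒩, N.card ≤ 2 * m) ∧
    ∀ ξ : Fin 2 → ℝ, ∃ N ∈ 𝒩, recordLettersAt γ γ' x d m' ξ ⊆ N

/-- Reduction: few letter sets ⇒ few records (`k ∈ {kmax, kmin}` per `S`). -/
theorem count_of_fewLetterSets (m n D L : ℕ) (γ γ' : Fin m → Fin n → ℂ[X]) (hγD : DegLe γ D) (hγ'D : DegLe γ' D)
    (x : Fin n → Expo) (d : Fin 2 → ℤ) (h : FewLetterSets γ γ' x d m L) :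
    ((shallowPairsT n m D).filter fun p => ∃ ξ : Fin 2 → ℝ, IsRecordT γ γ' x d m ξ p).card
      ≤ L * (2 * ((m + 1) * 2 ^ (2 * m + m))) := by
  obtain ⟨𝒩, hcard, hsize, hcover⟩ := h
  calc _ ≤ (𝒩.biUnion fun N => candidatesT γ γ' D m N).card := Finset.card_le_card ?_
    _ ≤ ∑ N ∈ 𝒩, (candidatesT γ γ' D m N).card := Finset.card_biUnion_le
    _ ≤ ∑ _N ∈ 𝒩, 2 * ((m + 1) * 2 ^ (2 * m + m)) :=
        Finset.sum_le_sum fun N hN => card_candidatesT_le γ γ' D m (2 * m) _ (hsize N hN)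
    _ = 𝒩.card * (2 * ((m + 1) * 2 ^ (2 * m + m))) := by rw [Finset.sum_const, smul_eq_mul]
    _ ≤ L * (2 * ((m + 1) * 2 ^ (2 * m + m))) := Nat.mul_le_mul_right _ hcard
  rintro ⟨S, k⟩ hp
  rw [Finset.mem_filter] at hp
  obtain ⟨-, ξ, hrec⟩ := hp
  obtain ⟨N, hN, hsub⟩ := hcover ξ
  rw [Finset.mem_biUnion]
  refine ⟨N, hN, ?_⟩
  have hlive := hrec.1
  simp only [liveT, Set.mem_setOf_eq] at hlive
  obtain ⟨hsizeS, -⟩ := hlive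
  have hS : S ∈ msets N m :=
    mem_msets hsizeS fun a ha => hsub (by
      simp only [recordLettersAt, Finset.mem_filter, Finset.mem_univ, true_and]
      exact ⟨S, k, hrec, Nat.pos_of_ne_zero ha⟩)
  rcases record_k γ γ' D hγD hγ'D x d m ξ S k hrec with h | h
  · exact Finset.mem_union_left _ (Finset.mem_image.mpr ⟨S, hS, by rw [h]⟩)
  · exact Finset.mem_union_right _ (Finset.mem_image.mpr ⟨S, hS, by rw [h]⟩)

/-- **VERTEX WALK BOUND** (PROVED in §12, `vertexWalkBound_holds`: Grassmann–Plücker exchange + rank potential + envelope walk):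
the sweep `ξ ↦ β*(ξ)` meets at most `4mn + 4` optimal column sets. -/
def VertexWalkBound : Prop :=
  ∀ (m n : ℕ) (γ γ' : Fin m → Fin n → ℂ[X]) (x : Fin n → Expo) (d : Fin 2 → ℤ), FewLetterSets γ γ' x d m (4 * m * n + 4)

/-- **LEVEL-FREE RECORD LAW** (crit-8's Q-R13, coefficient side): ARBITRARY pencils, bound independent of degrees and levels. -/
def LevelFreeRecordLaw : Prop :=
  ∃ a b : ℕ, ∀ (m n t D : ℕ) (γ γ' : Fin m → Fin n → ℂ[X]) (x : Fin n → Expo) (d : Fin 2 → ℤ),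
    DegLe γ D → DegLe γ' D → n ≤ 2 * m * t →
    ((shallowPairsT n m D).filter fun p => ∃ ξ : Fin 2 → ℝ, IsRecordT γ γ' x d m ξ p).card
      ≤ 2 ^ (a * m) * (t + 2) ^ b

theorem arith_levelFree (m n t : ℕ) (hm : 1 ≤ m) (hn : n ≤ 2 * m * t) :
    (4 * m * n + 4) * (2 * ((m + 1) * 2 ^ (2 * m + m))) ≤ 2 ^ (11 * m) * (t + 2) ^ 1 := by
  obtain ⟨X, hX⟩ : ∃ X : ℕ, X = 2 ^ m := ⟨_, rfl⟩
  have hmX : m + 1 ≤ X := hX ▸ Nat.lt_two_pow_self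
  have hX2 : 2 ≤ X := by
    rw [hX]
    calc (2 : ℕ) = 2 ^ 1 := (pow_one 2).symm
      _ ≤ 2 ^ m := Nat.pow_le_pow_right (by norm_num) hm
  have h3 : 2 ^ (2 * m + m) = X ^ 3 := by
    rw [hX, ← pow_mul]
    ring_nf
  have h11 : 2 ^ (11 * m) = X ^ 11 := by rw [hX, ← pow_mul, mul_comm]
  rw [h3, h11, pow_one]
  have hA : 4 * m * n + 4 ≤ 12 * (X ^ 2 * (t + 2)) := by
    have h1 : 4 * m * n ≤ 8 * (m * m) * t := by
      calc 4 * m * n ≤ 4 * m * (2 * m * t) := Nat.mul_le_mul_left _ hn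
        _ = 8 * (m * m) * t := by ring
    have h2 : m * m ≤ X ^ 2 := by
      calc m * m ≤ X * X := Nat.mul_le_mul (by omega) (by omega)
        _ = X ^ 2 := (sq X).symm
    have h3 : 8 * (m * m) * t ≤ 8 * X ^ 2 * (t + 2) := Nat.mul_le_mul (Nat.mul_le_mul_left 8 h2) (by omega)
    have h4 : 1 ≤ X ^ 2 * (t + 2) := Nat.one_le_iff_ne_zero.mpr (by positivity)
    nlinarith
  have hC : 2 * ((m + 1) * X ^ 3) ≤ 2 * (X * X ^ 3) := Nat.mul_le_mul_left 2 (Nat.mul_le_mul_right _ hmX)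
  have h24 : 24 ≤ X ^ 5 :=
    calc (24 : ℕ) ≤ 2 ^ 5 := by norm_num
      _ ≤ X ^ 5 := Nat.pow_le_pow_left hX2 5
  calc (4 * m * n + 4) * (2 * ((m + 1) * X ^ 3)) ≤ 12 * (X ^ 2 * (t + 2)) * (2 * (X * X ^ 3)) := Nat.mul_le_mul hA hC
    _ = 24 * (X ^ 6 * (t + 2)) := by ring
    _ ≤ X ^ 5 * (X ^ 6 * (t + 2)) := Nat.mul_le_mul_right _ h24
    _ = X ^ 11 * (t + 2) := by ring

/-- **REDUCTION, PROVED**: the vertex walk bound implies the level-free record law with `(a, b) = (11, 1)` — LINEAR in `t`. -/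
theorem levelFree_of_vertexWalk (hV : VertexWalkBound) : LevelFreeRecordLaw := by
  refine ⟨11, 1, fun m n t D γ γ' x d hγD hγ'D hn => ?_⟩
  rcases Nat.eq_zero_or_pos m with rfl | hm
  · have h0 : ((shallowPairsT n 0 D).filter fun p => ∃ ξ : Fin 2 → ℝ, IsRecordT γ γ' x d 0 ξ p).card = 0 := by
      rw [Finset.card_eq_zero, Finset.filter_eq_empty_iff]
      rintro p - ⟨ξ, hrec⟩
      have h := hrec.1
      simp only [liveT, Set.mem_setOf_eq, layerT, momentPolyT] at h
      exact h.2 (by simp)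
    rw [h0]
    exact Nat.zero_le _
  exact (count_of_fewLetterSets m n D _ γ γ' hγD hγ'D x d (hV m n γ γ' x d)).trans (arith_levelFree m n t hm hn)

end Cramer

/-! ## 12. `VertexWalkBound` and `LevelFreeRecordLaw` in the kernel (rev 5): Grassmann–Plücker exchange, rank potential, envelope walk

(i) `gp_rows`/`gp_minor`: in-place Grassmann–Plücker over `ℂ[X]` (Cramer's rule `Matrix.mulVec_cramer` + row-linearity of `det`).
(ii) `opt_exchange`: for `ξ`-optimal `(β₁,s₁)`, `(β₂,s₂)` (rows `ρ` fixed) and `u₁` there is `u₂` with BOTH exchanged selections optimal —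
read off the `z^{ŝ₁+ŝ₂}` coefficient of GP, `ŝ = natDegree` if `ξ·d ≥ 0`, `natTrailingDegree` if `< 0` (`topExp`).
(iii) `psi_chain`: `Ψ(β) = Σ_u #{b'' : ζ·x_{b''} < ζ·x_{β u}}`; inside `Opt(ξ)`, if `β⁺` is `ζ`-maximal then `Ψ β ≤ Ψ β⁺`, strictly if
`ζ·x(β) < ζ·x(β⁺)` (induction on `#{u : β u ∉ range β⁺}` using (ii) and injectivity of optimal selections).
(iv) `envelope`/`exists_lineFamily` (abstract, any finite `T`, scores `α + θσ`): if (F3) `Ψ` rises strictly towards the right vertex inside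
every optimal set, then between right vertices at `θ₁ < θ₂` that differ as points `Ψ` rises strictly (strong induction on the crossing set
`{o : σ p < σ o}` through the next breakpoint `μ = min (α p − α o)/(σ o − σ p)`), so the right vertex FACTORS THROUGH `Φ = max Ψ ∈ [0, B]`:
`≤ B+1` right vertices per line.  Assembly (`vertexWalkBound_holds`): frame `ν = d`, `ζ = d^⊥` (`d = 0`: `e₀, e₁`), every `ξ = aν + bζ`;
`a > 0`: `Opt(ξ) = Opt(ν + (b/a)ζ)` (positive scaling), `a < 0`: the line `−ν + θζ`, `a = 0`: `Opt(±ζ)`, `Opt(0)`; the letter set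
`N = ⋂_{p ∈ RV} range p` has `≤ r ≤ 2m` elements and contains the record letters (Cramer cover `letters_subset_of_isOpt`); in all
`≤ 2(r(n−1)+1) + 3 ≤ 4mn + 4` sets (`m, n ≥ 1`; else `{∅}`).  Hence `levelFreeRecordLaw_holds`. -/

section Walk

/-- Row form of the pencil minor matrix (rows = selected carriers, columns = selected factor rows). -/
def rowM (γ γ' : Fin m → Fin n → ℂ[X]) {r : ℕ} (ρ : Fin r → Fin m ⊕ Fin m) (β : Fin r → Fin n) :
    Matrix (Fin r) (Fin r) ℂ[X] :=
  Matrix.of fun u p => tvec γ γ' (β u) (ρ p)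

theorem minorT_eq_rowM (γ γ' : Fin m → Fin n → ℂ[X]) {r : ℕ} (ρ : Fin r → Fin m ⊕ Fin m) (β : Fin r → Fin n) :
    minorT γ γ' ρ β = (rowM γ γ' ρ β).det := by
  unfold minorT rowM
  rw [← Matrix.det_transpose]
  rfl

theorem rowM_updateRow (γ γ' : Fin m → Fin n → ℂ[X]) {r : ℕ} (ρ : Fin r → Fin m ⊕ Fin m) (β : Fin r → Fin n)
    (u₁ : Fin r) (b : Fin n) :
    (rowM γ γ' ρ β).updateRow u₁ (fun p => tvec γ γ' b (ρ p)) = rowM γ γ' ρ (Function.update β u₁ b) := by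
  ext u p
  simp only [Matrix.updateRow_apply, rowM, Matrix.of_apply, Function.update_apply]
  split_ifs <;> rfl

/-- Determinant as a linear function of one row. -/
def rowDetLin {r : ℕ} (M : Matrix (Fin r) (Fin r) ℂ[X]) (j : Fin r) : (Fin r → ℂ[X]) →ₗ[ℂ[X]] ℂ[X] where
  toFun w := (M.updateRow j w).det
  map_add' u v := Matrix.det_updateRow_add M j u v
  map_smul' c u := by simp only [Matrix.det_updateRow_smul, smul_eq_mul, RingHom.id_apply]

/-- GRASSMANN–PLÜCKER, in-place row form: Cramer's rule + linearity of `det` in one row. -/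
theorem gp_rows {r : ℕ} (R₁ R₂ : Matrix (Fin r) (Fin r) ℂ[X]) (u₁ : Fin r) :
    R₂.det * R₁.det = ∑ u, (R₂.updateRow u (R₁ u₁)).det * (R₁.updateRow u₁ (R₂ u)).det := by
  have hc := Matrix.mulVec_cramer (Matrix.transpose R₂) (R₁ u₁)
  rw [Matrix.det_transpose] at hc
  have hfun : R₂.det • R₁ u₁ = ∑ u, (Matrix.cramer (Matrix.transpose R₂) (R₁ u₁) u) • R₂ u := by
    rw [← hc]
    funext p
    simp only [Matrix.mulVec, dotProduct, Matrix.transpose_apply, Finset.sum_apply, Pi.smul_apply, smul_eq_mul]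
    exact Finset.sum_congr rfl fun u _ => mul_comm _ _
  have key : ∀ w, (R₁.updateRow u₁ w).det = rowDetLin R₁ u₁ w := fun w => rfl
  calc R₂.det * R₁.det = rowDetLin R₁ u₁ (R₂.det • R₁ u₁) := by
        rw [map_smul, smul_eq_mul, ← key, Matrix.updateRow_eq_self]
    _ = rowDetLin R₁ u₁ (∑ u, (Matrix.cramer (Matrix.transpose R₂) (R₁ u₁) u) • R₂ u) := by rw [hfun]
    _ = ∑ u, Matrix.cramer (Matrix.transpose R₂) (R₁ u₁) u * rowDetLin R₁ u₁ (R₂ u) := by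
        rw [map_sum]
        simp only [map_smul, smul_eq_mul]
    _ = ∑ u, (R₂.updateRow u (R₁ u₁)).det * (R₁.updateRow u₁ (R₂ u)).det := by
        refine Finset.sum_congr rfl fun u _ => ?_
        rw [Matrix.cramer_apply, Matrix.updateCol_transpose, Matrix.det_transpose, ← key]

/-- GP for pencil minors. -/
theorem gp_minor (γ γ' : Fin m → Fin n → ℂ[X]) {r : ℕ} (ρ : Fin r → Fin m ⊕ Fin m) (β₁ β₂ : Fin r → Fin n)
    (u₁ : Fin r) :
    minorT γ γ' ρ β₂ * minorT γ γ' ρ β₁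
      = ∑ u, minorT γ γ' ρ (Function.update β₂ u (β₁ u₁)) * minorT γ γ' ρ (Function.update β₁ u₁ (β₂ u)) := by
  simp only [minorT_eq_rowM]
  rw [gp_rows (rowM γ γ' ρ β₁) (rowM γ γ' ρ β₂) u₁]
  refine Finset.sum_congr rfl fun u _ => ?_
  rw [← rowM_updateRow γ γ' ρ β₂ u (β₁ u₁), ← rowM_updateRow γ γ' ρ β₁ u₁ (β₂ u)]
  rfl

/-- Score of a (column selection, exponent) pair at weight `ξ`. -/
def score (ξ : Fin 2 → ℝ) (x : Fin n → Expo) (d : Fin 2 → ℤ) {r : ℕ} (β : Fin r → Fin n) (s : ℕ) : ℝ :=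
  wsum ξ x β + (s : ℝ) * wtZ ξ d

/-- `ξ`-optimality of `(β, s)` among pairs with `coeff s (minor β) ≠ 0` (rows `ρ` fixed). -/
def IsOpt (γ γ' : Fin m → Fin n → ℂ[X]) (x : Fin n → Expo) (d : Fin 2 → ℤ) (ξ : Fin 2 → ℝ) {r : ℕ}
    (ρ : Fin r → Fin m ⊕ Fin m) (β : Fin r → Fin n) (s : ℕ) : Prop :=
  (minorT γ γ' ρ β).coeff s ≠ 0 ∧
    ∀ (β' : Fin r → Fin n) (s' : ℕ), (minorT γ γ' ρ β').coeff s' ≠ 0 → score ξ x d β' s' ≤ score ξ x d β s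

theorem wsum_update (ξ : Fin 2 → ℝ) (x : Fin n → Expo) {r : ℕ} (β : Fin r → Fin n) (u₁ : Fin r) (b : Fin n) :
    wsum ξ x (Function.update β u₁ b) = wsum ξ x β - wt ξ (x (β u₁)) + wt ξ (x b) := by
  simp only [wsum]
  have h : ∀ u, wt ξ (x (Function.update β u₁ b u))
      = wt ξ (x (β u)) + (if u = u₁ then wt ξ (x b) - wt ξ (x (β u₁)) else 0) := by
    intro u
    by_cases hu : u = u₁
    · subst hu
      simp
    · simp [hu]
  rw [Finset.sum_congr rfl fun u _ => h u, Finset.sum_add_distrib, Finset.sum_ite_eq' Finset.univ u₁]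
  simp only [Finset.mem_univ, if_true]
  ring

/-- The `ξ`-extreme exponent of a polynomial: top degree if `ξ·d ≥ 0`, bottom degree otherwise. -/
def topExp (c : ℝ) (P : ℂ[X]) : ℕ := if 0 ≤ c then P.natDegree else P.natTrailingDegree

theorem coeff_topExp_ne (c : ℝ) {P : ℂ[X]} (hP : P ≠ 0) : P.coeff (topExp c P) ≠ 0 := by
  unfold topExp
  split_ifs
  · exact Polynomial.leadingCoeff_ne_zero.mpr hP
  · exact mt Polynomial.trailingCoeff_eq_zero.mp hP

theorem topExp_score_le (c : ℝ) {P : ℂ[X]} {s : ℕ} (hs : P.coeff s ≠ 0) : (s : ℝ) * c ≤ (topExp c P : ℝ) * c := by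
  unfold topExp
  split_ifs with hc
  · exact mul_le_mul_of_nonneg_right (by exact_mod_cast Polynomial.le_natDegree_of_ne_zero hs) hc
  · exact mul_le_mul_of_nonpos_right (by exact_mod_cast Polynomial.natTrailingDegree_le_of_ne_zero hs) (le_of_lt (not_le.mp hc))

theorem coeff_mul_topExp_ne (c : ℝ) {P Q : ℂ[X]} (hP : P ≠ 0) (hQ : Q ≠ 0) :
    (P * Q).coeff (topExp c P + topExp c Q) ≠ 0 := by
  unfold topExp
  split_ifs
  · rw [Polynomial.coeff_mul_degree_add_degree]
    exact mul_ne_zero (Polynomial.leadingCoeff_ne_zero.mpr hP) (Polynomial.leadingCoeff_ne_zero.mpr hQ)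
  · rw [Polynomial.coeff_mul_natTrailingDegree_add_natTrailingDegree]
    exact mul_ne_zero (mt Polynomial.trailingCoeff_eq_zero.mp hP) (mt Polynomial.trailingCoeff_eq_zero.mp hQ)

theorem isOpt_top {γ γ' : Fin m → Fin n → ℂ[X]} {x : Fin n → Expo} {d : Fin 2 → ℤ} {ξ : Fin 2 → ℝ} {r : ℕ}
    {ρ : Fin r → Fin m ⊕ Fin m} {β : Fin r → Fin n} {s : ℕ} (h : IsOpt γ γ' x d ξ ρ β s) :
    IsOpt γ γ' x d ξ ρ β (topExp (wtZ ξ d) (minorT γ γ' ρ β)) := by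
  have hne : minorT γ γ' ρ β ≠ 0 := fun h0 => h.1 (by rw [h0, coeff_zero])
  refine ⟨coeff_topExp_ne _ hne, fun β' s' hs' => (h.2 β' s' hs').trans ?_⟩
  unfold score
  have := topExp_score_le (wtZ ξ d) h.1
  linarith

/-- SYMMETRIC EXCHANGE inside the optimal set (Grassmann–Plücker + extremality of the top exponents). -/
theorem opt_exchange {γ γ' : Fin m → Fin n → ℂ[X]} {x : Fin n → Expo} {d : Fin 2 → ℤ} {ξ : Fin 2 → ℝ} {r : ℕ}
    {ρ : Fin r → Fin m ⊕ Fin m} {β₁ β₂ : Fin r → Fin n} {s₁ s₂ : ℕ}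
    (h₁ : IsOpt γ γ' x d ξ ρ β₁ s₁) (h₂ : IsOpt γ γ' x d ξ ρ β₂ s₂) (u₁ : Fin r) :
    ∃ (u₂ : Fin r) (s₁' s₂' : ℕ), IsOpt γ γ' x d ξ ρ (Function.update β₁ u₁ (β₂ u₂)) s₁' ∧
      IsOpt γ γ' x d ξ ρ (Function.update β₂ u₂ (β₁ u₁)) s₂' := by
  set c := wtZ ξ d with hc
  have o₁ := isOpt_top h₁
  have o₂ := isOpt_top h₂
  set t₁ := topExp c (minorT γ γ' ρ β₁)
  set t₂ := topExp c (minorT γ γ' ρ β₂)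
  have hne₁ : minorT γ γ' ρ β₁ ≠ 0 := fun h0 => h₁.1 (by rw [h0, coeff_zero])
  have hne₂ : minorT γ γ' ρ β₂ ≠ 0 := fun h0 => h₂.1 (by rw [h0, coeff_zero])
  -- the `z^{t₂+t₁}` coefficient of GP
  have hprod := coeff_mul_topExp_ne c hne₂ hne₁
  rw [gp_minor γ γ' ρ β₁ β₂ u₁, finsetSum_coeff] at hprod
  obtain ⟨u₂, -, hu₂⟩ := Finset.exists_ne_zero_of_sum_ne_zero hprod
  rw [Polynomial.coeff_mul] at hu₂
  obtain ⟨⟨i, j⟩, hij, hterm⟩ := Finset.exists_ne_zero_of_sum_ne_zero hu₂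
  replace hij : i + j = _ := Finset.HasAntidiagonal.mem_antidiagonal.mp hij
  simp only at hterm
  have hi : (minorT γ γ' ρ (Function.update β₂ u₂ (β₁ u₁))).coeff i ≠ 0 := fun h0 => hterm (by rw [h0, zero_mul])
  have hj : (minorT γ γ' ρ (Function.update β₁ u₁ (β₂ u₂))).coeff j ≠ 0 := fun h0 => hterm (by rw [h0, mul_zero])
  -- scores
  have e12 : score ξ x d β₁ t₁ = score ξ x d β₂ t₂ := le_antisymm (o₂.2 β₁ t₁ o₁.1) (o₁.2 β₂ t₂ o₂.1)
  have hA := o₁.2 _ j hj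
  have hB := o₁.2 _ i hi
  have hsum : score ξ x d (Function.update β₁ u₁ (β₂ u₂)) j + score ξ x d (Function.update β₂ u₂ (β₁ u₁)) i
      = score ξ x d β₁ t₁ + score ξ x d β₂ t₂ := by
    simp only [score, wsum_update]
    have hij' : (i : ℝ) + j = (t₂ : ℝ) + t₁ := by exact_mod_cast hij
    have : (j : ℝ) * c + (i : ℝ) * c = (t₁ : ℝ) * c + (t₂ : ℝ) * c := by
      have := congrArg (· * c) hij'
      simp only [add_mul] at this
      linarith
    rw [hc] at this
    linarith
  have hA' : score ξ x d (Function.update β₁ u₁ (β₂ u₂)) j = score ξ x d β₁ t₁ := by linarith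
  have hB' : score ξ x d (Function.update β₂ u₂ (β₁ u₁)) i = score ξ x d β₁ t₁ := by linarith
  exact ⟨u₂, j, i, ⟨hj, fun β' s' hs' => hA' ▸ o₁.2 β' s' hs'⟩, ⟨hi, fun β' s' hs' => hB' ▸ o₁.2 β' s' hs'⟩⟩

theorem injective_of_isOpt {γ γ' : Fin m → Fin n → ℂ[X]} {x : Fin n → Expo} {d : Fin 2 → ℤ} {ξ : Fin 2 → ℝ} {r : ℕ}
    {ρ : Fin r → Fin m ⊕ Fin m} {β : Fin r → Fin n} {s : ℕ} (h : IsOpt γ γ' x d ξ ρ β s) :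
    Function.Injective β := by
  intro u u' huu
  by_contra hne
  apply h.1
  rw [minorT_eq_rowM, Matrix.det_zero_of_row_eq hne (funext fun p => by simp [rowM, Matrix.of_apply, huu]), coeff_zero]

/-! ### Rank potential -/

/-- `#{b'' : ζ·x_{b''} < ζ·x_b}`. -/
def phiN (ζ : Fin 2 → ℝ) (x : Fin n → Expo) (b : Fin n) : ℕ :=
  (Finset.univ.filter fun b'' : Fin n => wt ζ (x b'') < wt ζ (x b)).card

/-- The rank potential `Ψ(β) = Σ_u #{b'' : λ_{b''} < λ_{β u}}`. -/
def Psi (ζ : Fin 2 → ℝ) (x : Fin n → Expo) {r : ℕ} (β : Fin r → Fin n) : ℕ := ∑ u, phiN ζ x (β u)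

theorem phiN_mono (ζ : Fin 2 → ℝ) (x : Fin n → Expo) {b b' : Fin n} (h : wt ζ (x b) ≤ wt ζ (x b')) :
    phiN ζ x b ≤ phiN ζ x b' :=
  Finset.card_le_card fun b'' hb'' => by
    simp only [Finset.mem_filter, Finset.mem_univ, true_and] at hb'' ⊢
    exact lt_of_lt_of_le hb'' h

theorem phiN_strict (ζ : Fin 2 → ℝ) (x : Fin n → Expo) {b b' : Fin n} (h : wt ζ (x b) < wt ζ (x b')) :
    phiN ζ x b < phiN ζ x b' := by
  refine Finset.card_lt_card (Finset.ssubset_iff_subset_ne.mpr ⟨fun b'' hb'' => ?_, fun heq => ?_⟩)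
  · simp only [Finset.mem_filter, Finset.mem_univ, true_and] at hb'' ⊢
    exact hb''.trans h
  · have hb : b ∈ Finset.univ.filter fun b'' : Fin n => wt ζ (x b'') < wt ζ (x b') := by simp [h]
    rw [← heq] at hb
    simp at hb

theorem phiN_le (ζ : Fin 2 → ℝ) (x : Fin n → Expo) (b : Fin n) : phiN ζ x b ≤ n - 1 := by
  have h : (Finset.univ.filter fun b'' : Fin n => wt ζ (x b'') < wt ζ (x b)) ⊆ Finset.univ.erase b := by
    intro b'' hb''
    simp only [Finset.mem_filter, Finset.mem_univ, true_and] at hb''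
    exact Finset.mem_erase.mpr ⟨fun h => by rw [h] at hb''; exact lt_irrefl _ hb'', Finset.mem_univ _⟩
  have := Finset.card_le_card h
  rw [Finset.card_erase_of_mem (Finset.mem_univ _), Finset.card_univ, Fintype.card_fin] at this
  exact this

theorem Psi_le (ζ : Fin 2 → ℝ) (x : Fin n → Expo) {r : ℕ} (β : Fin r → Fin n) : Psi ζ x β ≤ r * (n - 1) := by
  unfold Psi
  calc ∑ u, phiN ζ x (β u) ≤ ∑ _u : Fin r, (n - 1) := Finset.sum_le_sum fun u _ => phiN_le ζ x (β u)
    _ = r * (n - 1) := by simp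

theorem Psi_update (ζ : Fin 2 → ℝ) (x : Fin n → Expo) {r : ℕ} (β : Fin r → Fin n) (u₁ : Fin r) (b : Fin n) :
    Psi ζ x (Function.update β u₁ b) + phiN ζ x (β u₁) = Psi ζ x β + phiN ζ x b := by
  simp only [Psi]
  have h : ∀ u, phiN ζ x (Function.update β u₁ b u) + (if u = u₁ then phiN ζ x (β u₁) else 0)
      = phiN ζ x (β u) + (if u = u₁ then phiN ζ x b else 0) := by
    intro u
    by_cases hu : u = u₁
    · subst hu
      simp [add_comm]
    · simp [hu]
  have := Finset.sum_congr rfl fun u (_ : u ∈ Finset.univ) => h u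
  simp only [Finset.sum_add_distrib, Finset.sum_ite_eq' Finset.univ u₁, Finset.mem_univ, if_true] at this
  exact this

theorem sum_eq_sum_image {M : Type*} [AddCommMonoid M] {r : ℕ} (β : Fin r → Fin n) (hβ : Function.Injective β)
    (g : Fin n → M) : ∑ u, g (β u) = ∑ b ∈ Finset.univ.image β, g b := by
  rw [Finset.sum_image fun u _ u' _ h => hβ h]

/-- THE CHAIN: inside `Opt(ξ)`, walking from `β` to the `ζ`-maximal `β⁺` by GP exchanges never lowers `Ψ`, and raises it when
the `ζ`-weight rises. -/
theorem psi_chain {γ γ' : Fin m → Fin n → ℂ[X]} {x : Fin n → Expo} {d : Fin 2 → ℤ} {ξ : Fin 2 → ℝ} (ζ : Fin 2 → ℝ)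
    {r : ℕ} {ρ : Fin r → Fin m ⊕ Fin m} {βp : Fin r → Fin n} {sp : ℕ} (hp : IsOpt γ γ' x d ξ ρ βp sp)
    (hlam : ∀ (β' : Fin r → Fin n) (s' : ℕ), IsOpt γ γ' x d ξ ρ β' s' → wsum ζ x β' ≤ wsum ζ x βp) :
    ∀ (k : ℕ) (β : Fin r → Fin n) (s : ℕ), IsOpt γ γ' x d ξ ρ β s →
      (Finset.univ.filter fun u => β u ∉ Finset.univ.image βp).card = k →
      Psi ζ x β ≤ Psi ζ x βp ∧ (wsum ζ x β < wsum ζ x βp → Psi ζ x β < Psi ζ x βp) := by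
  intro k
  induction k with
  | zero =>
    intro β s hβ hk
    rw [Finset.card_eq_zero, Finset.filter_eq_empty_iff] at hk
    have hsub : Finset.univ.image β ⊆ Finset.univ.image βp := by
      intro b hb
      obtain ⟨u, -, rfl⟩ := Finset.mem_image.mp hb
      exact not_not.mp (hk (Finset.mem_univ u))
    have hinj := injective_of_isOpt hβ
    have hinjp := injective_of_isOpt hp
    have hc1 : (Finset.univ.image β).card = r := by
      rw [Finset.card_image_of_injective _ hinj, Finset.card_univ, Fintype.card_fin]
    have hc2 : (Finset.univ.image βp).card = r := by
      rw [Finset.card_image_of_injective _ hinjp, Finset.card_univ, Fintype.card_fin]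
    have heq : Finset.univ.image β = Finset.univ.image βp := Finset.eq_of_subset_of_card_le hsub (by rw [hc1, hc2])
    have hPsi : Psi ζ x β = Psi ζ x βp := by
      unfold Psi
      rw [sum_eq_sum_image β hinj, sum_eq_sum_image βp hinjp, heq]
    have hws : wsum ζ x β = wsum ζ x βp := by
      unfold wsum
      rw [sum_eq_sum_image β hinj (fun b => wt ζ (x b)), sum_eq_sum_image βp hinjp (fun b => wt ζ (x b)), heq]
    exact ⟨hPsi.le, fun h => absurd (hws ▸ h) (lt_irrefl _)⟩
  | succ k ih =>
    intro β s hβ hk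
    obtain ⟨u₁, hu₁⟩ : (Finset.univ.filter fun u => β u ∉ Finset.univ.image βp).Nonempty := by
      rw [← Finset.card_pos, hk]
      exact Nat.succ_pos k
    have hu₁' : β u₁ ∉ Finset.univ.image βp := (Finset.mem_filter.mp hu₁).2
    obtain ⟨u₂, s₁', s₂', ho₁, ho₂⟩ := opt_exchange hβ hp u₁
    have hle : wt ζ (x (β u₁)) ≤ wt ζ (x (βp u₂)) := by
      have := hlam _ _ ho₂
      rw [wsum_update] at this
      linarith
    have hk' : (Finset.univ.filter fun u => Function.update β u₁ (βp u₂) u ∉ Finset.univ.image βp).card = k := by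
      have hset : (Finset.univ.filter fun u => Function.update β u₁ (βp u₂) u ∉ Finset.univ.image βp)
          = (Finset.univ.filter fun u => β u ∉ Finset.univ.image βp).erase u₁ := by
        ext u
        simp only [Finset.mem_filter, Finset.mem_univ, true_and, Finset.mem_erase]
        by_cases hu : u = u₁
        · subst hu
          simp
        · simp [hu]
      rw [hset, Finset.card_erase_of_mem hu₁, hk]
      rfl
    obtain ⟨ih1, ih2⟩ := ih _ _ ho₁ hk'
    have hup := Psi_update ζ x β u₁ (βp u₂)
    have hmono := phiN_mono ζ x hle
    refine ⟨by omega, fun hlt => ?_⟩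
    rcases lt_or_eq_of_le hle with hlt' | heq'
    · have := phiN_strict ζ x hlt'
      omega
    · have hws : wsum ζ x (Function.update β u₁ (βp u₂)) = wsum ζ x β := by rw [wsum_update, heq']; ring
      have := ih2 (hws ▸ hlt)
      omega

end Walk

/-! ### The envelope walk (abstract): optimal sets along a pencil of slopes -/

section Envelope

variable {ι : Type*}

/-- Optimal set at slope `θ`: maximisers of `α + θ σ` over `T`. -/
def OptA (T : Finset ι) (α σ : ι → ℝ) (θ : ℝ) : Finset ι :=
  T.filter fun p => ∀ q ∈ T, α q + θ * σ q ≤ α p + θ * σ p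

/-- Right vertex at slope `θ`: the `σ`-maximal optimal elements. -/
def RVA (T : Finset ι) (α σ : ι → ℝ) (θ : ℝ) : Finset ι :=
  (OptA T α σ θ).filter fun p => ∀ q ∈ OptA T α σ θ, σ q ≤ σ p

/-- Envelope potential: the largest `Ψ` on the right vertex. -/
def PhiA (T : Finset ι) (α σ : ι → ℝ) (Ψv : ι → ℕ) (θ : ℝ) : ℕ := (RVA T α σ θ).sup Ψv

variable {T : Finset ι} {α σ : ι → ℝ}

theorem mem_OptA {θ : ℝ} {p : ι} : p ∈ OptA T α σ θ ↔ p ∈ T ∧ ∀ q ∈ T, α q + θ * σ q ≤ α p + θ * σ p :=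
  Finset.mem_filter

theorem mem_RVA {θ : ℝ} {p : ι} : p ∈ RVA T α σ θ ↔ p ∈ OptA T α σ θ ∧ ∀ q ∈ OptA T α σ θ, σ q ≤ σ p :=
  Finset.mem_filter

theorem OptA_nonempty (hT : T.Nonempty) (θ : ℝ) : (OptA T α σ θ).Nonempty := by
  obtain ⟨p, hp, hmax⟩ := Finset.exists_max_image T (fun q => α q + θ * σ q) hT
  exact ⟨p, mem_OptA.mpr ⟨hp, hmax⟩⟩

theorem RVA_nonempty (hT : T.Nonempty) (θ : ℝ) : (RVA T α σ θ).Nonempty := by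
  obtain ⟨q, hq, hqmax⟩ := Finset.exists_max_image _ σ (OptA_nonempty (α := α) (σ := σ) hT θ)
  exact ⟨q, mem_RVA.mpr ⟨hq, hqmax⟩⟩

theorem sigma_le_of_opt {θ₁ θ₂ : ℝ} (h : θ₁ < θ₂) {p q : ι} (hp : p ∈ OptA T α σ θ₁) (hq : q ∈ OptA T α σ θ₂) :
    σ p ≤ σ q := by
  have h1 := (mem_OptA.mp hp).2 q (mem_OptA.mp hq).1
  have h2 := (mem_OptA.mp hq).2 p (mem_OptA.mp hp).1
  by_contra hlt
  rw [not_le] at hlt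
  nlinarith [mul_pos (sub_pos.mpr h) (sub_pos.mpr hlt)]

theorem alpha_eq_of_opt {θ₁ θ₂ : ℝ} {p q : ι} (hp : p ∈ OptA T α σ θ₁) (hq : q ∈ OptA T α σ θ₂) (hσ : σ p = σ q) :
    α p = α q := by
  have h1 := (mem_OptA.mp hp).2 q (mem_OptA.mp hq).1
  have h2 := (mem_OptA.mp hq).2 p (mem_OptA.mp hp).1
  rw [hσ] at h1 h2
  linarith

/-- THE ENVELOPE LEMMA: if inside every optimal set `Ψ` rises strictly towards the right vertex (F3), then `Ψ` rises strictly from any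
optimal element at slope `θ₁` to the right vertex at any slope `θ₂ ≥ θ₁` with larger `σ` (strong induction on the crossing set). -/
theorem envelope (Ψv : ι → ℕ)
    (F3 : ∀ θ : ℝ, ∀ p ∈ OptA T α σ θ, ∀ q ∈ RVA T α σ θ, σ p < σ q → Ψv p < Ψv q) :
    ∀ (M : ℕ) {θ₁ θ₂ : ℝ} {p q : ι}, θ₁ ≤ θ₂ → p ∈ OptA T α σ θ₁ → q ∈ RVA T α σ θ₂ → σ p < σ q →
      (T.filter fun o => σ p < σ o).card = M → Ψv p < Ψv q := by
  intro M
  induction M using Nat.strong_induction_on with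
  | _ M ih =>
    intro θ₁ θ₂ p q h12 hp hq hσ hM
    obtain ⟨hpT, hpopt⟩ := mem_OptA.mp hp
    have hqO : q ∈ OptA T α σ θ₂ := (mem_RVA.mp hq).1
    have hqT : q ∈ T := (mem_OptA.mp hqO).1
    -- the crossing set and the next breakpoint `μ`
    have hmemC : ∀ {o : ι}, o ∈ T.filter (fun o => σ p < σ o) ↔ o ∈ T ∧ σ p < σ o := fun {o} => Finset.mem_filter
    have hqC : q ∈ T.filter (fun o => σ p < σ o) := hmemC.mpr ⟨hqT, hσ⟩
    have hCne : (T.filter fun o => σ p < σ o).Nonempty := ⟨q, hqC⟩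
    have hκne : ((T.filter fun o => σ p < σ o).image fun o => (α p - α o) / (σ o - σ p)).Nonempty := hCne.image _
    obtain ⟨μ, hμdef⟩ : ∃ μ : ℝ, μ = ((T.filter fun o => σ p < σ o).image fun o => (α p - α o) / (σ o - σ p)).min' hκne :=
      ⟨_, rfl⟩
    have hμle : ∀ o ∈ T.filter (fun o => σ p < σ o), μ ≤ (α p - α o) / (σ o - σ p) := fun o ho =>
      hμdef ▸ Finset.min'_le _ _ (Finset.mem_image_of_mem (fun o => (α p - α o) / (σ o - σ p)) ho)
    have h1μ : θ₁ ≤ μ := by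
      rw [hμdef]
      refine Finset.le_min' _ _ _ fun y hy => ?_
      obtain ⟨o, ho, rfl⟩ := Finset.mem_image.mp hy
      obtain ⟨hoT, hσo⟩ := hmemC.mp ho
      have := hpopt o hoT
      rw [le_div_iff₀ (sub_pos.mpr hσo), mul_sub]
      linarith
    obtain ⟨θs, hθsdef⟩ : ∃ θs : ℝ, θs = min θ₂ μ := ⟨_, rfl⟩
    have h1s : θ₁ ≤ θs := hθsdef ▸ le_min h12 h1μ
    have hs2 : θs ≤ θ₂ := hθsdef ▸ min_le_left _ _
    have hsμ : θs ≤ μ := hθsdef ▸ min_le_right _ _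
    -- `p` stays optimal up to `θs`
    have hpOs : p ∈ OptA T α σ θs := by
      refine mem_OptA.mpr ⟨hpT, fun o hoT => ?_⟩
      have hpo := hpopt o hoT
      by_cases hσo : σ p < σ o
      · have hk : θs ≤ (α p - α o) / (σ o - σ p) := hsμ.trans (hμle o (hmemC.mpr ⟨hoT, hσo⟩))
        rw [le_div_iff₀ (sub_pos.mpr hσo), mul_sub] at hk
        linarith
      · rw [not_lt] at hσo
        have : (θs - θ₁) * σ o ≤ (θs - θ₁) * σ p := mul_le_mul_of_nonneg_left hσo (sub_nonneg.mpr h1s)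
        rw [sub_mul, sub_mul] at this
        linarith
    -- the right vertex at `θs`
    obtain ⟨qs, hqs⟩ := RVA_nonempty (α := α) (σ := σ) ⟨p, hpT⟩ θs
    obtain ⟨hqsO, hqsmax⟩ := mem_RVA.mp hqs
    have hqsT : qs ∈ T := (mem_OptA.mp hqsO).1
    rcases eq_or_lt_of_le hs2 with hEq | hLt
    · rw [hEq] at hpOs
      exact F3 θ₂ p hpOs q hq hσ
    · -- `θs = μ < θ₂`: a crossing element is optimal at `θs`, so the right vertex has larger `σ`
      have hμ2 : μ < θ₂ := by
        by_contra hh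
        rw [not_lt] at hh
        rw [hθsdef, min_eq_left hh] at hLt
        exact lt_irrefl _ hLt
      have hsEq : θs = μ := by rw [hθsdef, min_eq_right hμ2.le]
      obtain ⟨o₀, ho₀C, hκo₀⟩ := Finset.mem_image.mp (hμdef ▸ Finset.min'_mem _ hκne)
      obtain ⟨ho₀T, hσo₀⟩ := hmemC.mp ho₀C
      have hrel : α p - α o₀ = μ * (σ o₀ - σ p) := (div_eq_iff (ne_of_gt (sub_pos.mpr hσo₀))).mp hκo₀
      have ho₀O : o₀ ∈ OptA T α σ θs := by
        refine mem_OptA.mpr ⟨ho₀T, fun o' ho' => ?_⟩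
        have := (mem_OptA.mp hpOs).2 o' ho'
        rw [hsEq] at this ⊢
        rw [mul_sub] at hrel
        linarith
      have hσqs : σ p < σ qs := lt_of_lt_of_le hσo₀ (hqsmax o₀ ho₀O)
      have hΨ1 : Ψv p < Ψv qs := F3 θs p hpOs qs hqs hσqs
      rcases lt_or_eq_of_le (sigma_le_of_opt hLt hqsO hqO) with hlt2 | heq2
      · have hcard : (T.filter fun o => σ qs < σ o).card < M := by
          rw [← hM]
          refine Finset.card_lt_card (Finset.ssubset_iff_subset_ne.mpr ⟨fun o ho => ?_, fun hEq' => ?_⟩)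
          · obtain ⟨hoT, hlo⟩ := Finset.mem_filter.mp ho
            exact Finset.mem_filter.mpr ⟨hoT, hσqs.trans hlo⟩
          · have : qs ∈ T.filter fun o => σ qs < σ o := by
              rw [hEq']
              exact Finset.mem_filter.mpr ⟨hqsT, hσqs⟩
            exact lt_irrefl _ (Finset.mem_filter.mp this).2
        exact hΨ1.trans (ih _ hcard hs2 hqsO hq hlt2 rfl)
      · have hαq : α qs = α q := alpha_eq_of_opt hqsO hqO heq2
        have hqOs : q ∈ OptA T α σ θs := by
          refine mem_OptA.mpr ⟨hqT, fun o' ho' => ?_⟩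
          have := (mem_OptA.mp hqsO).2 o' ho'
          rw [hαq, heq2] at this
          exact this
        have hqRs : q ∈ RVA T α σ θs := mem_RVA.mpr ⟨hqOs, fun o' ho' => heq2 ▸ hqsmax o' ho'⟩
        exact F3 θs p hpOs q hqRs hσ

theorem envelope_lt (Ψv : ι → ℕ)
    (F3 : ∀ θ : ℝ, ∀ p ∈ OptA T α σ θ, ∀ q ∈ RVA T α σ θ, σ p < σ q → Ψv p < Ψv q)
    {θ₁ θ₂ : ℝ} (h : θ₁ < θ₂) {p q : ι} (hp : p ∈ RVA T α σ θ₁) (hq : q ∈ RVA T α σ θ₂)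
    (hne : ¬ (α p = α q ∧ σ p = σ q)) : Ψv p < Ψv q := by
  have hpO := (mem_RVA.mp hp).1
  have hqO := (mem_RVA.mp hq).1
  rcases lt_or_eq_of_le (sigma_le_of_opt h hpO hqO) with hlt | heq
  · exact envelope Ψv F3 _ h.le hpO hq hlt rfl
  · exact absurd ⟨alpha_eq_of_opt hpO hqO heq, heq⟩ hne

/-- A right vertex is a point class: it is determined by the `(α, σ)`-value of any member. -/
theorem RVA_eq_of_ptEq {θ₁ θ₂ : ℝ} {p q : ι} (hp : p ∈ RVA T α σ θ₁) (hq : q ∈ RVA T α σ θ₂)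
    (h : α p = α q ∧ σ p = σ q) : RVA T α σ θ₁ = RVA T α σ θ₂ := by
  suffices key : ∀ {θ θ' : ℝ} {p q : ι}, p ∈ RVA T α σ θ → q ∈ RVA T α σ θ' → (α p = α q ∧ σ p = σ q) →
      RVA T α σ θ ⊆ RVA T α σ θ' from
    Finset.Subset.antisymm (key hp hq h) (key hq hp ⟨h.1.symm, h.2.symm⟩)
  intro θ θ' p q hp hq h o ho
  obtain ⟨hpO, hpmax⟩ := mem_RVA.mp hp
  obtain ⟨hqO, hqmax⟩ := mem_RVA.mp hq
  obtain ⟨hoO, homax⟩ := mem_RVA.mp ho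
  have hσo : σ o = σ p := le_antisymm (hpmax o hoO) (homax p hpO)
  have hαo : α o = α p := alpha_eq_of_opt hoO hpO hσo
  have hoT : o ∈ T := (mem_OptA.mp hoO).1
  have hoO' : o ∈ OptA T α σ θ' := by
    refine mem_OptA.mpr ⟨hoT, fun o' ho' => ?_⟩
    have := (mem_OptA.mp hqO).2 o' ho'
    rw [hαo, hσo, h.1, h.2]
    exact this
  exact mem_RVA.mpr ⟨hoO', fun o' ho' => by rw [hσo, h.2]; exact hqmax o' ho'⟩

theorem PhiA_lt (Ψv : ι → ℕ)
    (F3 : ∀ θ : ℝ, ∀ p ∈ OptA T α σ θ, ∀ q ∈ RVA T α σ θ, σ p < σ q → Ψv p < Ψv q)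
    (hT : T.Nonempty) {θ₁ θ₂ : ℝ} (h : θ₁ < θ₂)
    (hne : ∀ p ∈ RVA T α σ θ₁, ∀ q ∈ RVA T α σ θ₂, ¬ (α p = α q ∧ σ p = σ q)) :
    PhiA T α σ Ψv θ₁ < PhiA T α σ Ψv θ₂ := by
  obtain ⟨p₀, hp₀, hsup⟩ := Finset.exists_mem_eq_sup _ (RVA_nonempty (α := α) (σ := σ) hT θ₁) Ψv
  obtain ⟨q₀, hq₀⟩ := RVA_nonempty (α := α) (σ := σ) hT θ₂
  unfold PhiA
  rw [hsup]
  exact lt_of_lt_of_le (envelope_lt Ψv F3 h hp₀ hq₀ (hne p₀ hp₀ q₀ hq₀)) (Finset.le_sup hq₀)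

/-- `N` FACTORS THROUGH `Φ`: equal envelope potential ⇒ the same right vertex. -/
theorem RVA_eq_of_PhiA_eq (Ψv : ι → ℕ)
    (F3 : ∀ θ : ℝ, ∀ p ∈ OptA T α σ θ, ∀ q ∈ RVA T α σ θ, σ p < σ q → Ψv p < Ψv q)
    (hT : T.Nonempty) {θ₁ θ₂ : ℝ} (h : PhiA T α σ Ψv θ₁ = PhiA T α σ Ψv θ₂) :
    RVA T α σ θ₁ = RVA T α σ θ₂ := by
  by_cases hex : ∃ p ∈ RVA T α σ θ₁, ∃ q ∈ RVA T α σ θ₂, α p = α q ∧ σ p = σ q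
  · obtain ⟨p, hp, q, hq, hpq⟩ := hex
    exact RVA_eq_of_ptEq hp hq hpq
  · have hne : ∀ p ∈ RVA T α σ θ₁, ∀ q ∈ RVA T α σ θ₂, ¬ (α p = α q ∧ σ p = σ q) :=
      fun p hp q hq hpq => hex ⟨p, hp, q, hq, hpq⟩
    rcases lt_trichotomy θ₁ θ₂ with hlt | heq | hgt
    · exact absurd h (ne_of_lt (PhiA_lt Ψv F3 hT hlt hne))
    · rw [heq]
    · have hne' : ∀ q ∈ RVA T α σ θ₂, ∀ p ∈ RVA T α σ θ₁, ¬ (α q = α p ∧ σ q = σ p) :=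
        fun q hq p hp hqp => hne p hp q hq ⟨hqp.1.symm, hqp.2.symm⟩
      exact absurd h.symm (ne_of_lt (PhiA_lt Ψv F3 hT hgt hne'))

theorem PhiA_le (Ψv : ι → ℕ) {B : ℕ} (hB : ∀ p ∈ T, Ψv p ≤ B) (θ : ℝ) : PhiA T α σ Ψv θ ≤ B :=
  Finset.sup_le fun p hp => hB p (mem_OptA.mp (mem_RVA.mp hp).1).1

/-- THE LINE FAMILY: along one pencil of slopes the right vertices take at most `B + 1` values. -/
theorem exists_lineFamily {κ : Type*} [DecidableEq κ] (Ψv : ι → ℕ)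
    (F3 : ∀ θ : ℝ, ∀ p ∈ OptA T α σ θ, ∀ q ∈ RVA T α σ θ, σ p < σ q → Ψv p < Ψv q)
    (hT : T.Nonempty) {B : ℕ} (hB : ∀ p ∈ T, Ψv p ≤ B) (Nf : Finset ι → κ) :
    ∃ 𝒩 : Finset κ, 𝒩.card ≤ B + 1 ∧ (∀ θ : ℝ, Nf (RVA T α σ θ) ∈ 𝒩) ∧
      ∀ N ∈ 𝒩, ∃ θ : ℝ, N = Nf (RVA T α σ θ) := by
  let θof : ℕ → ℝ := fun k => if h : ∃ θ : ℝ, PhiA T α σ Ψv θ = k then Classical.choose h else 0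
  refine ⟨(Finset.range (B + 1)).image fun k => Nf (RVA T α σ (θof k)), ?_, fun θ => ?_, fun N hN => ?_⟩
  · exact Finset.card_image_le.trans (by simp)
  · refine Finset.mem_image.mpr ⟨PhiA T α σ Ψv θ, Finset.mem_range.mpr (Nat.lt_succ_of_le (PhiA_le Ψv hB θ)), ?_⟩
    have hex : ∃ θ' : ℝ, PhiA T α σ Ψv θ' = PhiA T α σ Ψv θ := ⟨θ, rfl⟩
    have hθof : θof (PhiA T α σ Ψv θ) = Classical.choose hex := dif_pos hex
    rw [hθof, RVA_eq_of_PhiA_eq Ψv F3 hT (Classical.choose_spec hex)]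
  · obtain ⟨k, -, rfl⟩ := Finset.mem_image.mp hN
    exact ⟨θof k, rfl⟩

end Envelope

/-! ### Assembly: the sweep over all weights -/

section Sweep

theorem wt_add_smul (ν ζ : Fin 2 → ℝ) (θ : ℝ) (e : Expo) : wt (ν + θ • ζ) e = wt ν e + θ * wt ζ e := by
  simp only [wt, Pi.add_apply, Pi.smul_apply, smul_eq_mul]
  ring

theorem wtZ_add_smul (ν ζ : Fin 2 → ℝ) (θ : ℝ) (d : Fin 2 → ℤ) : wtZ (ν + θ • ζ) d = wtZ ν d + θ * wtZ ζ d := by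
  simp only [wtZ, Pi.add_apply, Pi.smul_apply, smul_eq_mul]
  ring

theorem wt_smul (t : ℝ) (ξ : Fin 2 → ℝ) (e : Expo) : wt (t • ξ) e = t * wt ξ e := by
  simp only [wt, Pi.smul_apply, smul_eq_mul]
  ring

theorem wtZ_smul (t : ℝ) (ξ : Fin 2 → ℝ) (d : Fin 2 → ℤ) : wtZ (t • ξ) d = t * wtZ ξ d := by
  simp only [wtZ, Pi.smul_apply, smul_eq_mul]
  ring

theorem score_add_smul (x : Fin n → Expo) (d : Fin 2 → ℤ) (ν ζ : Fin 2 → ℝ) (θ : ℝ) (hζ : wtZ ζ d = 0) {r : ℕ}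
    (β : Fin r → Fin n) (s : ℕ) : score (ν + θ • ζ) x d β s = score ν x d β s + θ * wsum ζ x β := by
  simp only [score, wsum, wt_add_smul, wtZ_add_smul, hζ, Finset.sum_add_distrib, Finset.mul_sum]
  ring

theorem score_smul (x : Fin n → Expo) (d : Fin 2 → ℤ) (t : ℝ) (ξ : Fin 2 → ℝ) {r : ℕ} (β : Fin r → Fin n) (s : ℕ) :
    score (t • ξ) x d β s = t * score ξ x d β s := by
  simp only [score, wsum, wt_smul, wtZ_smul, mul_add, Finset.mul_sum]
  ring

variable (γ γ' : Fin m → Fin n → ℂ[X]) (x : Fin n → Expo) (d : Fin 2 → ℤ)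

/-- All pairs `(β, s)` with `[z^s] minor(ρ, β) ≠ 0`. -/
def Tset {r : ℕ} (ρ : Fin r → Fin m ⊕ Fin m) : Finset ((Fin r → Fin n) × ℕ) :=
  (Finset.univ : Finset (Fin r → Fin n)).biUnion fun β => ((minorT γ γ' ρ β).support).image fun s => (β, s)

theorem mem_Tset {r : ℕ} {ρ : Fin r → Fin m ⊕ Fin m} {p : (Fin r → Fin n) × ℕ} :
    p ∈ Tset γ γ' ρ ↔ (minorT γ γ' ρ p.1).coeff p.2 ≠ 0 := by
  rcases p with ⟨β, s⟩
  simp only [Tset, Finset.mem_biUnion, Finset.mem_univ, true_and, Finset.mem_image, Prod.mk.injEq]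
  constructor
  · rintro ⟨β', s', hs', rfl, rfl⟩
    exact Polynomial.mem_support_iff.mp hs'
  · intro h
    exact ⟨β, s, Polynomial.mem_support_iff.mpr h, rfl, rfl⟩

/-- The `ξ`-optimal pairs. -/
def OptT (ξ : Fin 2 → ℝ) {r : ℕ} (ρ : Fin r → Fin m ⊕ Fin m) : Finset ((Fin r → Fin n) × ℕ) :=
  (Tset γ γ' ρ).filter fun p => ∀ q ∈ Tset γ γ' ρ, score ξ x d q.1 q.2 ≤ score ξ x d p.1 p.2

theorem mem_OptT {ξ : Fin 2 → ℝ} {r : ℕ} {ρ : Fin r → Fin m ⊕ Fin m} {p : (Fin r → Fin n) × ℕ} :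
    p ∈ OptT γ γ' x d ξ ρ ↔ IsOpt γ γ' x d ξ ρ p.1 p.2 := by
  simp only [OptT, Finset.mem_filter, mem_Tset, IsOpt]
  constructor
  · rintro ⟨h1, h2⟩
    exact ⟨h1, fun β' s' hs' => h2 (β', s') hs'⟩
  · rintro ⟨h1, h2⟩
    exact ⟨h1, fun q hq => h2 q.1 q.2 hq⟩

theorem OptT_nonempty {r : ℕ} {ρ : Fin r → Fin m ⊕ Fin m} (hT : (Tset γ γ' ρ).Nonempty) (ξ : Fin 2 → ℝ) :
    (OptT γ γ' x d ξ ρ).Nonempty := by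
  obtain ⟨p, hp, hmax⟩ := Finset.exists_max_image _ (fun q : (Fin r → Fin n) × ℕ => score ξ x d q.1 q.2) hT
  exact ⟨p, Finset.mem_filter.mpr ⟨hp, hmax⟩⟩

theorem OptT_smul {t : ℝ} (ht : 0 < t) (ξ : Fin 2 → ℝ) {r : ℕ} (ρ : Fin r → Fin m ⊕ Fin m) :
    OptT γ γ' x d (t • ξ) ρ = OptT γ γ' x d ξ ρ := by
  unfold OptT
  refine Finset.filter_congr fun p hp => ?_
  simp only [score_smul]
  refine forall₂_congr fun q hq => ⟨fun h => le_of_mul_le_mul_left h ht, fun h => mul_le_mul_of_nonneg_left h ht.le⟩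

theorem OptT_line (ν ζ : Fin 2 → ℝ) (hζ : wtZ ζ d = 0) (θ : ℝ) {r : ℕ} (ρ : Fin r → Fin m ⊕ Fin m) :
    OptT γ γ' x d (ν + θ • ζ) ρ
      = OptA (Tset γ γ' ρ) (fun p => score ν x d p.1 p.2) (fun p => wsum ζ x p.1) θ := by
  unfold OptT OptA
  refine Finset.filter_congr fun p hp => ?_
  simp only [score_add_smul x d ν ζ θ hζ]

/-- (F3) on a line: inside `Opt(ν + θζ)` the rank potential rises strictly towards the right vertex (`psi_chain`). -/
theorem F3_line (ν ζ : Fin 2 → ℝ) (hζ : wtZ ζ d = 0) {r : ℕ} (ρ : Fin r → Fin m ⊕ Fin m) :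
    ∀ θ : ℝ, ∀ p ∈ OptA (Tset γ γ' ρ) (fun p => score ν x d p.1 p.2) (fun p => wsum ζ x p.1) θ,
      ∀ q ∈ RVA (Tset γ γ' ρ) (fun p => score ν x d p.1 p.2) (fun p => wsum ζ x p.1) θ,
        wsum ζ x p.1 < wsum ζ x q.1 → Psi ζ x p.1 < Psi ζ x q.1 := by
  intro θ p hp q hq hσ
  have hqO : q ∈ OptT γ γ' x d (ν + θ • ζ) ρ := by
    rw [OptT_line γ γ' x d ν ζ hζ θ ρ]
    exact (mem_RVA.mp hq).1
  have hp' : p ∈ OptT γ γ' x d (ν + θ • ζ) ρ := by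
    rw [OptT_line γ γ' x d ν ζ hζ θ ρ]
    exact hp
  have hqI : IsOpt γ γ' x d (ν + θ • ζ) ρ q.1 q.2 := (mem_OptT γ γ' x d).mp hqO
  have hpI : IsOpt γ γ' x d (ν + θ • ζ) ρ p.1 p.2 := (mem_OptT γ γ' x d).mp hp'
  have hlam : ∀ (β' : Fin r → Fin n) (s' : ℕ), IsOpt γ γ' x d (ν + θ • ζ) ρ β' s' → wsum ζ x β' ≤ wsum ζ x q.1 := by
    intro β' s' h'
    have hmem : (β', s') ∈ OptT γ γ' x d (ν + θ • ζ) ρ := (mem_OptT γ γ' x d).mpr h'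
    rw [OptT_line γ γ' x d ν ζ hζ θ ρ] at hmem
    exact (mem_RVA.mp hq).2 (β', s') hmem
  have key := psi_chain ζ hqI hlam
    ((Finset.univ.filter fun u => p.1 u ∉ Finset.univ.image q.1).card) p.1 p.2 hpI rfl
  exact key.2 hσ

/-- Cramer cover: the record letters at `ξ` are columns of ANY `ξ`-optimal selection. -/
theorem letters_subset_of_isOpt {r : ℕ} {ρ : Fin r → Fin m ⊕ Fin m}
    (hmax : ∀ (ρ' : Fin (r + 1) → Fin m ⊕ Fin m) (β' : Fin (r + 1) → Fin n), minorT γ γ' ρ' β' = 0)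
    {ξ : Fin 2 → ℝ} {β : Fin r → Fin n} {s : ℕ} (h : IsOpt γ γ' x d ξ ρ β s) (m' : ℕ) :
    recordLettersAt γ γ' x d m' ξ ⊆ Finset.univ.image β := by
  intro a ha
  simp only [recordLettersAt, Finset.mem_filter, Finset.mem_univ, true_and] at ha
  obtain ⟨S, k, hrec, hSa⟩ := ha
  by_contra hna
  have ha' : ∀ q, β q ≠ a := fun q hq => hna (Finset.mem_image.mpr ⟨q, Finset.mem_univ _, hq⟩)
  have hopt' : ∀ β' : Fin r → Fin n, ∀ s' ∈ (minorT γ γ' ρ β').support,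
      wsum ξ x β' + (s' : ℝ) * wtZ ξ d ≤ wsum ξ x β + (s : ℝ) * wtZ ξ d :=
    fun β' s' hs' => h.2 β' s' (Polynomial.mem_support_iff.mp hs')
  exact cramerRecordLemma γ γ' x d m' ξ S k hrec ρ β s h.1 hmax hopt' a hSa ha'

/-- A maximal non-vanishing minor of the pencil matrix (`r ≤ 2m`). -/
theorem exists_max_minor : ∃ r : ℕ, r ≤ 2 * m ∧ ∃ (ρ : Fin r → Fin m ⊕ Fin m) (β₀ : Fin r → Fin n),
    minorT γ γ' ρ β₀ ≠ 0 ∧ ∀ (ρ' : Fin (r + 1) → Fin m ⊕ Fin m) (β' : Fin (r + 1) → Fin n), minorT γ γ' ρ' β' = 0 := by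
  let P : ℕ → Prop := fun k => ∀ (ρ : Fin k → Fin m ⊕ Fin m) (β : Fin k → Fin n), minorT γ γ' ρ β = 0
  have hP : P (2 * m + 1) := by
    intro ρ β
    obtain ⟨p, p', hne, heq⟩ := Fintype.exists_ne_map_eq_of_card_lt ρ (by simp; omega)
    exact Matrix.det_zero_of_row_eq hne (funext fun u => by simp [Matrix.of_apply, heq])
  have hex : ∃ k, P k := ⟨_, hP⟩
  have h0 : ¬ P 0 := by
    intro h
    have := h Fin.elim0 Fin.elim0
    rw [minorT, Matrix.det_fin_zero] at this
    exact one_ne_zero this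
  obtain ⟨r, hr⟩ : ∃ r, Nat.find hex = r + 1 :=
    Nat.exists_eq_succ_of_ne_zero (fun h => h0 (h ▸ Nat.find_spec hex))
  have hmax : P (r + 1) := hr ▸ Nat.find_spec hex
  have hr2 : r ≤ 2 * m := by
    have := Nat.find_le (h := hex) hP
    omega
  have hnot : ¬ P r := Nat.find_min hex (by omega)
  simp only [P, not_forall] at hnot
  obtain ⟨ρ, β₀, hβ₀⟩ := hnot
  exact ⟨r, hr2, ρ, β₀, hβ₀, hmax⟩

/-- An orthogonal frame adapted to `d`: `ζ ⊥ d`, and every weight decomposes as `a ν + b ζ`. -/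
theorem exists_frame : ∃ ν ζ : Fin 2 → ℝ, wtZ ζ d = 0 ∧ ∀ ξ : Fin 2 → ℝ, ∃ a b : ℝ, ξ = a • ν + b • ζ := by
  obtain ⟨d0, hd0⟩ : ∃ d0 : ℝ, d0 = ((d 0 : ℤ) : ℝ) := ⟨_, rfl⟩
  obtain ⟨d1, hd1⟩ : ∃ d1 : ℝ, d1 = ((d 1 : ℤ) : ℝ) := ⟨_, rfl⟩
  by_cases hd : d0 = 0 ∧ d1 = 0
  · refine ⟨![1, 0], ![0, 1], ?_, fun ξ => ⟨ξ 0, ξ 1, ?_⟩⟩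
    · simp only [wtZ, ← hd0, ← hd1, hd.1, hd.2]
      simp
    · funext i
      fin_cases i <;> simp
  · have hD : 0 < d0 ^ 2 + d1 ^ 2 := by
      rcases not_and_or.mp hd with h | h
      · have : 0 < d0 ^ 2 := by positivity
        nlinarith [sq_nonneg d1]
      · have : 0 < d1 ^ 2 := by positivity
        nlinarith [sq_nonneg d0]
    have hDne : d0 ^ 2 + d1 ^ 2 ≠ 0 := ne_of_gt hD
    refine ⟨![d0, d1], ![-d1, d0], ?_, fun ξ =>
      ⟨(ξ 0 * d0 + ξ 1 * d1) / (d0 ^ 2 + d1 ^ 2), (-(ξ 0) * d1 + ξ 1 * d0) / (d0 ^ 2 + d1 ^ 2), ?_⟩⟩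
    · simp only [wtZ, ← hd0, ← hd1]
      simp
      ring
    · funext i
      fin_cases i
      · simp
        field_simp
        ring
      · simp
        field_simp
        ring

theorem arith_walk {m n r : ℕ} (hm : 1 ≤ m) (hn : 1 ≤ n) (hr : r ≤ 2 * m) :
    (r * (n - 1) + 1) + (r * (n - 1) + 1) + 3 ≤ 4 * m * n + 4 := by
  obtain ⟨n', rfl⟩ : ∃ n', n = n' + 1 := ⟨n - 1, by omega⟩
  have h1 : r * (n' + 1 - 1) ≤ 2 * m * n' := by
    rw [Nat.add_sub_cancel]
    exact Nat.mul_le_mul_right _ hr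
  nlinarith

/-- **VERTEX WALK BOUND, PROVED**: `≤ 4mn + 4` sets of `≤ 2m` letters cover the record letters of every real weight. -/
theorem vertexWalkBound_holds : VertexWalkBound := by
  intro m n γ γ' x d
  -- degenerate sizes
  by_cases hmn : m = 0 ∨ n = 0
  · refine ⟨{∅}, by simp, by simp, fun ξ => ⟨∅, by simp, ?_⟩⟩
    rcases hmn with hm | hn
    · subst hm
      intro a ha
      simp only [recordLettersAt, Finset.mem_filter, Finset.mem_univ, true_and] at ha
      obtain ⟨S, k, hrec, -⟩ := ha
      have h := hrec.1
      simp only [liveT, Set.mem_setOf_eq, layerT, momentPolyT] at h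
      exact absurd (by simp) h.2
    · subst hn
      intro a _
      exact a.elim0
  have hm : 1 ≤ m := Nat.pos_of_ne_zero fun h => hmn (Or.inl h)
  have hn : 1 ≤ n := Nat.pos_of_ne_zero fun h => hmn (Or.inr h)
  -- a maximal minor, the pair set, the frame
  obtain ⟨r, hr, ρ, β₀, hβ₀, hmax⟩ := exists_max_minor γ γ'
  obtain ⟨ν, ζ, hζ, hframe⟩ := exists_frame d
  have hT : (Tset γ γ' ρ).Nonempty := by
    obtain ⟨s, hs⟩ := Finset.nonempty_iff_ne_empty.mpr (mt Polynomial.support_eq_empty.mp hβ₀)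
    exact ⟨(β₀, s), (mem_Tset γ γ').mpr (Polynomial.mem_support_iff.mp hs)⟩
  have hB : ∀ p ∈ Tset γ γ' ρ, (fun p : (Fin r → Fin n) × ℕ => Psi ζ x p.1) p ≤ r * (n - 1) :=
    fun p _ => Psi_le ζ x p.1
  -- the line families for `+ν + θζ` and `-ν + θζ`
  let rng : (Fin r → Fin n) × ℕ → Finset (Fin n) := fun p => Finset.univ.image p.1
  let Nof : Finset ((Fin r → Fin n) × ℕ) → Finset (Fin n) := fun R =>
    Finset.univ.filter fun a => ∀ p ∈ R, a ∈ rng p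
  obtain ⟨𝒩p, hcp, hmp, hep⟩ := exists_lineFamily (T := Tset γ γ' ρ) (α := fun p => score ν x d p.1 p.2)
    (σ := fun p => wsum ζ x p.1) (fun p => Psi ζ x p.1) (F3_line γ γ' x d ν ζ hζ ρ) hT hB Nof
  obtain ⟨𝒩m, hcm, hmm, hem⟩ := exists_lineFamily (T := Tset γ γ' ρ) (α := fun p => score (-ν) x d p.1 p.2)
    (σ := fun p => wsum ζ x p.1) (fun p => Psi ζ x p.1) (F3_line γ γ' x d (-ν) ζ hζ ρ) hT hB Nof
  -- fixed optimal selections for the directions `ζ`, `-ζ`, `0`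
  obtain ⟨pζ, hpζ⟩ := OptT_nonempty γ γ' x d hT ζ
  obtain ⟨pζ', hpζ'⟩ := OptT_nonempty γ γ' x d hT (-ζ)
  obtain ⟨p0, hp0⟩ := OptT_nonempty γ γ' x d hT 0
  have hrng : ∀ p : (Fin r → Fin n) × ℕ, (rng p).card ≤ 2 * m := fun p =>
    Finset.card_image_le.trans (by simp [hr])
  have hNof : ∀ (R : Finset ((Fin r → Fin n) × ℕ)), R.Nonempty → (Nof R).card ≤ 2 * m := by
    intro R ⟨p, hp⟩
    refine (Finset.card_le_card fun a ha => ?_).trans (hrng p)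
    exact (Finset.mem_filter.mp ha).2 p hp
  -- covering by an optimal selection
  have hcov : ∀ (ξ : Fin 2 → ℝ) (p : (Fin r → Fin n) × ℕ), p ∈ OptT γ γ' x d ξ ρ →
      recordLettersAt γ γ' x d m ξ ⊆ rng p := fun ξ p hp =>
    letters_subset_of_isOpt γ γ' x d hmax ((mem_OptT γ γ' x d).mp hp) m
  have hcovN : ∀ (ξ : Fin 2 → ℝ) (R : Finset ((Fin r → Fin n) × ℕ)), R ⊆ OptT γ γ' x d ξ ρ →
      recordLettersAt γ γ' x d m ξ ⊆ Nof R := by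
    intro ξ R hR a ha
    exact Finset.mem_filter.mpr ⟨Finset.mem_univ _, fun p hp => hcov ξ p (hR hp) ha⟩
  refine ⟨𝒩p ∪ 𝒩m ∪ {rng pζ, rng pζ', rng p0}, ?_, ?_, ?_⟩
  · -- count
    calc (𝒩p ∪ 𝒩m ∪ {rng pζ, rng pζ', rng p0}).card
        ≤ (𝒩p ∪ 𝒩m).card + ({rng pζ, rng pζ', rng p0} : Finset (Finset (Fin n))).card := Finset.card_union_le _ _
      _ ≤ (𝒩p.card + 𝒩m.card) + 3 := add_le_add (Finset.card_union_le _ _) Finset.card_le_three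
      _ ≤ (r * (n - 1) + 1) + (r * (n - 1) + 1) + 3 := by omega
      _ ≤ 4 * m * n + 4 := arith_walk hm hn hr
  · -- sizes
    intro N hN
    rcases Finset.mem_union.mp hN with hN | hN
    · rcases Finset.mem_union.mp hN with hN | hN
      · obtain ⟨θ, rfl⟩ := hep N hN
        exact hNof _ (RVA_nonempty hT θ)
      · obtain ⟨θ, rfl⟩ := hem N hN
        exact hNof _ (RVA_nonempty hT θ)
    · simp only [Finset.mem_insert, Finset.mem_singleton] at hN
      rcases hN with rfl | rfl | rfl <;> exact hrng _
  · -- cover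
    intro ξ
    obtain ⟨a, b, hab⟩ := hframe ξ
    rcases lt_trichotomy 0 a with ha | ha | ha
    · -- `a > 0`: the line `ν + θζ`, `θ = b / a`
      have hθ : ξ = a • (ν + (b / a) • ζ) := by
        have : a * (b / a) = b := by field_simp
        rw [hab, smul_add, smul_smul, this]
      refine ⟨Nof (RVA (Tset γ γ' ρ) (fun p => score ν x d p.1 p.2) (fun p => wsum ζ x p.1) (b / a)),
        Finset.mem_union_left _ (Finset.mem_union_left _ (hmp _)), hcovN ξ _ fun p hp => ?_⟩
      rw [hθ, OptT_smul γ γ' x d ha, OptT_line γ γ' x d ν ζ hζ]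
      exact (mem_RVA.mp hp).1
    · -- `a = 0`: `ξ = b ζ`
      rw [← ha, zero_smul, zero_add] at hab
      rcases lt_trichotomy 0 b with hb | hb | hb
      · refine ⟨rng pζ, by simp, hcov ξ pζ ?_⟩
        rw [hab, OptT_smul γ γ' x d hb]
        exact hpζ
      · refine ⟨rng p0, by simp, hcov ξ p0 ?_⟩
        rw [hab, ← hb, zero_smul]
        exact hp0
      · refine ⟨rng pζ', by simp, hcov ξ pζ' ?_⟩
        have hθ : ξ = (-b) • (-ζ) := by rw [hab, smul_neg, neg_smul, neg_neg]
        rw [hθ, OptT_smul γ γ' x d (neg_pos.mpr hb)]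
        exact hpζ'
    · -- `a < 0`: the line `-ν + θζ`, `θ = b / (-a)`
      have hθ : ξ = (-a) • (-ν + (b / (-a)) • ζ) := by
        have hane : a ≠ 0 := ha.ne
        have : (-a) * (b / (-a)) = b := by field_simp
        rw [hab, smul_add, smul_smul, this, smul_neg, neg_smul, neg_neg]
      refine ⟨Nof (RVA (Tset γ γ' ρ) (fun p => score (-ν) x d p.1 p.2) (fun p => wsum ζ x p.1) (b / (-a))),
        Finset.mem_union_left _ (Finset.mem_union_right _ (hmm _)), hcovN ξ _ fun p hp => ?_⟩
      rw [hθ, OptT_smul γ γ' x d (neg_pos.mpr ha), OptT_line γ γ' x d (-ν) ζ hζ]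
      exact (mem_RVA.mp hp).1

/-- **LEVEL-FREE RECORD LAW, PROVED** (`(a, b) = (11, 1)`): arbitrary pencils, arbitrary levels and heights. -/
theorem levelFreeRecordLaw_holds : LevelFreeRecordLaw := levelFree_of_vertexWalk vertexWalkBound_holds

end Sweep

/-! ## Audit -/
example : TowerRecordLaw := towerRecordLaw_holds
example : ThreeLevelRecordLaw := threeLevelRecordLaw_holds
example (ℓ : ℕ) (hℓ : 1 ≤ ℓ) : SparseLevelRecordLaw ℓ := sparseLevelRecordLaw_holds ℓ hℓ
example : VertexWalkBound → LevelFreeRecordLaw := levelFree_of_vertexWalk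
example : VertexWalkBound := vertexWalkBound_holds
example : LevelFreeRecordLaw := levelFreeRecordLaw_holds
/-- The level-free law, unfolded: `2^{11m}·(t+2)` records for ARBITRARY pencils whenever `n ≤ 2mt`. -/
example : ∃ a b : ℕ, ∀ (m n t D : ℕ) (γ γ' : Fin m → Fin n → ℂ[X]) (x : Fin n → Expo) (d : Fin 2 → ℤ),
    DegLe γ D → DegLe γ' D → n ≤ 2 * m * t →
    ((shallowPairsT n m D).filter fun p => ∃ ξ : Fin 2 → ℝ, IsRecordT γ γ' x d m ξ p).card ≤ 2 ^ (a * m) * (t + 2) ^ b :=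
  levelFreeRecordLaw_holds

end ValIdea37g4T

end

#print axioms ValIdea37g4T.towerRecordLemma
#print axioms ValIdea37g4T.card_cellLettersT_le
#print axioms ValIdea37g4T.towerRecordLaw_holds
#print axioms ValIdea37g4T.threeLevelRecordLaw_holds
#print axioms ValIdea37g4T.sparseLevelRecordLaw_holds
#print axioms ValIdea37g4T.card_recordLettersAt_le
#print axioms ValIdea37g4T.levelFree_of_vertexWalk
#print axioms ValIdea37g4T.opt_exchange
#print axioms ValIdea37g4T.psi_chain
#print axioms ValIdea37g4T.envelope
#print axioms ValIdea37g4T.vertexWalkBound_holds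
#print axioms ValIdea37g4T.levelFreeRecordLaw_holds
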